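import Summits.Ventures.HSemireg.Pad4TowerB1OddBoostBlind
import Summits.Ventures.HSemireg.Pad4TowerSeedFCUnit

/-!
# Crux workfile — lens «control» on H2 ∕ (B1-odd) (stmt-HodgeConjecture-18881): TOWER LAWS, TRACE & COLLAR, TRACE-FREE RE-BASING, CEILING RIGIDITY I–II, POSITION SPLIT, FLOOR RIGIDITY, X⁺ SIBLING EXCLUSION, NO PERPENDICULAR CEILING PAIR, (AP_h), TOP-CHILD UNIQUENESS + G₁-COROLLARIES

HONEST FRAMING. Crux workfile of the LENSES-v3 ideator `plan-lens-HodgeAV-control` (g0–g4; director-hodge req-36, lens «control» =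
controlling quantity; critic of record idea-crit-6). It is the Cruxes-side copy of §10–§23 of the lens's HOME `Sketch.lean` v21
(20d3ee9ade68c89e; v20 = 1df281dd41b57e27∕Sketch a11700ea3ebdbb26, v19 = a94a96a06cb6c2b1, v18 = 636f36d1d035dd0a, v17 = 3ad2831a14854bb1, v16 = 84a3c34cf1c746c3, v15 = fd2cadec838a97b9, v14 = eb97ce68db0f1881, v13 = 500524a4b7bf822e); §1–§9 of that Sketch are NOT repeated here because they are LANDED in the tree (`Pad4TowerB1OddSpanControl`, p659231;
`Pad4TowerB1OddBoostBlind`, p663032) and are imported instead (dedup rule; the companion `B1OddSpanControl.lean` in this directory stays a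
pointer stub). Census-neutral: definitions and lemmas ABOUT THE TYPED STATIC PREDICATES of `Summits/Ventures/HSemireg/Pad4Tower*`
(`CellRealisable`, `InDiamond`, `RuleDMu4N∕P`, `XPlusClosed`, `A2IMinusClosed`, `G1Closed`). EVERY LAW named (WL) ∕ (IR) ∕ (UC) ∕ (BR) ∕ (NT) ∕ (NFC) ∕
(CL_h) ∕ (sIR) ∕ (IR-FC) ∕ (TB_h) ∕ (TBA_h) ∕ (CT) ∕ (CT-FC) ∕ (TAF_h) ∕ (UUL) below is a `def … : Prop` in HYPOTHESIS FORM — conjectural, NOT asserted,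
NOT a theorem; (BR) is moreover REFUTED at the machine level by the ◇₈ census points (§14.5, kernel `not_boostRigidity_of_census` from the two
census facts as hypotheses) and the unrestricted (IR) ∕ (UC) ∕ (sIR) ∕ (CT) at (6, 8) by the solver row O1 (kit j318577 x-ir13 SAT ×2) — they are
kept as the record of the line, never as progress. What is PROVED are implications between the laws, pure diamond geometry, the trace theorems
of §14, the ceiling rigidity lemmas of §15.3 ∕ §16 and the position split ∕ b-leg menu of §17. Nothing here is an object, a σ, a seed or a census row; NOTHING HERE SAYS THAT HC ∕ HC_CM ∕ HC_AV ∕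
H2 ∕ (T_8) HOLDS OR FAILS; (T_8) = `SeedB1OddDiamond8G1H1` and (W′) = `SeedFCPCeilingUnitDiamond8G1H1` are machine ×2 (+ third code), not kernel
theorems. Research route conditional on HC_CM (displayed binder only); width toward H2 = 0. No `sorry`, no `axiom`, no `instance`, no notation,
no Literature fact. Farm `lean check`: see the `ledger crux write` record.

CONTENTS. §10 window law (`inDiamond_iff_window`, `cellRealisable_window_mp` PROVED; (WL) hypothesis form). §11 (IR) ∕ (UC) and their PROVED
relations. §12 (BR) ∕ (NT) ∕ (CL_h) `RealFCClassified`; `realFCClassified_antitone` (unconditional); the (BR)-chains (vacuous since §14.5 — kept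
for the record). §13 `realFCClassified_eight_iff_pCeilingUnit : CL_8 ↔ (W′)` PROVED; `tall_iff_floor_and_ceiling` PROVED; (NFC). §14 TRACE AND
COLLAR: ◇_h is a causal down-set; the ◇_h-trace of an admissible ◇_{h′} configuration keeps `InDiamond h`, `G₁`, RULE D at N-cells and the A2I⁻
family (PROVED: `trace_g1Closed`, `trace_ruleDN`, `trace_a2iMinusClosed`, `trace_admissible`); (sIR), (IR-FC), (TB_h) `TopBandFCUnits`, (TBA_h)
`TopBandFCUnitsAnchored`, the PROVED reduction `topBand_of_anchored` (span control), §14.5 `not_boostRigidity_of_census`, §14.7 the typed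
collar (CT) ∕ (CT-FC) `CollaredTraceFC` (LINE 2's first open lemma of record, director-hodge R17.26 (3); under the pre-registered model-level
test F3d, hsemireg bus l.33756 ∕ R17.56). §15 (g3) TRACE-FREE RE-BASING: (TAF_h) `TallAnchoredFCUnits`; PROVED `realFCClassified_step_tall :
TAF_h → CL_h → CL_{h+2}`, `seedB1Odd_all_of_tall : (∀ n, TAF_{8+2n}) → (W′) → ∀ n, T_{8+2n}`, `tallAnchored_of_IRFC_TBA`, `topBandAnchored_of_tall`;
the cone form (UUL) `UpperUnitLawCone` ⇔ ∀ h CL_h; and CEILING RIGIDITY `ceilingUnit_forces_bLegs` (h-uniform kernel lemma: RULE D inside ◇_h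
forces the four b-legs `N[hI|((h−2)I+ℓ_u)³]` under `P[(h−2)I+ℓ_u]⁴`; sibling of the tree's LEMMA L `lift_of_ceiling_unit_h` of
`Pad4TowerSeedB1OddCeiling`, where the other factor is the apex `hI`). §16 (g3, v14) CEILING RIGIDITY II (PROVED, h-uniform): a charged letter on the
ceiling line `t + 2c = h` pins every other factor — `settledAbove_of_ceiling_letter`, `antipodalServer_of_ceiling_letter`,
`ownServer_of_ceiling_letter`, `fcc_of_ownServer`; corollaries `fc_touching_ceiling_flat_of_noFCN` (no FC `N`-cells ⇒ FC `P`-cells touching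
the ceiling are ceiling-flat) and `apexLift_of_ceiling_letter_noFCN` (… and carry all apex lifts); §16.2 `tallAnchored_of_classified`,
`tallAnchored_six_of_W'` (first rung (TAF_6) ⇐ (W′)), `realFCClassified_all_iff_tall : (∀ n, CL_{8+2n}) ↔ CL_8 ∧ ∀ n, TAF_{8+2n}`.
§17 (g3, v15) THE POSITION SPLIT (PROVED, h-uniform): `tallAnchored_iff_split : TAF_h ↔ TallNoFCN h ∧ CeilingFlatUnitLaw h ∧ TallNoFloorFCP h ∧
TallInteriorFCP h` (N-cells ∣ ceiling-touching P ∣ floor-touching P ∣ interior P; the four class laws are hypothesis-form, OPEN), with the ceiling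
class SHRUNK by the §16 engine to the residual «ceiling-flat FC `P`-cell with all four apex lifts ⇒ diagonal unit» (`tallCeilingFCP_of_noFCN_flatUnit`),
`seedB1Odd_all_of_split`; §17.2 the unit's second rung `bLeg_menu` (typed RULE D at the b-leg: sibling ∨ server ∨ cover, as typed cells) and
`unitServer_of_flatUnits` (in a flat-unit world the servers `[(h−2)I+ℓ_u]⁴[j ↦ hI, g ↦ (h−2−2e)I+(1+e)ℓ_u]`, `e ≥ 1`, are forced for every ordered
pair `(j,g)`; composition with anomaly's `UnitLaw.unit_law` stated on paper in the §17 docstring — the farm cannot import the unbuilt Cruxes module).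
Critic's words of record (idea-crit-6 g5 23:11:38Z, director R17.72): LINE 2′ PASS-WITH-PRICE, interior OPEN, progress = kernel lemmas shrinking the
classes h-uniformly, never census rows; the (8,10) face is read only under the fixed words (α)–(δ).
§18 (g3, v16) FLOOR RIGIDITY (PROVED, h-uniform; the mirror of §16 at `N`-cells): `below_floor_letter`, `settledBelow_of_floor_letter`,
`ownDrop_of_floor_letter`, `antipodalDrop_of_floor_letter`; under «no FC `P`-cell touches the floor»: `fcN_touching_floor_flat_of_noFloorFCP` and
`oDrop_of_floor_letter_noFloorFCP` (floor-touching FC `N`-cells are floor-flat with all four O-drops `Z[j ↦ O] ∈ C.upper`); §18.2 `TallNoFloorFCN`,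
`TallNoLiftedFCN`, residual `FloorFlatDropLaw`, PROVED `tallNoFloorFCN_of_noFloorFCP_flatDrop`, `tallNoFCN_iff_lifted_flatDrop`, `tallAnchored_iff_split5`
(both window ends reduced to flat residuals; open middle = lifted FC `N`-cells ∧ interior FC `P`-cells).
§19 (g3, v17) X⁺ SIBLING EXCLUSION (PROVED, h-uniform; the first kernel use of the encoder's `X+` family here): `xPlus_sibling_exclusion` (an
`X+`-closed configuration has no `N`-cell with two `P`-children below it on one factor in two directions, given «only lower σ-variant» and a top
letter), `xPlus_apex_children_exclusion` (children `(t−2)I + ℓ_a ≠ (t−2)I + ℓ_c` of `tI`), `xPlus_perpPair_apex_exclusion` (with `G₁`: a cell with a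
PERPENDICULAR unit pair and axis letters elsewhere supplies its own sibling — the ◇₈ peel's round-1 pattern). MACHINE STATUS at v17 (R18.2 ∕ R18.7):
(TAF₈) ∕ (CL₁₀) and the §17–§18 class laws at h = 8 are REFUTED AS TYPED by kit j317021 rows 1 ∕ 5 (see the §19 docstring); §15–§18 stand as implications.
§20 (g3, v18) NO PERPENDICULAR CEILING PAIR (PROVED, h-uniform): `xPlus_sibling_exclusion_sharp` (§19 with «only variant» replaced by «lowest
partner above» + (H-e′)), `effective_top_bsub_of_inDiamond` ∕ `level_le_of_inDiamond` (the window discharges both at the top letter),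
`xPlus_top_children_exclusion`, `xPlus_perpPair_top_exclusion`, and **`noPerpCeilingPair_of_ruleD` ∕ `noPerpCeilingPair`**: under `InDiamond h`,
`G1Closed`, `StaticH1` (RULE D-P supplies the apex lift via §16 `antipodalServer_of_ceiling_letter`; `X+` kills; `A2I−` unused) NO `P`-cell has two
perpendicular ceiling units `(h−2)I+ℓ_a`, `(h−2)I+ℓ_{a±1}`, a top letter `hI` and an axis fourth letter — a census-free class exclusion inside the
hypotheses of (T_h), matching the peel data ×1 (◇₈: 5∕5 and ◇₁₀: 6∕6 such orbits die in round 1 by `Xp`; antipodal analogues die late or survive).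
§21 (g3, v19) THE ANTIPODAL-CLASS LAW (AP_h) IN HYPOTHESIS FORM (typed at the director's invitation R18.44, after (CP₁₀) «constant phase» was
REFUTED at machine level ×2-instrument by the realisable 2+2 antipodal cell `P[8I+ℓ₋₁²|8I+ℓ₁²]` — gs-eng-2 g55's residual instrument + this seat's port
replay, hsemireg l.34327 ∕ l.34330 ∕ R18.44): `sbit`, `MCell.spar`, `MCell.APConcl`, **`AntipodalClassLaw h`** («phases of a present FC cell lie in ONE
antipodal class with EVEN multiplicity of each»), the bridge `seedB1Odd_of_antipodalClassLaw : (AP_h) → (T_h)` (RENAMES (T_h) per critic E-2 until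
(AP_h) has an independent reason — stated in the docstring), `antipodalClassLaw_antitone`, and `apConcl_probes` (`decide`: the law separates the
booked-realisable C-antimix22 cell from the residual-UNSAT C-antimix31 cell and from the perpendicular and odd cells). NOT proved for any h; no census section.
§22 (g4, v20) APEX RIVALRY ∕ TOP-CHILD UNIQUENESS (PROVED, h-uniform, census-free; engine `X+`, lift RULE D-P): `settledAbove_of_topLetter` (a top
letter `hI` is stuck: nothing of `◇_h` lies above level `h`), `inwardLift_of_topLetter` ∕ `apexLift_of_topLetter` (so RULE D-P forces the inward lift of
every charged factor — the apex twin of §16), **`apexRivalry_of_ruleD`** (a head with a top letter and a ceiling-line letter `(h−2e)I + eℓ_a` on `σ`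
excludes every rival ceiling unit `(h−2)I + ℓ_c`, `c ≠ a`, among the `P`-cells agreeing with it off `σ`, given no intermediate lower lift),
**`topChild_unique`** (`e = 1`, hypothesis-free under the hypotheses of (T_h): two `P`-cells agreeing off `σ` with ceiling units there and a
common top letter have the same phase) and `apexRivalry_two` (`e = 2`, one absent cell named) — the h-uniform form of ALL 48 `X+` clauses of
g55's three ◇₁₀ FC-unit MUS cores and of 738∕939 `X+` clauses of its 32 cores (reader `pred/musmap.py`); §20's `noPerpCeilingPair` is the
`G₁`-sibling sub-case. Silent on 4-charged FC cells (no top letter); not (AP_h), not (T_h).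
§23 (g4, v21) `G₁`-COROLLARIES OF TOP-CHILD UNIQUENESS (PROVED, h-uniform, census-free): `G1_orbit_mem`, **`topChild_unique_orbit`** (rival inside
the cell's own `G₁`-orbit) ⇒ **`noLoneCeilingUnit`** (lone ceiling unit among apexes under `hI`; rival `Δ Z`) and **`noAntipodalPairUnit`** (antipodal
pair `ℓ_a, ℓ_{a+2}` + ANY third ceiling unit under `hI`; rival `Δ²` of the pair's transposition) — incl. the «2+1 antipodal» ODD-multiplicity class
(`no_top_antipodal21_ten`) = the ◇₁₀ peel's round-1 top-letter `Xp` deaths (kit j318002); uncovered neighbours booked SAT (g55 census.json). Not (AP_h)∕(T_h).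
SIZE: this workfile is at the 200 000-byte cap with v21; later sections go to a second workfile.

SOURCES: HOME `run/shared/lean/pub/ideators/plan-lens-HodgeAV-control/Sketch.v21-20d3ee9ade68c89e.lean` (v20 a11700ea3ebdbb26, v19 a94a96a06cb6c2b1, v18 636f36d1d035dd0a, v17 3ad2831a14854bb1, v16 84a3c34cf1c746c3) (+ HANDOFF.md §3 for the pre-registered
census tests F2 ∕ F2′ ∕ F3a ∕ F3d and their fixed reading words); crux idea `Ideas/b1odd-span-control.md`; tree `Pad4TowerRuleDMu4`,
`Pad4TowerDiamondMu4`, `Pad4TowerSeedB1Odd`, `Pad4TowerSeedFCUnit`, `Pad4TowerSeedB1OddCeiling` (LEMMA C ∕ L uniform in h, gs-eng-2). -/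

namespace Summit.Ventures.HSemireg.Pad4Tower
open Finset

/-! ## §10 (g2, 2026-08-28) THE WINDOW LAW — RG consistency of realisability across heights (LINE 1 addendum 3)
The windows themselves are RG-consistent: `◇_h = ◇_{h+2} ∩ (◇_{h+2} − 2I)` letterwise (`inDiamond_iff_window`, PROVED). §9 gives the
rigorous half of the same identity for TRUE realisability, `Real_h ⊆ Real_{h+2} ∩ (Real_{h+2} − 2I)` (`cellRealisable_window_mp`,
PROVED). The **WINDOW LAW (WL)** `RealisableWindowLaw` is the conjectural converse: a cell realisable at `h+2` whose `+2I` translate is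
also realisable at `h+2` is realisable at `h` — «floor obstructions and ceiling obstructions do not interact». TABLE EVIDENCE (peel =
UP over-approximation of `Real`): at `(h, h+2) = (6, 8)` the law holds EXACTLY — `Surv₆` (◇₆ H₁-peel, 48 orbits, hsemireg INBOX l.32711)
`= {O ∈ ◇₆ : O, O+2I ∈ Surv₈}` (48 orbits of gs2∕g53 j309861 `peel_table`, pre-registered `pred/D6-survivors-predicted.txt`
457cd93c5f785a00; inclusion rigorous + equal counts ⇒ equality). TEST at `(8, 10)` = gs2∕g53 kit j313137 (PREREG dd6eeaf705c32404):
`pred/D10-inplace-deaths-predicted.txt` lists the 25 orbits `O ∈ ◇₈ ∖ Surv₈` with `O + 2I ∈ Surv₈` — (WL) at table level says every one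
is peel-DEAD at ◇₁₀ although its translate survives; the only FC one is the diagonal unit `P[4I+ℓ_u]⁴`.
CONSEQUENCE PROVED HERE (`window_gap_persists`): under (WL) a census GAP «`Z ∉ Real_h`, `Z + 2I ∈ Real_h`» persists at EVERY height
`h + 2n` — so (WL) + the two ◇₈ data points «`[4I+ℓ_u]⁴ ∉ Real₈`» (peel j309861, round 14) and «`[6I+ℓ_u]⁴ ∈ Real₈`» (model j298438
8d3ee082b6d8b019) give the h-UNIFORM statement «the diagonal unit `[4I+ℓ_u]⁴` is realisable at NO height, `[6I+ℓ_u]⁴` at every height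
`≥ 8`»: the controlling number `κ(h) = min {t : DiagUnitRealisable h t}` can never take the value 4 (`diagUnit_four_never`). Nothing
here is evidence about any support of record; (WL) is a HYPOTHESIS-FORM def, not asserted; HC ∕ HC_CM ∕ HC_AV ∕ H2 ∕ (T_8) NOT proved. -/

/-- the windows are RG-consistent, letterwise: `x ∈ ◇_h ↔ x ∈ ◇_{h+2} ∧ x + 2I ∈ ◇_{h+2}`. -/
theorem inDiamond_iff_window (h : ℤ) (x : BPoint) :
    InDiamond h x ↔ InDiamond (h + 2) x ∧ InDiamond (h + 2) (boostPt 2 x) := by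
  constructor
  · intro hx
    exact ⟨inDiamond_mono (by omega) hx,
      inDiamond_boostPt hx (by decide) (by have := hx.2.1; omega) (by have := hx.2.2.2; omega)⟩
  · rintro ⟨h1, h2⟩
    refine ⟨h1.1, h1.2.1, h1.2.2.1, ?_⟩
    have e : (boostPt 2 x).1 + absCharge (boostPt 2 x) = x.1 + 2 + absCharge x := rfl
    have := h2.2.2.2
    omega

/-- cellwise: `Z ∈ ◇_h ↔ Z ∈ ◇_{h+2} ∧ Z + 2I ∈ ◇_{h+2}`. -/
theorem mcell_inDiamond_iff_window (h : ℤ) (Z : MCell) :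
    Z.InDiamond h ↔ Z.InDiamond (h + 2) ∧ (Z.boost 2).InDiamond (h + 2) :=
  ⟨fun H => ⟨fun f => ((inDiamond_iff_window h (Z f)).mp (H f)).1, fun f => ((inDiamond_iff_window h (Z f)).mp (H f)).2⟩,
    fun H f => (inDiamond_iff_window h (Z f)).mpr ⟨H.1 f, H.2 f⟩⟩

/-- the RIGOROUS half of the window law for true realisability (§9): `Real_h ⊆ Real_{h+2} ∩ (Real_{h+2} − 2I)`. -/
theorem cellRealisable_window_mp {h : ℤ} {b : Bool} {Z : MCell} (H : CellRealisable h b Z) :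
    CellRealisable (h + 2) b Z ∧ CellRealisable (h + 2) b (Z.boost 2) :=
  ⟨cellRealisable_mono (by omega) H, cellRealisable_boost H⟩

/-- **(WL) THE WINDOW LAW (HYPOTHESIS FORM, conjectural; NOT asserted)**: `Real_{h+2} ∩ (Real_{h+2} − 2I) ⊆ Real_h` — a cell realisable
at height `h + 2` whose `+2I` translate is also realisable at `h + 2` is realisable at `h` («floor and ceiling obstructions do not
interact»). Table-level instance `(6, 8)` confirmed (48 = 48); `(8, 10)` is kit j313137's peel on the 25-orbit list. -/
def RealisableWindowLaw : Prop :=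
  ∀ h : ℤ, ∀ b : Bool, ∀ Z : MCell,
    CellRealisable (h + 2) b Z → CellRealisable (h + 2) b (Z.boost 2) → CellRealisable h b Z

/-- **GAP PERSISTENCE (PROVED, conditional on (WL) only)**: a census gap «`Z` unrealisable, `Z + 2I` realisable» at height `h` persists at
every height `h + 2n`. [induction on `n`: the translate stays realisable by `cellRealisable_mono`; if `Z` became realisable at `h + 2n + 2`,
(WL) with the realisable translate would make it realisable at `h + 2n`.] -/
theorem window_gap_persists (W : RealisableWindowLaw) {h : ℤ} {b : Bool} {Z : MCell}
    (hlo : ¬ CellRealisable h b Z) (hhi : CellRealisable h b (Z.boost 2)) (n : ℕ) :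
    ¬ CellRealisable (h + 2 * n) b Z ∧ CellRealisable (h + 2 * n) b (Z.boost 2) := by
  induction n with
  | zero => simpa using ⟨hlo, hhi⟩
  | succ m ih =>
    obtain ⟨ihlo, ihhi⟩ := ih
    have e : h + 2 * ((m + 1 : ℕ) : ℤ) = h + 2 * (m : ℤ) + 2 := by push_cast; ring
    rw [e]
    exact ⟨fun H => ihlo (W _ b Z H (cellRealisable_mono (by omega) ihhi)), cellRealisable_mono (by omega) ihhi⟩

/-- `DiagUnitRealisable` is upper-level realisability of some phase of the diagonal unit. -/
theorem diagUnitRealisable_iff (h t : ℤ) : DiagUnitRealisable h t ↔ ∃ k, CellRealisable h false (diagUnit t k) := by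
  constructor
  · rintro ⟨C, hU, hG, hS, k, hk⟩
    exact ⟨k, C, hU, hG, hS, by simpa using hk⟩
  · rintro ⟨k, C, hU, hG, hS, hk⟩
    exact ⟨C, hU, hG, hS, k, by simpa using hk⟩

/-- **`κ(h) ≠ 4` AT EVERY HEIGHT, conditional on (WL) and the two ◇₈ census points as HYPOTHESES** (phase by phase: `[4I+ℓ_k]⁴ ∉ Real₈`
— peel j309861 round 14, an UNREALISABILITY the peel certifies; `[6I+ℓ_k]⁴ ∈ Real₈` — the j298438 model, by `Δ`-closure in every phase):
the diagonal unit `[4I+ℓ_k]⁴` is realisable at NO height `8 + 2n` while `[6I+ℓ_k]⁴` is realisable at all of them. First test: j313137. -/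
theorem diagUnit_four_never (W : RealisableWindowLaw) (k : Fin 4)
    (h4 : ¬ CellRealisable 8 false (diagUnit 4 k)) (h6 : CellRealisable 8 false (diagUnit 6 k)) (n : ℕ) :
    ¬ CellRealisable (8 + 2 * n) false (diagUnit 4 k) ∧ CellRealisable (8 + 2 * n) false (diagUnit 6 k) := by
  have hb : (diagUnit 4 k).boost 2 = diagUnit 6 k := by rw [boost_diagUnit]; norm_num
  have := window_gap_persists W h4 (hb ▸ h6) n
  rwa [hb] at this


/-! ## §11 (v7, g2) TOWER RIGIDITY — the two one-sided laws behind (WL), typed; what the ◇₁₀ peel (kit j313137) measures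

Raising the ceiling by two does two things to the realisable family: it may REVIVE cells in place (`Real_{h+2} ∩ ◇_h ⊋ Real_h`?) and it
may add cells in the new top band. (IR) IN-PLACE RIGIDITY says the first never happens: a cell of the old diamond is realisable under the
higher ceiling iff it was realisable under the old one (`⇐` is `cellRealisable_mono`, PROVED §9). (UC) UP-CLOSURE says a cell of the old
diamond realisable under the higher ceiling has its `+2I` translate realisable there too. PROVED here: (IR) ⇒ (WL); (WL) ∧ (UC) ⇒ (IR) —
so on the data the window law splits into two separately measurable one-sided statements: «no in-place revivals» (IR: `Surv₁₀ ∩ ◇₈ ⊆ Surv₈`)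
and «no orphan survivors» (UC: `O ∈ Surv₁₀ ∩ ◇₈ ⇒ O + 2I ∈ Surv₁₀`); prediction files F2 6648ccaea2744931 ∕ F2′ v2 8de21bd41e6d5b78, reader
`pred∕d10check.py`. All three are HYPOTHESIS-FORM defs, NOT asserted; nothing here is evidence about a support of record; HC ∕ HC_CM ∕ HC_AV ∕
H2 ∕ (T_8) NOT proved. -/

/-- **(IR) IN-PLACE RIGIDITY (HYPOTHESIS FORM, conjectural; NOT asserted)**: `Real_{h+2} ∩ ◇_h ⊆ Real_h` — raising the ceiling by two
revives no cell of the old diamond. -/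
def InPlaceRigidity : Prop :=
  ∀ h : ℤ, ∀ b : Bool, ∀ Z : MCell, Z.InDiamond h → CellRealisable (h + 2) b Z → CellRealisable h b Z

/-- **(UC) UP-CLOSURE (HYPOTHESIS FORM, conjectural; NOT asserted)**: a cell of `◇_h` realisable at height `h + 2` has its `+2I`
translate realisable at height `h + 2`. -/
def UpClosure : Prop :=
  ∀ h : ℤ, ∀ b : Bool, ∀ Z : MCell, Z.InDiamond h → CellRealisable (h + 2) b Z → CellRealisable (h + 2) b (Z.boost 2)

/-- a realisable cell lies in the diamond of its height. -/
theorem inDiamond_of_cellRealisable {h : ℤ} {b : Bool} {Z : MCell} (H : CellRealisable h b Z) : Z.InDiamond h := by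
  obtain ⟨C, hU, -, -, hZ⟩ := H
  cases b
  · exact hU.2 Z (by simpa using hZ)
  · exact hU.1 Z (by simpa using hZ)

/-- **(IR) ⇒ (WL)** (PROVED): if both `Z` and `Z + 2I` are realisable at `h + 2` then both lie in `◇_{h+2}`, so `Z ∈ ◇_h` by the
window identity `mcell_inDiamond_iff_window`, and in-place rigidity puts `Z` in `Real_h`. -/
theorem windowLaw_of_inPlaceRigidity (R : InPlaceRigidity) : RealisableWindowLaw := fun h b Z H1 H2 =>
  R h b Z ((mcell_inDiamond_iff_window h Z).mpr ⟨inDiamond_of_cellRealisable H1, inDiamond_of_cellRealisable H2⟩) H1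

/-- **(WL) ∧ (UC) ⇒ (IR)** (PROVED): the converse split. -/
theorem inPlaceRigidity_of_windowLaw (W : RealisableWindowLaw) (U : UpClosure) : InPlaceRigidity := fun h b Z hZ H =>
  W h b Z H (U h b Z hZ H)

/-- **(IR) ⇔ (WL) ∧ (UC′)** in the usable direction for the census: under (IR), `Real_{h+2}` restricted to the old diamond IS `Real_h`
(PROVED; `⊇` is `cellRealisable_mono`). -/
theorem real_restrict_eq_of_inPlaceRigidity (R : InPlaceRigidity) {h : ℤ} {b : Bool} {Z : MCell} (hZ : Z.InDiamond h) :
    CellRealisable (h + 2) b Z ↔ CellRealisable h b Z :=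
  ⟨R h b Z hZ, cellRealisable_mono (by omega)⟩

/-- under (IR), a cell of `◇_h` unrealisable at height `h` is unrealisable at EVERY larger even height (PROVED; iterate). -/
theorem never_revived_of_inPlaceRigidity (R : InPlaceRigidity) {h : ℤ} {b : Bool} {Z : MCell} (hZ : Z.InDiamond h)
    (hno : ¬ CellRealisable h b Z) (n : ℕ) : ¬ CellRealisable (h + 2 * n) b Z := by
  induction n with
  | zero => simpa using hno
  | succ m ih =>
    intro H
    have e : h + 2 * ((m + 1 : ℕ) : ℤ) = h + 2 * (m : ℤ) + 2 := by push_cast; ring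
    rw [e] at H
    exact ih (R _ b Z (fun f => inDiamond_mono (by omega) (hZ f)) H)


/-! ## §12 (v8, g2) WHAT THE RIGIDITY LAWS BUY: the FC CLASSIFICATION at all heights from ONE height + a two-ends lemma (PROVED implication)

(CL_h) «every realisable FC cell at height h is an upper-level diagonal unit `[tI+ℓ_k]⁴` with `t ≥ 6`» is the sharp, boost-invariant
form of (DUL-h) ∕ (CUL-8): it implies (DUL-h) and (T_h), it is ANTITONE in `h` unconditionally (`cellRealisable_mono`), and — the point
of this section — it PROPAGATES UPWARD under the two rigidity laws (IR) (§11) and (BR) below plus the TWO-ENDS statement (NT) «a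
realisable FC cell never touches floor band and ceiling band at once» (every realisable FC cell of `◇_{h+2}` lies in `◇_h` or in `◇_h + 2I`):
`(IR) ∧ (BR) ∧ (NT) ∧ (CL_8) ⇒ ∀ n, (CL_{8+2n})` ⇒ `(T_h)` at every even `h ≥ 8` (and below by antitonicity). So K2 ∕ (DUL-∞) splits into
two CENSUS-MEASURABLE tower laws (revivals = 0, translated revivals = 0: j309860 ∕ j309861 ∕ j313137 peel tables), ONE height's
classification (◇₈: third code j309715 «≥ 2 letters» ∕ «diagonal non-unit» ∕ «diagonal off units» UNSAT ×1, encoder (W′) j312296 UNSAT ×2)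
and the two-ends lemma (NT), whose ingredients are the tree's h-uniform FLOOR RAISE ∕ SWAP KILL (`Pad4TowerSeedB1OddFloor`, g53) and
CEILING KILL (`Pad4TowerSeedB1OddCeiling`). All four are HYPOTHESIS-FORM here; only the implication is a kernel theorem; HC ∕ HC_CM ∕
HC_AV ∕ H2 ∕ (T_8) NOT proved. -/

/-- **(BR) BOOST RIGIDITY (HYPOTHESIS FORM, conjectural; NOT asserted)**: `Real_{h+2} ∩ (◇_h + 2I) ⊆ Real_h + 2I` — a translate
`Z + 2I` realisable under the higher ceiling comes from a `Z` realisable under the old one (`⊇` is `cellRealisable_boost`, PROVED §9). -/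
def BoostRigidity : Prop :=
  ∀ h : ℤ, ∀ b : Bool, ∀ Z : MCell, Z.InDiamond h → CellRealisable (h + 2) b (Z.boost 2) → CellRealisable h b Z

/-- **(NT) NO TALL FC CELLS (HYPOTHESIS FORM, conjectural; NOT asserted)**: a realisable FC cell of `◇_{h+2}` lies in the lower window
`◇_h` or is the `+2I` translate of a cell of `◇_h` — it never carries a floor-cone letter and a ceiling-band letter at once. -/
def NoTallFC : Prop :=
  ∀ h : ℤ, ∀ b : Bool, ∀ Z : MCell, FCc Z → CellRealisable (h + 2) b Z →
    Z.InDiamond h ∨ ∃ Y : MCell, Y.InDiamond h ∧ Z = Y.boost 2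

/-- **(CL_h) THE FC CLASSIFICATION AT HEIGHT h (HYPOTHESIS FORM; at `h = 8` machine ×1 third code + ×2 encoder, NOT a kernel theorem)**:
every realisable FC cell is an UPPER-level diagonal unit `[tI+ℓ_k]⁴` with `t ≥ 6`. -/
def RealFCClassified (h : ℤ) : Prop :=
  ∀ b : Bool, ∀ Z : MCell, FCc Z → CellRealisable h b Z → b = false ∧ ∃ t : ℤ, ∃ k : Fin 4, 6 ≤ t ∧ Z = diagUnit t k

/-- (CL) is antitone in the height (PROVED, unconditional). -/
theorem realFCClassified_antitone {h h' : ℤ} (hh : h ≤ h') (H : RealFCClassified h') : RealFCClassified h :=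
  fun b Z hfc hZ => H b Z hfc (cellRealisable_mono hh hZ)

/-- **UPWARD STEP (PROVED implication)**: `(IR) → (BR) → (NT) → (CL_h) → (CL_{h+2})`. -/
theorem realFCClassified_step (R : InPlaceRigidity) (B : BoostRigidity) (T : NoTallFC) {h : ℤ} (H : RealFCClassified h) :
    RealFCClassified (h + 2) := by
  intro b Z hfc hZ
  rcases T h b Z hfc hZ with hlow | ⟨Y, hY, rfl⟩
  · exact H b Z hfc (R h b Z hlow hZ)
  · obtain ⟨hb, t, k, ht, rfl⟩ := H b Y ((boost_fcc 2 Y).mp hfc) (B h b Y hY hZ)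
    exact ⟨hb, t + 2, k, by omega, boost_diagUnit 2 t k⟩

/-- **ALL HEIGHTS FROM ONE (PROVED implication)**: `(IR) ∧ (BR) ∧ (NT) ∧ (CL_8) ⇒ (CL_{8+2n})` for every `n`. -/
theorem realFCClassified_all (R : InPlaceRigidity) (B : BoostRigidity) (T : NoTallFC) (H8 : RealFCClassified 8) (n : ℕ) :
    RealFCClassified (8 + 2 * n) := by
  induction n with
  | zero => simpa using H8
  | succ m ih =>
    have e : (8 : ℤ) + 2 * ((m + 1 : ℕ) : ℤ) = 8 + 2 * (m : ℤ) + 2 := by push_cast; ring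
    rw [e]; exact realFCClassified_step R B T ih

/-- (CL_h) ⇒ (DUL-h) (PROVED): a classified support has only diagonal FC cells. -/
theorem seedFCDiagonal_of_classified {h : ℤ} (H : RealFCClassified h) : SeedFCDiagonalDiamondG1H1 h := by
  intro C hU hG hS Z hZ hfc f g
  rcases hZ with hZ | hZ
  · exact absurd (H true Z hfc ⟨C, hU, hG, hS, by simpa using hZ⟩).1 (by decide)
  · obtain ⟨-, t, k, -, rfl⟩ := H false Z hfc ⟨C, hU, hG, hS, by simpa using hZ⟩
    rfl

/-- (CL_h) ⇒ (T_h) (PROVED): in particular `(IR) ∧ (BR) ∧ (NT) ∧ (CL_8)` give the B1-odd statement at EVERY height `8 + 2n`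
— and at every `h ≤ 8 + 2n` by `seedB1OddDiamondG1H1_antitone`. -/
theorem seedB1Odd_all_of_rigidity (R : InPlaceRigidity) (B : BoostRigidity) (T : NoTallFC) (H8 : RealFCClassified 8) (n : ℕ) :
    SeedB1OddDiamondG1H1 (8 + 2 * n) :=
  seedB1Odd_of_diagonal (seedFCDiagonal_of_classified (realFCClassified_all R B T H8 n))


/-! ## §13 (v9, g2) THE CRITIC'S (C3-5) AND (C3-4): `(CL_8)` IS `(W′)`; the normal form of `(NT)` = «no FC cell touches floor and ceiling»

(C3-5) `realFCClassified_eight_iff_pCeilingUnit : RealFCClassified 8 ↔ SeedFCPCeilingUnitDiamond8G1H1` (PROVED): the height-8 FC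
classification of §12 is LITERALLY the typed sharper target (W′) of `Pad4TowerSeedFCUnit` (machine ×1 third code — the ◇₈ peel j309861 — and
×2 encoder-side, (W′) j312296 UNSAT ×2, R16.23; NOT a kernel theorem). Hence the §12 chain in its honest minimal form
`seedB1Odd_all_of_rigidity_W' : IR → BR → NT → (W′) → ∀ n, T_{8+2n}` — ONE machine row instead of a second machine-side classification.
(C3-4) `(NT)` in normal form: for a cell of `◇_{h+2}` (h even), «in `◇_h` or a `+2I` translate of a `◇_h` cell» fails iff the cell has a letter ON
THE CEILING LINE `α + c = h + 2` AND a letter ON THE FLOOR LINE `α = c` (`tall_iff_floor_and_ceiling`, PROVED, pure diamond geometry); so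
`NoTallFC ↔ NoFloorCeilingFC` («no realisable FC cell carries a floor letter and a ceiling letter at once», PROVED equivalence). None of its
clauses is a kernel consequence of the tree's h-uniform kills as they stand (`a2i_floor_raise` ∕ `a2i_swap_kill` ∕ `level_transfer_of_cancellation`
act on floor UNIT letters `ℓ_u` of `N`-cells with a present cancellation; `xplus_ceiling_kill_h` ∕ `not_mem_apex_apex_cu_top_h` on `P`-cells
`[x|y|(h−2)I+ℓ_u|hI]` with apex `x, y` — not FC); the normal form names the census class to read: FC orbits with `min t = 0` and `max (t+2c) = h+2`. -/

/-- the charge of a unit table letter is `1`. -/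
theorem absCharge_diamondLetter_one (t : ℤ) (k : Fin 4) : absCharge (diamondLetter t 1 k) = 1 := by
  fin_cases k <;> simp [absCharge, chargeOf]

/-- a diagonal unit `[tI+ℓ_k]⁴` inside `◇_h` has `t + 2 ≤ h`. -/
theorem diagUnit_inDiamond_le {h t : ℤ} {k : Fin 4} (hZ : (diagUnit t k).InDiamond h) : t + 2 ≤ h := by
  have h4 : (diamondLetter t 1 k).1 + absCharge (diamondLetter t 1 k) ≤ h := (hZ 0).2.2.2
  rw [absCharge_diamondLetter_one] at h4
  have : (diamondLetter t 1 k).1 = t + 1 := rfl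
  omega

/-- the ceiling unit cell of ◇₈ is the diagonal unit `[6I+ℓ_u]⁴` (definitionally). -/
theorem isCeilingUnit8_iff_diagUnit (Z : MCell) : Z.IsCeilingUnit8 ↔ ∃ u, Z = diagUnit 6 u := by
  constructor
  · rintro ⟨u, hu⟩; exact ⟨u, funext hu⟩
  · rintro ⟨u, rfl⟩; exact ⟨u, fun _ => rfl⟩

/-- **(C3-5) `(CL_8)` IS `(W′)` (PROVED)**: the FC classification at height 8 («every realisable FC cell is an upper-level diagonal unit with
`t ≥ 6`») is equivalent to `SeedFCPCeilingUnitDiamond8G1H1` («no `N`-level FC cell; every `P`-level FC cell is `[6I+ℓ_u]⁴`»): inside ◇₈ a diagonal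
unit has `t + 2 ≤ 8`, so `t ≥ 6` forces `t = 6`. -/
theorem realFCClassified_eight_iff_pCeilingUnit : RealFCClassified 8 ↔ SeedFCPCeilingUnitDiamond8G1H1 := by
  constructor
  · intro H C hU hG hS Z hfc
    refine ⟨fun hZ => ?_, fun hZ => ?_⟩
    · exact absurd (H true Z hfc ⟨C, hU, hG, hS, by simpa using hZ⟩).1 (by decide)
    · obtain ⟨-, t, k, ht, rfl⟩ := H false Z hfc ⟨C, hU, hG, hS, by simpa using hZ⟩
      have hle : t + 2 ≤ 8 := diagUnit_inDiamond_le (hU.2 _ hZ)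
      obtain rfl : t = 6 := by omega
      exact ⟨k, fun _ => rfl⟩
  · rintro W b Z hfc ⟨C, hU, hG, hS, hZ⟩
    cases b
    · obtain ⟨u, hu⟩ := (isCeilingUnit8_iff_diagUnit Z).mp ((W C hU hG hS Z hfc).2 (by simpa using hZ))
      exact ⟨rfl, 6, u, le_refl _, hu⟩
    · exact ((W C hU hG hS Z hfc).1 (by simpa using hZ)).elim

/-- **THE §12 CHAIN IN MINIMAL FORM (PROVED implication)**: `(IR) ∧ (BR) ∧ (NT) ∧ (W′) ⇒ (T_{8+2n})` for every `n` — two census-measurable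
tower laws, the two-ends lemma, and ONE machine row (W′). None of the four hypotheses is a theorem. -/
theorem seedB1Odd_all_of_rigidity_W' (R : InPlaceRigidity) (B : BoostRigidity) (T : NoTallFC)
    (W : SeedFCPCeilingUnitDiamond8G1H1) (n : ℕ) : SeedB1OddDiamondG1H1 (8 + 2 * n) :=
  seedB1Odd_all_of_rigidity R B T (realFCClassified_eight_iff_pCeilingUnit.mpr W) n

/-- inside `◇_{h+2}`, a letter lies in `◇_h` iff it is NOT on the ceiling line `α + c = h + 2` (h even: `α + c ≡ t` is even, so the odd line
`h + 1` is empty). -/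
theorem inDiamond_iff_not_onCeiling {h : ℤ} (he : h % 2 = 0) {x : BPoint} (hx : InDiamond (h + 2) x) :
    InDiamond h x ↔ ¬ OnCeiling (h + 2) x := by
  obtain ⟨hax, hc, hpar, htop⟩ := hx
  simp only [InDiamond, OnCeiling, hax, hc, hpar, true_and]
  omega

/-- inside `◇_{h+2}`, the `−2I` translate of a letter lies in `◇_h` iff the letter is NOT on the floor line `α = c` (`t ≥ 2` iff `t ≠ 0`,
`t` being even and non-negative). -/
theorem inDiamond_unboost_iff_not_onFloor {h : ℤ} {x : BPoint} (hx : InDiamond (h + 2) x) :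
    InDiamond h (boostPt (-2) x) ↔ ¬ OnFloor x := by
  obtain ⟨hax, hc, hpar, htop⟩ := hx
  have e1 : absCharge (boostPt (-2) x) = absCharge x := rfl
  have e2 : (boostPt (-2) x).1 = x.1 + -2 := rfl
  have e3 : (boostPt (-2) x).2 = x.2 := rfl
  have eax : ((boostPt (-2) x).2 = (0, 0) ∨ AxisPt (boostPt (-2) x)) ↔ (x.2 = (0, 0) ∨ AxisPt x) := Iff.rfl
  simp only [InDiamond, OnFloor, eax, hax, true_and, e1]
  show absCharge x ≤ x.1 + -2 ∧ (x.1 + -2 - absCharge x) % 2 = 0 ∧ x.1 + -2 + absCharge x ≤ h ↔ ¬ x.1 = absCharge x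
  omega

/-- a cell is the `+2I` translate of a `◇_h` cell iff its `−2I` translate lies in `◇_h`. -/
theorem exists_boost_two_iff {h : ℤ} (Z : MCell) : (∃ Y : MCell, Y.InDiamond h ∧ Z = Y.boost 2) ↔ (Z.boost (-2)).InDiamond h := by
  constructor
  · rintro ⟨Y, hY, rfl⟩; rwa [boost_boost, show (2 : ℤ) + -2 = 0 by norm_num, boost_zero]
  · intro hZ; exact ⟨Z.boost (-2), hZ, by rw [boost_boost, show (-2 : ℤ) + 2 = 0 by norm_num, boost_zero]⟩

/-- **TALL = FLOOR ∧ CEILING (PROVED, pure diamond geometry)**: a cell of `◇_{h+2}` (h even) is neither in `◇_h` nor the `+2I` translate of a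
`◇_h` cell iff it has a letter on the ceiling line `α + c = h + 2` and a letter on the floor line `α = c`. -/
theorem tall_iff_floor_and_ceiling {h : ℤ} (he : h % 2 = 0) {Z : MCell} (hZ : Z.InDiamond (h + 2)) :
    ¬ (Z.InDiamond h ∨ ∃ Y : MCell, Y.InDiamond h ∧ Z = Y.boost 2) ↔ (∃ f, OnCeiling (h + 2) (Z f)) ∧ ∃ g, OnFloor (Z g) := by
  rw [exists_boost_two_iff, not_or]
  have h1 : ¬ Z.InDiamond h ↔ ∃ f, OnCeiling (h + 2) (Z f) := by
    constructor
    · intro hn; by_contra hno; push Not at hno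
      exact hn fun f => (inDiamond_iff_not_onCeiling he (hZ f)).mpr (hno f)
    · rintro ⟨f, hf⟩ hn; exact (inDiamond_iff_not_onCeiling he (hZ f)).mp (hn f) hf
  have h2 : ¬ (Z.boost (-2)).InDiamond h ↔ ∃ g, OnFloor (Z g) := by
    constructor
    · intro hn; by_contra hno; push Not at hno
      exact hn fun g => (inDiamond_unboost_iff_not_onFloor (hZ g)).mpr (hno g)
    · rintro ⟨g, hg⟩ hn; exact (inDiamond_unboost_iff_not_onFloor (hZ g)).mp (hn g) hg
  rw [h1, h2]

/-- **(NFC) NO FLOOR–CEILING FC CELL (HYPOTHESIS FORM, conjectural; NOT asserted)** — the normal form of (NT): at every even height no realisable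
FC cell carries a letter on the floor line and a letter on the ceiling line at once. -/
def NoFloorCeilingFC : Prop :=
  ∀ h : ℤ, h % 2 = 0 → ∀ b : Bool, ∀ Z : MCell, FCc Z → CellRealisable (h + 2) b Z →
    ¬ ((∃ f, OnCeiling (h + 2) (Z f)) ∧ ∃ g, OnFloor (Z g))

/-- (NT) at even heights in normal form (PROVED): `NoTallFC` restricted to even `h` ↔ `NoFloorCeilingFC`. (Only even heights occur in the tower
`8 + 2n`; `realFCClassified_step` is applied there only.) -/
theorem noFloorCeilingFC_iff :
    NoFloorCeilingFC ↔ ∀ h : ℤ, h % 2 = 0 → ∀ b : Bool, ∀ Z : MCell, FCc Z → CellRealisable (h + 2) b Z →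
      Z.InDiamond h ∨ ∃ Y : MCell, Y.InDiamond h ∧ Z = Y.boost 2 := by
  refine forall_congr' fun h => forall_congr' fun he => forall_congr' fun b => forall_congr' fun Z =>
    forall_congr' fun hfc => forall_congr' fun hZ => ?_
  rw [← tall_iff_floor_and_ceiling he (inDiamond_of_cellRealisable hZ), not_not]

/-- (NT) ⇒ (NFC) (PROVED). -/
theorem noFloorCeilingFC_of_noTallFC (T : NoTallFC) : NoFloorCeilingFC :=
  noFloorCeilingFC_iff.mpr fun h _ b Z hfc hZ => T h b Z hfc hZ

/-- **THE EVEN-HEIGHT CHAIN (PROVED implication)**: `(IR) ∧ (BR) ∧ (NFC) ∧ (W′) ⇒ (T_{8+2n})` — the classification step only ever runs at the even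
heights `8 + 2n`, where (NFC) is exactly what it needs. -/
theorem realFCClassified_step_even (R : InPlaceRigidity) (B : BoostRigidity) (F : NoFloorCeilingFC) {h : ℤ} (he : h % 2 = 0)
    (H : RealFCClassified h) : RealFCClassified (h + 2) := by
  intro b Z hfc hZ
  rcases noFloorCeilingFC_iff.mp F h he b Z hfc hZ with hlow | ⟨Y, hY, rfl⟩
  · exact H b Z hfc (R h b Z hlow hZ)
  · obtain ⟨hb, t, k, ht, rfl⟩ := H b Y ((boost_fcc 2 Y).mp hfc) (B h b Y hY hZ)
    exact ⟨hb, t + 2, k, by omega, boost_diagUnit 2 t k⟩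

theorem realFCClassified_all_even (R : InPlaceRigidity) (B : BoostRigidity) (F : NoFloorCeilingFC) (H8 : RealFCClassified 8) (n : ℕ) :
    RealFCClassified (8 + 2 * n) := by
  induction n with
  | zero => simpa using H8
  | succ m ih =>
    have e : (8 : ℤ) + 2 * ((m + 1 : ℕ) : ℤ) = 8 + 2 * (m : ℤ) + 2 := by push_cast; ring
    rw [e]; exact realFCClassified_step_even R B F (by omega) ih

/-- **`seedB1Odd_all_of_rigidity_NFC` (PROVED implication)**: `(IR) ∧ (BR) ∧ (NFC) ∧ (W′) ⇒ B1-odd at every height `8 + 2n`**. -/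
theorem seedB1Odd_all_of_rigidity_NFC (R : InPlaceRigidity) (B : BoostRigidity) (F : NoFloorCeilingFC)
    (W : SeedFCPCeilingUnitDiamond8G1H1) (n : ℕ) : SeedB1OddDiamondG1H1 (8 + 2 * n) :=
  seedB1Odd_of_diagonal (seedFCDiagonal_of_classified
    (realFCClassified_all_even R B F (realFCClassified_eight_iff_pCeilingUnit.mpr W) n))

/-! ## §14 TRACE AND COLLAR — the monotone half of (IR) (v10, 2026-08-28 ≈22:00Z)

THE NEXT CONTROL OBJECT. `C.trace h` = the cells of `C` lying in `◇_h`. Because `◇_h` is a DOWN-SET for the causal order among μ₄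
letters (`inDiamond_of_effective`), every closure conjunct whose `C`-witnesses lie BELOW an in-`◇_h` cell passes to the trace:
`InDiamond h` (trivial), `G₁` (`trace_g1Closed`), RULE D at `N`-cells (`trace_ruleDN`) and the whole `A2I⁻` family (`trace_a2iMinusClosed`
— all five escape species of `XresA2IFires` live in the causal past of the participants). What can LEAK is exactly the pair of UPWARD
obligations of in-`◇_h` `P`-cells — RULE D at `P`-cells (service∕covers above) and `X⁺` (dual-world `X`: partners∕escapes above) —
`MConfig.UpwardObligations h C`. PROVED: `trace_admissible` (upward obligations hold ⇒ the trace is itself an admissible `◇_h`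
configuration), `inPlaceRigidity_of_simultaneous` ((sIR) ⇒ (IR)), `simultaneousRigidity_of_upward`. So (IR) can fail at `(h, h+2)` ONLY
through a `P`-cell of `◇_h` whose RULE-D service above or `X⁺` escapes are supplied in every height-`(h+2)` realisation by cells OUTSIDE
`◇_h` («upward leak»). Pre-registered test F3 on THIRDCODE-b's decoded ◇₁₀ models (kit j317021 rows 1–2): see HOME `pred∕F3-trace-test.md`.
(sIR), (IR) are HYPOTHESIS-FORM, NOT asserted; HC ∕ HC_CM ∕ HC_AV ∕ H2 ∕ (T_8) NOT proved. -/

/-! ## §14.1 The causal order respects the diamonds: ◇_h is a DOWN-SET among μ₄ letters -/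

/-- the HEIGHT SUM `α + c` is monotone along the causal order on μ₄ letters (axis or node letters): if `x − y` is effective then
`α(y) + c(y) ≤ α(x) + c(x)`. [cases on which `β`-coordinates vanish; `|a| ≤ Δα` from `a² ≤ Δα²`] -/
theorem heightSum_le_of_effective {x y : BPoint} (hx : x.2 = (0, 0) ∨ AxisPt x) (hy : y.2 = (0, 0) ∨ AxisPt y)
    (he : Effective (bsub x y)) : y.1 + absCharge y ≤ x.1 + absCharge x := by
  obtain ⟨a, b, c⟩ := x
  obtain ⟨a', b', c'⟩ := y
  obtain ⟨h0, hsq⟩ := he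
  have hb : -(a - a') ≤ b - b' ∧ b - b' ≤ a - a' := abs_le_of_sq_le_sq' (by nlinarith [sq_nonneg (c - c')]) h0
  have hc : -(a - a') ≤ c - c' ∧ c - c' ≤ a - a' := abs_le_of_sq_le_sq' (by nlinarith [sq_nonneg (b - b')]) h0
  simp only [absCharge, chargeOf, AxisPt, Prod.mk.injEq] at hx hy ⊢
  rcases abs_cases (b - c) with ⟨h1, _⟩ | ⟨h1, _⟩ <;> rcases abs_cases (b' - c') with ⟨h2, _⟩ | ⟨h2, _⟩ <;>
    rw [h1, h2] <;> rcases hx with ⟨rfl, rfl⟩ | ⟨-, rfl⟩ | ⟨rfl, -⟩ <;> rcases hy with ⟨rfl, rfl⟩ | ⟨-, rfl⟩ | ⟨rfl, -⟩ <;>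
    simp at * <;> omega

/-- **◇ IS A CAUSAL DOWN-SET**: a μ₄ letter of SOME diamond (`InDiamond h' y`: axis∕node, `c ≤ α`, even node level) lying in the causal
past of a letter of `◇_h` lies in `◇_h`. This is why every BELOW-witness of an in-`◇_h` cell survives truncation to `◇_h`. -/
theorem inDiamond_of_effective {h h' : ℤ} {x y : BPoint} (hx : InDiamond h x) (hy : InDiamond h' y)
    (he : Effective (bsub x y)) : InDiamond h y :=
  ⟨hy.1, hy.2.1, hy.2.2.1, (heightSum_le_of_effective hx.1 hy.1 he).trans hx.2.2.2⟩

/-- a letter strictly below `x` on a null ray (`x = y + d·n_k`, `d = α(x) − α(y) > 0`) is in the causal past of `x`. -/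
theorem effective_of_ray_eq {x y : BPoint} {k : Fin 4} (hlt : y.1 < x.1) (hxy : x = ray y k (x.1 - y.1)) :
    Effective (bsub x y) := by
  have H := effective_ray_sub y k (e := x.1 - y.1) (by omega)
  rwa [← hxy] at H

/-- hence: the letter below an in-`◇_h` letter along a ray, itself a letter of some diamond, is in `◇_h`. -/
theorem inDiamond_of_ray_eq {h h' : ℤ} {x y : BPoint} {k : Fin 4} (hx : InDiamond h x) (hy : InDiamond h' y)
    (hlt : y.1 < x.1) (hxy : x = ray y k (x.1 - y.1)) : InDiamond h y :=
  inDiamond_of_effective hx hy (effective_of_ray_eq hlt hxy)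

/-! ## §14.2 The ◇_h-trace of a configuration -/

/-- the `◇_h`-TRACE of a configuration: on each level, the cells lying in `◇_h`. -/
noncomputable def MConfig.trace (h : ℤ) (C : MConfig) : MConfig := by
  classical exact ⟨C.lower.filter (fun Z : MCell => Z.InDiamond h), C.upper.filter (fun P : MCell => P.InDiamond h)⟩

theorem MConfig.mem_trace_lower {h : ℤ} {C : MConfig} {Z : MCell} : Z ∈ (C.trace h).lower ↔ Z ∈ C.lower ∧ Z.InDiamond h := by
  classical simp [MConfig.trace]

theorem MConfig.mem_trace_upper {h : ℤ} {C : MConfig} {P : MCell} : P ∈ (C.trace h).upper ↔ P ∈ C.upper ∧ P.InDiamond h := by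
  classical simp [MConfig.trace]

/-- the trace lies in `◇_h`. -/
theorem MConfig.trace_inDiamond (h : ℤ) (C : MConfig) : (C.trace h).InDiamond h :=
  ⟨fun _ hZ => (MConfig.mem_trace_lower.1 hZ).2, fun _ hP => (MConfig.mem_trace_upper.1 hP).2⟩

/-- `Δ` keeps the diamond predicate (copy of `Pad4TowerStaticTorus.inDiamond_deltaPt_iff`, restated to keep this scratch's imports
minimal). -/
theorem inDiamond_deltaPt_iff' (h : ℤ) (x : BPoint) : InDiamond h (deltaPt x) ↔ InDiamond h x := by
  obtain ⟨a, b, c⟩ := x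
  by_cases hb : b = 0
  · subst hb
    by_cases hc : c = 0
    · subst hc; simp [InDiamond, AxisPt, absCharge, chargeOf, deltaPt]
    · simp [InDiamond, AxisPt, absCharge, chargeOf, deltaPt, hc, abs_neg]
  · by_cases hc : c = 0
    · subst hc; simp [InDiamond, AxisPt, absCharge, chargeOf, deltaPt, hb, abs_neg]
    · simp [InDiamond, AxisPt, absCharge, chargeOf, deltaPt, hb, hc]

/-- the trace of a `G₁`-closed configuration is `G₁`-closed (`S₄` permutes factors; `Δ` keeps `◇_h` letter by letter). -/
theorem MConfig.trace_g1Closed {h : ℤ} {C : MConfig} (hG : C.G1Closed) : (C.trace h).G1Closed := by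
  obtain ⟨hpl, hpu, hdl, hdu⟩ := hG
  refine ⟨fun σ Z hZ => ?_, fun σ P hP => ?_, fun Z hZ => ?_, fun P hP => ?_⟩
  · rw [MConfig.mem_trace_lower] at hZ ⊢; exact ⟨hpl σ Z hZ.1, fun f => hZ.2 (σ f)⟩
  · rw [MConfig.mem_trace_upper] at hP ⊢; exact ⟨hpu σ P hP.1, fun f => hP.2 (σ f)⟩
  · rw [MConfig.mem_trace_lower] at hZ ⊢; exact ⟨hdl Z hZ.1, fun f => (inDiamond_deltaPt_iff' h (Z f)).2 (hZ.2 f)⟩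
  · rw [MConfig.mem_trace_upper] at hP ⊢; exact ⟨hdu P hP.1, fun f => (inDiamond_deltaPt_iff' h (P f)).2 (hP.2 f)⟩

/-! ## §14.3 The DOWNWARD obligations survive truncation: RULE D at `N`-cells -/

/-- a `u`-partner BELOW an in-`◇_h` cell, all of whose letters are diamond letters, lies in `◇_h`. -/
theorem upartner_inDiamond {h h' : ℤ} {Z P : MCell} {f k : Fin 4} (hZ : Z.InDiamond h) (hP : P.InDiamond h')
    (hU : UPartner Z P f k) : P.InDiamond h := fun g => by
  by_cases hg : g = f
  · subst hg; exact inDiamond_of_ray_eq (hZ g) (hP g) hU.2.1 hU.2.2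
  · rw [hU.1 g hg]; exact hZ g

/-- an (r2a) cover BELOW an in-`◇_h` cell lies in `◇_h`. -/
theorem coverBelow_inDiamond {h h' : ℤ} {Z P : MCell} {g a j b : Fin 4} (hZ : Z.InDiamond h) (hP : P.InDiamond h')
    (hA : MAgree2 P Z g j) (hg : (P g).1 < (Z g).1) (hgr : Z g = ray (P g) a ((Z g).1 - (P g).1))
    (hj : (P j).1 < (Z j).1) (hjr : Z j = ray (P j) b ((Z j).1 - (P j).1)) : P.InDiamond h := fun f => by
  by_cases hfg : f = g
  · subst hfg; exact inDiamond_of_ray_eq (hZ f) (hP f) hg hgr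
  by_cases hfj : f = j
  · subst hfj; exact inDiamond_of_ray_eq (hZ f) (hP f) hj hjr
  · rw [hA f hfg hfj]; exact hZ f

/-- **RULE D AT THE `N`-CELLS OF THE TRACE** (PROVED): service and covers BELOW an in-`◇_h` `N`-cell are in `◇_h`, so the
trace of a RULE-D-closed configuration of any diamond satisfies RULE D at every one of its `N`-cells. -/
theorem MConfig.trace_ruleDN {h h' : ℤ} {C : MConfig} (hU : C.InDiamond h') (hR : RuleDMu4Closed C) :
    ∀ Z ∈ (C.trace h).lower, RuleDMu4N (C.trace h) Z := by
  intro Z hZ g j hgj k k' hak hak' hne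
  obtain ⟨hZC, hZh⟩ := MConfig.mem_trace_lower.1 hZ
  have served : ∀ f r, MServedBelow C Z f r → MServedBelow (C.trace h) Z f r := fun f r ⟨P, hP, hUP⟩ =>
    ⟨P, MConfig.mem_trace_upper.2 ⟨hP, upartner_inDiamond hZh (hU.2 P hP) hUP⟩, hUP⟩
  have settled : ∀ f r, SettledBelow C Z f r → SettledBelow (C.trace h) Z f r := fun f r ⟨s, hs, hS⟩ =>
    ⟨s, hs, served f s hS⟩
  rcases hR.1 Z hZC g j hgj k k' hak hak' hne with H | H | ⟨a, b, ha, hb, P, hP, hA, hg, hgr, hj, hjr⟩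
  · exact Or.inl (settled g k H)
  · exact Or.inr (Or.inl (settled j k' H))
  · exact Or.inr (Or.inr ⟨a, b, ha, hb, P, MConfig.mem_trace_upper.2
      ⟨hP, coverBelow_inDiamond hZh (hU.2 P hP) hA hg hgr hj hjr⟩, hA, hg, hgr, hj, hjr⟩)

/-! ## §14.4 Simultaneous rigidity and the upward obligations -/

/-- **(sIR) SIMULTANEOUS IN-PLACE RIGIDITY (HYPOTHESIS FORM, conjectural; NOT asserted)**: the `◇_h`-trace of every `G₁`-closed
`H₁`-static configuration of `◇_{h+2}` EXTENDS to a `G₁`-closed `H₁`-static configuration of `◇_h`. Stronger than (IR) (one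
extension serving all in-`◇_h` cells at once). -/
def SimultaneousRigidity : Prop :=
  ∀ h : ℤ, ∀ C : MConfig, C.InDiamond (h + 2) → C.G1Closed → C.StaticH1 →
    ∃ C' : MConfig, C'.InDiamond h ∧ C'.G1Closed ∧ C'.StaticH1 ∧ (C.trace h).lower ⊆ C'.lower ∧ (C.trace h).upper ⊆ C'.upper

/-- **(sIR) ⇒ (IR)** (PROVED). -/
theorem inPlaceRigidity_of_simultaneous (S : SimultaneousRigidity) : InPlaceRigidity := by
  intro h b Z hZ ⟨C, hU, hG, hS, hm⟩
  obtain ⟨C', hU', hG', hS', hl, hu⟩ := S h C hU hG hS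
  refine ⟨C', hU', hG', hS', ?_⟩
  cases b
  · exact hu (MConfig.mem_trace_upper.2 ⟨by simpa using hm, hZ⟩)
  · exact hl (MConfig.mem_trace_lower.2 ⟨by simpa using hm, hZ⟩)

/-- **THE UPWARD OBLIGATIONS of the trace** (the only closure conjuncts whose `C`-witnesses can lie ABOVE an in-`◇_h` cell, hence
outside `◇_h`): RULE D at the trace's `P`-cells (service∕covers above) and `X⁺` (the dual-world `X` family: partners and escapes
above). Decidable in principle; HYPOTHESIS about a given `C`, not asserted. -/
def MConfig.UpwardObligations (h : ℤ) (C : MConfig) : Prop :=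
  (∀ P ∈ (C.trace h).upper, RuleDMu4P (C.trace h) P) ∧ XPlusClosed (C.trace h)

/-- a strictly-null-below letter is in the causal past. -/
theorem effective_of_nullBelow {x y : BPoint} (hn : NullBelow y x) : Effective (bsub x y) :=
  ⟨le_of_lt (sub_pos.2 hn.1), le_of_eq hn.2⟩

/-- two letters on the same null ray from `x` are causally ordered by their ray parameters. -/
theorem effective_ray_ray (x : BPoint) (v : Fin 4) {e₁ e₂ : ℤ} (hle : e₂ ≤ e₁) :
    Effective (bsub (ray x v e₁) (ray x v e₂)) := by
  have H := effective_ray_sub (ray x v e₂) v (e := e₁ - e₂) (by omega)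
  have E : ray (ray x v e₂) v (e₁ - e₂) = ray x v e₁ :=
    Prod.ext (by simp only; ring) (Prod.ext (by simp only; ring) (by simp only; ring))
  rwa [E] at H

/-- **`A2I⁻` RESTRICTS** (PROVED): every escape species of an `A2I⁻` clause (`XresA2IFires`: other-direction partners, shallower
`u`-partners, deeper points on the `u`-line, below-partners on `f′`, polluters of the server's row) lies in the causal past of the
clause's participants `Z, q, N′`; so when the participants lie in `◇_h` every escape present in `C` is present in the trace (§14.1), and
the trace of an `A2I⁻`-closed configuration of any diamond is `A2I⁻`-closed. -/
theorem MConfig.trace_a2iMinusClosed {h h' : ℤ} {C : MConfig} (hU : C.InDiamond h') (hA : A2IMinusClosed C) :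
    A2IMinusClosed (C.trace h) := by
  intro Z hZ q hq N' hN' σ u f' v hF
  obtain ⟨hZC, hZh⟩ := MConfig.mem_trace_lower.1 hZ
  obtain ⟨hqC, hqh⟩ := MConfig.mem_trace_upper.1 hq
  obtain ⟨hNC, hNh⟩ := MConfig.mem_trace_lower.1 hN'
  obtain ⟨h1, h2, h3, h4, h5, h6, h7, h8, h9, h10, h11⟩ := hF
  refine hA Z hZC q hqC N' hNC σ u f' v ⟨h1, h2, h3, h4, h5, h6, ?_, ?_, ?_, ?_, ?_⟩
  · intro P hP w hw hUP
    exact h7 P (MConfig.mem_trace_upper.2 ⟨hP, upartner_inDiamond hZh (hU.2 P hP) hUP⟩) w hw hUP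
  · intro P hP hUP
    exact h8 P (MConfig.mem_trace_upper.2 ⟨hP, upartner_inDiamond hZh (hU.2 P hP) hUP⟩) hUP
  · intro P hP hUP
    exact h9 P (MConfig.mem_trace_upper.2 ⟨hP, upartner_inDiamond hqh (hU.2 P hP) hUP⟩) hUP
  · intro P hP hnb hag
    refine h10 P (MConfig.mem_trace_upper.2 ⟨hP, fun g' => ?_⟩) hnb hag
    rcases hag with hM | ⟨g, -, hM2, hnbg⟩
    · by_cases hg' : g' = f'
      · subst hg'; exact inDiamond_of_effective (hZh g') (hU.2 P hP g') (effective_of_nullBelow hnb)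
      · rw [hM g' hg']; exact hZh g'
    · by_cases hg'f : g' = f'
      · subst hg'f; exact inDiamond_of_effective (hZh g') (hU.2 P hP g') (effective_of_nullBelow hnb)
      by_cases hg'g : g' = g
      · subst hg'g; exact inDiamond_of_effective (hZh g') (hU.2 P hP g') (effective_of_nullBelow hnbg)
      · rw [hM2 g' hg'f hg'g]; exact hZh g'
  · intro P hP hag hline
    -- the polluter `P` lies in `◇_h` in either species, so the trace's clause sees it
    have hq' : q f' = Z f' := h3.1 f' h5
    have hN : N' f' = ray (Z f') v ((N' f').1 - (Z f').1) := by have e := h6.2.2; rwa [hq'] at e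
    have hPin : ((Z f').1 < (P f').1 ∧ (P f').1 ≤ (N' f').1 ∧ P f' = ray (Z f') v ((P f').1 - (Z f').1)) ∨
        Effective (bsub (N' f') (P f')) → P.InDiamond h := by
      intro hAB g'
      by_cases hσ : g' = σ
      · subst hσ
        have H := effective_ray_sub (P g') u (e := (q g').1 - (P g').1) (by have := hline.1; omega)
        rw [← hline.2] at H
        exact inDiamond_of_effective (hqh g') (hU.2 P hP g') H
      by_cases hf : g' = f'
      · subst hf
        rcases hAB with ⟨-, hle, hray⟩ | heff
        · have H := effective_ray_ray (Z g') v (e₁ := (N' g').1 - (Z g').1) (e₂ := (P g').1 - (Z g').1) (by omega)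
          rw [← hN, ← hray] at H
          exact inDiamond_of_effective (hNh g') (hU.2 P hP g') H
        · exact inDiamond_of_effective (hNh g') (hU.2 P hP g') heff
      · rw [hag g' hσ hf]; exact hZh g'
    exact ⟨fun hA' => (h11 P (MConfig.mem_trace_upper.2 ⟨hP, hPin (Or.inl hA')⟩) hag hline).1 hA',
      fun hB' => (h11 P (MConfig.mem_trace_upper.2 ⟨hP, hPin (Or.inr hB'.1)⟩) hag hline).2 hB'⟩

/-- **TRACE THEOREM** (PROVED): if the upward obligations of the `◇_h`-trace hold, the trace ITSELF is a
`G₁`-closed `H₁`-static configuration of `◇_h` — i.e. (sIR) holds at `C` with `C' :=` the trace. So (sIR), hence (IR), can only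
fail through an UPWARD obligation of an in-`◇_h` `P`-cell discharged in `C` by cells outside `◇_h` and by nothing inside. -/
theorem MConfig.trace_admissible {h h' : ℤ} {C : MConfig} (hU : C.InDiamond h') (hG : C.G1Closed) (hS : C.StaticH1)
    (hUp : C.UpwardObligations h) : (C.trace h).InDiamond h ∧ (C.trace h).G1Closed ∧ (C.trace h).StaticH1 :=
  ⟨C.trace_inDiamond h, MConfig.trace_g1Closed hG, ⟨MConfig.trace_ruleDN hU hS.1, hUp.1⟩, hUp.2,
    MConfig.trace_a2iMinusClosed hU hS.2.2⟩

/-- **(UO) UPWARD OBLIGATIONS NEVER LEAK ⇒ (sIR)**, bookkeeping form (PROVED): if every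
admissible configuration of `◇_{h+2}` has a trace whose upward obligations hold, (sIR) holds with the trace as the extension. The
CONTENT of (sIR) beyond this is the repair of traces whose upward obligations fail (the «collar repair» — not typed here). -/
theorem simultaneousRigidity_of_upward
    (H : ∀ h : ℤ, ∀ C : MConfig, C.InDiamond (h + 2) → C.G1Closed → C.StaticH1 → C.UpwardObligations h) :
    SimultaneousRigidity := fun h C hU hG hS =>
  have T := MConfig.trace_admissible hU hG hS (H h C hU hG hS)
  ⟨C.trace h, T.1, T.2.1, T.2.2, subset_rfl, subset_rfl⟩

/-! ## §14.5 (v10) (BR) IS REFUTED BY THE ◇₈ CENSUS POINTS; the corrected tower input is the TOP-BAND FC LAW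

**Negative result of the lens (2026-08-28 ≈21:45Z).** The typed law (BR) `BoostRigidity` (§12) is FALSE at the machine level, at the
instances `h = 6` AND `h = 8`, by two ◇₈ census points already booked: `[6I+ℓ_k]⁴ ∈ Real₈` (◇₈ models with an FC orbit: W17 ∕ third code
j309715 `x-anyfc` SAT, and every other FC class UNSAT = (W′) ×2, so the witness orbit is the upper ceiling unit) and `[4I+ℓ_k]⁴ ∉ Real₈`
(◇₈ H₁-peel round 14, j309861, ×2 by j318002 stage 1): (BR) at `h = 6` with `Z = [4I+ℓ_k]⁴ ∈ ◇₆` would realise `Z` at 6, hence at 8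
(`cellRealisable_mono`); at `h = 8` with the same `Z ∈ ◇₈` and `Z + 2I = [6I+ℓ_k]⁴ ∈ Real₈ ⊆ Real₁₀` likewise. Kernel form:
`not_boostRigidity_of_census`, `not_boostRigidityFC_eight_of_census` (the census points enter as HYPOTHESES; they are machine facts, not
kernel objects). CONSEQUENCE: the implications `seedB1Odd_all_of_rigidity{,_W',_NFC}` (§12–§13) and `realFCClassified_step{,_even}` are
correct but carry a machine-false hypothesis — VACUOUS as routes. The flaw: the (NT)∕(NFC) dichotomy «in the old window OR a translate»
sends IN-WINDOW translates (`[6I+ℓ]⁴ = [4I+ℓ]⁴ + 2I`, both in ◇₈) through (BR). REPAIR (PROVED below): cut by «in the old window OR NOT»,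
use (IR) only on FC cells of the old window — (IR-FC) — and for the top band the law that is actually observed, **(TB_h) every realisable
FC cell of `◇_{h+2}` outside `◇_h` is an upper ceiling unit `[hI+ℓ_k]⁴`**: `realFCClassified_step_TB : IR-FC → TB_h → CL_h → CL_{h+2}`
(`h ≥ 6`), `seedB1Odd_all_of_TB : IR-FC → (∀ n, TB_{8+2n}) → (W′) → ∀ n, T_{8+2n}`. (TB_6) is (W′)'s top-band half (machine ×2); (TB_8) is
tested at ◇₁₀ by THIRDCODE-b row 5 (`x-fcnondiag`, non-diagonal part) and would be completed by two cheap rows not yet booked (top-band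
diagonal non-units `[6I+2ℓ]⁴, [4I+3ℓ]⁴, [2I+4ℓ]⁴, [5ℓ]⁴` absent; `N[8I+ℓ]⁴` absent). (IR-FC)₈ is tested by rows 3–5 and by F3a on the
decoded witnesses of rows 1–2. (TB_h) for all `h` is where K2's difficulty now sits, localised to the CEILING BAND; by span control
(`seedB1OddAnchored_iff`, landed) a support realising a top-band cell is either a `+2I`-boost of a `◇_h` support (then TB_h follows from
TB_{h−2}, K1) or FLOOR-ANCHORED AND TALL (spans floor to ceiling band) — the typed residual is the top band of TALL ANCHORED supports
(not typed in this version). All laws HYPOTHESIS-FORM; HC ∕ HC_CM ∕ HC_AV ∕ H2 ∕ (T_8) NOT proved. -/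

/-- `[4I+ℓ_k]⁴ ∈ ◇₆` (it is the ceiling unit of ◇₆) and `∈ ◇₈`, and it is FC. [`decide` per phase] -/
theorem diagUnit_four_facts (k : Fin 4) :
    (diagUnit 4 k).InDiamond 6 ∧ (diagUnit 4 k).InDiamond 8 ∧ FCc (diagUnit 4 k) := by
  fin_cases k <;> decide

/-- **(BR) REFUTED BY THE CENSUS POINTS** (PROVED implication): `[4I+ℓ_k]⁴ ∉ Real₈` and `[6I+ℓ_k]⁴ ∈ Real₈` give `¬ BoostRigidity`
(instance `h = 6`, `Z = [4I+ℓ_k]⁴ ∈ ◇₆`, `Z + 2I = [6I+ℓ_k]⁴`). -/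
theorem not_boostRigidity_of_census (k : Fin 4) (h4 : ¬ CellRealisable 8 false (diagUnit 4 k))
    (h6 : CellRealisable 8 false (diagUnit 6 k)) : ¬ BoostRigidity := fun B => by
  have hb : (diagUnit 4 k).boost 2 = diagUnit 6 k := by rw [boost_diagUnit]; norm_num
  have h6' : CellRealisable (6 + 2) false ((diagUnit 4 k).boost 2) := by rw [hb]; simpa using h6
  exact h4 (cellRealisable_mono (by norm_num) (B 6 false (diagUnit 4 k) (diagUnit_four_facts k).1 h6'))

/-- **(BR-FC)₈, the instance a ◇₈-based tower would use, is refuted by the same two points** (PROVED implication): boost rigidity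
at the pair (8, 10) fails already for FC cells (`Z = [4I+ℓ_k]⁴ ∈ ◇₈`, `Z + 2I = [6I+ℓ_k]⁴ ∈ Real₈ ⊆ Real₁₀`). -/
theorem not_boostRigidityFC_eight_of_census (k : Fin 4) (h4 : ¬ CellRealisable 8 false (diagUnit 4 k))
    (h6 : CellRealisable 8 false (diagUnit 6 k)) :
    ¬ (∀ b : Bool, ∀ Z : MCell, FCc Z → Z.InDiamond 8 → CellRealisable 10 b (Z.boost 2) → CellRealisable 8 b Z) := fun B => by
  have hb : (diagUnit 4 k).boost 2 = diagUnit 6 k := by rw [boost_diagUnit]; norm_num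
  have h6' : CellRealisable 10 false ((diagUnit 4 k).boost 2) := by rw [hb]; exact cellRealisable_mono (by norm_num) h6
  exact h4 (B false (diagUnit 4 k) (diagUnit_four_facts k).2.2 (diagUnit_four_facts k).2.1 h6')

/-- **(IR-FC) IN-PLACE RIGIDITY FOR FC CELLS (HYPOTHESIS FORM, conjectural; NOT asserted)** — the only use the tower makes of (IR). -/
def InPlaceRigidityFC : Prop :=
  ∀ h : ℤ, ∀ b : Bool, ∀ Z : MCell, FCc Z → Z.InDiamond h → CellRealisable (h + 2) b Z → CellRealisable h b Z

/-- (IR) ⇒ (IR-FC). -/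
theorem inPlaceRigidityFC_of (R : InPlaceRigidity) : InPlaceRigidityFC := fun h b Z _ hZ H => R h b Z hZ H

/-- **(TB_h) THE TOP-BAND FC LAW at the pair `(h, h+2)` (HYPOTHESIS FORM; `h = 6`: machine ×2 = the top-band half of (W′); `h = 8`:
partly tested by THIRDCODE-b row 5; NOT a kernel theorem)**: a realisable FC cell of `◇_{h+2}` NOT lying in `◇_h` is an UPPER ceiling unit
`[hI+ℓ_k]⁴`. -/
def TopBandFCUnits (h : ℤ) : Prop :=
  ∀ b : Bool, ∀ Z : MCell, FCc Z → CellRealisable (h + 2) b Z → ¬ Z.InDiamond h → b = false ∧ ∃ k : Fin 4, Z = diagUnit h k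

/-- **THE CORRECTED STEP (PROVED implication)**: `(IR-FC) ∧ (TB_h) ∧ CL_h ⇒ CL_{h+2}` for `h ≥ 6` — in-window FC cells go through
(IR-FC) and CL_h, top-band FC cells through (TB_h); (BR) and (NT)∕(NFC) are not used. -/
theorem realFCClassified_step_TB (R : InPlaceRigidityFC) {h : ℤ} (hh : 6 ≤ h) (T : TopBandFCUnits h)
    (H : RealFCClassified h) : RealFCClassified (h + 2) := by
  intro b Z hfc hZ
  by_cases hin : Z.InDiamond h
  · exact H b Z hfc (R h b Z hfc hin hZ)
  · obtain ⟨hb, k, rfl⟩ := T b Z hfc hZ hin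
    exact ⟨hb, h, k, hh, rfl⟩

/-- the corrected tower of classifications from `CL_8`. -/
theorem realFCClassified_all_TB (R : InPlaceRigidityFC) (T : ∀ n : ℕ, TopBandFCUnits (8 + 2 * n))
    (H8 : RealFCClassified 8) (n : ℕ) : RealFCClassified (8 + 2 * n) := by
  induction n with
  | zero => simpa using H8
  | succ m ih =>
    have e : (8 : ℤ) + 2 * ((m + 1 : ℕ) : ℤ) = 8 + 2 * (m : ℤ) + 2 := by push_cast; ring
    rw [e]; exact realFCClassified_step_TB R (by omega) (T m) ih

/-- **`seedB1Odd_all_of_TB` (PROVED implication)**: `(IR-FC) ∧ (∀ n, TB_{8+2n}) ∧ (W′) ⇒ B1-odd at every height `8 + 2n`** — the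
corrected minimal chain (replaces `seedB1Odd_all_of_rigidity{,_W',_NFC}`, whose hypothesis (BR) is machine-false). -/
theorem seedB1Odd_all_of_TB (R : InPlaceRigidityFC) (T : ∀ n : ℕ, TopBandFCUnits (8 + 2 * n))
    (W : SeedFCPCeilingUnitDiamond8G1H1) (n : ℕ) : SeedB1OddDiamondG1H1 (8 + 2 * n) :=
  seedB1Odd_of_diagonal (seedFCDiagonal_of_classified
    (realFCClassified_all_TB R T (realFCClassified_eight_iff_pCeilingUnit.mpr W) n))


/-! ## §14.6 (v10) The top band reduces to TALL FLOOR-ANCHORED supports (PROVED reduction, by span control)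

Where (TB_h) can be attacked uniformly in `h`: a support realising a top-band FC cell of `◇_{h+2}` either touches the FLOOR line — then it
is TALL (floor to ceiling band) and (TBA_h) below is the residual claim — or it does not, and then its `−2I`-boost is an admissible `◇_h`
configuration (K1 boost blindness, landed p663032) realising `Z − 2I` in the top band of `◇_h`, so (TB_{h−2}) applies and boosts back.
PROVED: `topBandFCUnits_step : TB_{h−2} → TBA_h → TB_h`; hence the tower input `∀ n, TB_{8+2n}` follows from (TB₆) (= the top-band half of
(W′), machine ×2) and `∀ n, TBA_{8+2n}` (`topBandFCUnits_all_of_anchored`), and the corrected chain reads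
`seedB1Odd_all_of_TBA : (IR-FC) → TB₆ → (∀ n, TBA_{8+2n}) → (W′) → ∀ n, T_{8+2n}`. The typed K2-residue of the control lens is therefore:
**the FC cells in the ceiling band of TALL floor-anchored admissible supports are the ceiling units** — a statement about supports spanning
the whole diamond (cf. THRESHOLD EXTREMALITY §8: the ◇₈ threshold witness is of exactly this kind). HYPOTHESIS-FORM laws NOT asserted;
HC ∕ HC_CM ∕ HC_AV ∕ H2 ∕ (T_8) NOT proved. -/

/-- **(TBA_h) THE TOP-BAND FC LAW FOR TALL ANCHORED SUPPORTS (HYPOTHESIS FORM, conjectural)**: an FC cell outside `◇_h` carried by a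
FLOOR-ANCHORED admissible configuration of `◇_{h+2}` is an upper ceiling unit `[hI+ℓ_k]⁴`. -/
def TopBandFCUnitsAnchored (h : ℤ) : Prop :=
  ∀ b : Bool, ∀ Z : MCell, FCc Z →
    (∃ C : MConfig, C.InDiamond (h + 2) ∧ C.FloorAnchored ∧ C.G1Closed ∧ C.StaticH1 ∧ (if b then Z ∈ C.lower else Z ∈ C.upper)) →
    ¬ Z.InDiamond h → b = false ∧ ∃ k : Fin 4, Z = diagUnit h k

/-- boosting a cell of `◇_{h−2}` by `+2I` lands in `◇_h`. -/
theorem inDiamond_boost_two_of {h : ℤ} {W : MCell} (hW : W.InDiamond (h - 2)) : (W.boost 2).InDiamond h := fun f => by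
  have hy := hW f
  have h1 := hy.2.1
  have h3 := hy.2.2.2
  exact inDiamond_boostPt hy (by decide) (by omega) (by omega)

/-- hence a cell outside `◇_h` boosts down to a cell outside `◇_{h−2}`. -/
theorem not_inDiamond_unboost {h : ℤ} {Z : MCell} (hZ : ¬ Z.InDiamond h) : ¬ (Z.boost (-2)).InDiamond (h - 2) := fun h2 => by
  have e : (Z.boost (-2)).boost 2 = Z := by rw [boost_boost]; norm_num; exact boost_zero Z
  exact hZ (e ▸ inDiamond_boost_two_of h2)

/-- a NON-anchored admissible configuration of `◇_{h+2}` boosts down by `2I` to an admissible configuration of `◇_h`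
(the down-boost half of span control, extracted from `threshold_support_spans`). -/
theorem unboost_admissible {h : ℤ} {C : MConfig} (hU : C.InDiamond (h + 2)) (hA : ¬ C.FloorAnchored) (hG : C.G1Closed)
    (hS : C.StaticH1) : (C.boostImage (-2)).InDiamond h ∧ (C.boostImage (-2)).G1Closed ∧ (C.boostImage (-2)).StaticH1 := by
  have hdia : ∀ Z, (Z ∈ C.lower ∨ Z ∈ C.upper) → ∀ f, InDiamond (h + 2) (Z f) := fun Z hZ f =>
    hZ.elim (fun hZ => hU.1 Z hZ f) (fun hZ => hU.2 Z hZ f)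
  have key : ∀ Z, (Z ∈ C.lower ∨ Z ∈ C.upper) → ∀ f, InDiamond h (boostPt (-2) (Z f)) := by
    intro Z hZ f
    have hx := hdia Z hZ f
    have hnf : ¬ ((Z f).1 = absCharge (Z f)) := fun hfl =>
      hA (hZ.elim (fun hZ => Or.inl ⟨Z, hZ, f, hfl⟩) (fun hZ => Or.inr ⟨Z, hZ, f, hfl⟩))
    have h1 := hx.2.1
    have h2 := hx.2.2.1
    have h3 := hx.2.2.2
    exact inDiamond_boostPt hx (by omega) (by omega) (by omega)
  have hU' : (C.boostImage (-2)).InDiamond h := by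
    constructor
    · intro W hW f
      obtain ⟨Z, hZ, rfl⟩ := Finset.mem_image.mp hW
      exact key Z (Or.inl hZ) f
    · intro W hW f
      obtain ⟨Z, hZ, rfl⟩ := Finset.mem_image.mp hW
      exact key Z (Or.inr hZ) f
  obtain ⟨hSi, hGi, -⟩ := staticH1BoostInvariant_holds (-2) C (inCone_of_inDiamond' hU) (inCone_of_inDiamond' hU')
  exact ⟨hU', hGi.mp hG, hSi.mp hS⟩

/-- **THE TOP-BAND STEP (PROVED implication)**: `(TB_{h−2}) ∧ (TBA_h) ⇒ (TB_h)`. -/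
theorem topBandFCUnits_step {h : ℤ} (T : TopBandFCUnits (h - 2)) (A : TopBandFCUnitsAnchored h) : TopBandFCUnits h := by
  intro b Z hfc hZ hnin
  obtain ⟨C, hU, hG, hS, hmem⟩ := hZ
  by_cases hA : C.FloorAnchored
  · exact A b Z hfc ⟨C, hU, hA, hG, hS, hmem⟩ hnin
  · obtain ⟨hU', hG', hS'⟩ := unboost_admissible hU hA hG hS
    have hmem' : if b then Z.boost (-2) ∈ (C.boostImage (-2)).lower else Z.boost (-2) ∈ (C.boostImage (-2)).upper := by
      cases b
      · simp only [Bool.false_eq_true, ↓reduceIte] at hmem ⊢; exact Finset.mem_image_of_mem _ hmem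
      · simp only [↓reduceIte] at hmem ⊢; exact Finset.mem_image_of_mem _ hmem
    have hreal : CellRealisable (h - 2 + 2) b (Z.boost (-2)) := ⟨C.boostImage (-2), by simpa using hU', hG', hS', hmem'⟩
    obtain ⟨hb, k, hk⟩ := T b (Z.boost (-2)) ((boost_fcc (-2) Z).mpr hfc) hreal (not_inDiamond_unboost hnin)
    refine ⟨hb, k, ?_⟩
    have e : (Z.boost (-2)).boost 2 = Z := by rw [boost_boost]; norm_num; exact boost_zero Z
    have this : (diagUnit (h - 2) k).boost 2 = diagUnit h k := by rw [boost_diagUnit]; congr 1; ring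
    rw [← hk, e] at this; exact this

/-- the whole tower input from (TB₆) and the anchored laws. -/
theorem topBandFCUnits_all_of_anchored (T6 : TopBandFCUnits 6) (A : ∀ n : ℕ, TopBandFCUnitsAnchored (8 + 2 * n)) (n : ℕ) :
    TopBandFCUnits (8 + 2 * n) := by
  induction n with
  | zero => simpa using topBandFCUnits_step (h := 8) (by simpa using T6) (by simpa using A 0)
  | succ m ih =>
    have ih' : TopBandFCUnits (8 + 2 * ((m + 1 : ℕ) : ℤ) - 2) := by
      have e : (8 : ℤ) + 2 * ((m + 1 : ℕ) : ℤ) - 2 = 8 + 2 * (m : ℤ) := by push_cast; ring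
      rw [e]; exact ih
    exact topBandFCUnits_step ih' (A (m + 1))

/-- **`seedB1Odd_all_of_TBA` (PROVED implication)**: `(IR-FC) ∧ (TB₆) ∧ (∀ n, TBA_{8+2n}) ∧ (W′) ⇒ B1-odd at every height `8 + 2n`** —
the control lens's corrected chain with the K2-residue localised to TALL FLOOR-ANCHORED supports. -/
theorem seedB1Odd_all_of_TBA (R : InPlaceRigidityFC) (T6 : TopBandFCUnits 6) (A : ∀ n : ℕ, TopBandFCUnitsAnchored (8 + 2 * n))
    (W : SeedFCPCeilingUnitDiamond8G1H1) (n : ℕ) : SeedB1OddDiamondG1H1 (8 + 2 * n) :=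
  seedB1Odd_all_of_TB R (topBandFCUnits_all_of_anchored T6 A) W n

/-- and (TB₆) is implied by the ◇₈ classification (W′) (so the chain's inputs are (IR-FC), the anchored laws and (W′) alone). -/
theorem topBandFCUnits_six_of_W (W : SeedFCPCeilingUnitDiamond8G1H1) : TopBandFCUnits 6 := by
  intro b Z hfc hZ _
  obtain ⟨hb, t, k, ht, rfl⟩ := realFCClassified_eight_iff_pCeilingUnit.mpr W b Z hfc (by simpa using hZ)
  refine ⟨hb, k, ?_⟩
  have hle : t + 2 ≤ 8 := by
    obtain ⟨C, hU, -, -, hmem⟩ := hZ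
    cases b
    · simp only [Bool.false_eq_true, ↓reduceIte] at hmem; exact diagUnit_inDiamond_le (by simpa using hU.2 _ hmem)
    · simp only [↓reduceIte] at hmem; exact diagUnit_inDiamond_le (by simpa using hU.1 _ hmem)
  have ht6 : t = 6 := by omega
  subst ht6; rfl


/-! ## §14.7 (v12) THE COLLAR, TYPED — LINE 2's first OPEN lemma and what it is meant to discharge (price C6-3)

LINE 2 «trace-and-collar» is aimed at **(IR-FC)** (`InPlaceRigidityFC`), the in-place input of the corrected chain
`seedB1Odd_all_of_TBA`; it does NOT touch (TBA_h) (the top band lies outside `◇_h`, where a trace says nothing). The TRACE half is proved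
(§14). The COLLAR is the missing half, typed here in the one form the census can test witness by witness: **(CT-FC_h) COLLARED TRACE
(FC)** — every FC cell of `◇_h` present in an admissible configuration `C ⊂ ◇_{h+2}` lies in an admissible `◇_h` configuration `C'`
CONTAINED IN the `◇_h`-trace of `C` (the «collar» of `Z` is `C' ∖ {Z}`: the part of the trace that serves `Z` inside the old window).
PROVED: `inPlaceRigidityFC_of_collaredTrace : CT-FC → IR-FC`, and the unrestricted form `CollaredTrace` ⇒ `CT-FC`. CENSUS TESTS
(pre-registered): per decoded ◇₁₀ witness `C` of THIRDCODE-b rows 1–2 and per FC orbit `Z` of its ◇₈-trace, ONE solver call on the ◇₈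
body with ABSENT-units for every orbit outside the trace and a PRESENT-unit for `Z` — SAT ⇔ the CT-FC instance holds (kit rider «F3c-FC»,
offered, default NO); and O1 «x-ir13» (keyed R17.19): SAT ⇒ the UNRESTRICTED forms `CollaredTrace`₆, (sIR)₆, (UO)₆ are REFUTED at
(6,8) together with unrestricted (IR)₆ (a ◇₆-unrealisable orbit inside a ◇₈ model has no admissible ◇₆ neighbourhood at all) — which is
why every LINE 2 law is FC-restricted from birth. OPEN LEMMA OF RECORD (the collar statement): `collaredTraceFC_holds : CollaredTraceFC`
— hypothesis-free as a target, conjectural; its first provable approach is the down-set calculus of §14 applied to the CAUSAL PAST of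
the `G₁`-orbit of `Z` inside the trace (RULE D at `N`, `A2I⁻`, `G₁` pass to any `G₁`-stable causal down-set by the §14 proofs), leaving
exactly the UPWARD obligations (RULE D at `P`, `X⁺`) of the past cone to be served inside `◇_h`. Nothing here is asserted; HC ∕ HC_CM ∕
HC_AV ∕ H2 ∕ (T_8) NOT proved; width 0. -/

/-- **(CT-FC) COLLARED TRACE FOR FC CELLS (HYPOTHESIS FORM; the COLLAR statement of LINE 2; conjectural, NOT asserted)**. -/
def CollaredTraceFC : Prop :=
  ∀ h : ℤ, ∀ C : MConfig, C.InDiamond (h + 2) → C.G1Closed → C.StaticH1 → ∀ b : Bool, ∀ Z : MCell, FCc Z → Z.InDiamond h →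
    (if b then Z ∈ C.lower else Z ∈ C.upper) →
    ∃ C' : MConfig, C'.InDiamond h ∧ C'.G1Closed ∧ C'.StaticH1 ∧ C'.lower ⊆ (C.trace h).lower ∧ C'.upper ⊆ (C.trace h).upper ∧
      (if b then Z ∈ C'.lower else Z ∈ C'.upper)

/-- the unrestricted collared-trace law (all cells; expected to DIE at (6,8) if O1 «x-ir13» returns SAT — typed to record the negative). -/
def CollaredTrace : Prop :=
  ∀ h : ℤ, ∀ C : MConfig, C.InDiamond (h + 2) → C.G1Closed → C.StaticH1 → ∀ b : Bool, ∀ Z : MCell, Z.InDiamond h →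
    (if b then Z ∈ C.lower else Z ∈ C.upper) →
    ∃ C' : MConfig, C'.InDiamond h ∧ C'.G1Closed ∧ C'.StaticH1 ∧ C'.lower ⊆ (C.trace h).lower ∧ C'.upper ⊆ (C.trace h).upper ∧
      (if b then Z ∈ C'.lower else Z ∈ C'.upper)

theorem collaredTraceFC_of (H : CollaredTrace) : CollaredTraceFC :=
  fun h C hU hG hS b Z _ hZ hmem => H h C hU hG hS b Z hZ hmem

/-- **CT-FC ⇒ IR-FC (PROVED)**: the collar discharges exactly the in-place input of `seedB1Odd_all_of_TBA`. -/
theorem inPlaceRigidityFC_of_collaredTrace (H : CollaredTraceFC) : InPlaceRigidityFC := by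
  intro h b Z hfc hZ hR
  obtain ⟨C, hU, hG, hS, hmem⟩ := hR
  obtain ⟨C', hU', hG', hS', -, -, hmem'⟩ := H h C hU hG hS b Z hfc hZ hmem
  exact ⟨C', hU', hG', hS', hmem'⟩

/-- the corrected chain with LINE 2's collar in place of (IR-FC) (PROVED implication):
`(CT-FC) ∧ (∀ n, TBA_{8+2n}) ∧ (W′) ⇒ ∀ n, T_{8+2n}`. -/
theorem seedB1Odd_all_of_collar (H : CollaredTraceFC) (A : ∀ n : ℕ, TopBandFCUnitsAnchored (8 + 2 * n))
    (W : SeedFCPCeilingUnitDiamond8G1H1) (n : ℕ) : SeedB1OddDiamondG1H1 (8 + 2 * n) :=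
  seedB1Odd_all_of_TBA (inPlaceRigidityFC_of_collaredTrace H) (topBandFCUnits_six_of_W W) A W n

/-- a trace whose upward obligations hold is its own collar: (UO at `C`) ⇒ the CT instance at `C` for every cell (PROVED; §14). -/
theorem collaredTrace_of_upward {h h' : ℤ} {C : MConfig} (hU : C.InDiamond h') (hG : C.G1Closed) (hS : C.StaticH1)
    (hO : C.UpwardObligations h) {b : Bool} {Z : MCell} (hZ : Z.InDiamond h) (hmem : if b then Z ∈ C.lower else Z ∈ C.upper) :
    ∃ C' : MConfig, C'.InDiamond h ∧ C'.G1Closed ∧ C'.StaticH1 ∧ C'.lower ⊆ (C.trace h).lower ∧ C'.upper ⊆ (C.trace h).upper ∧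
      (if b then Z ∈ C'.lower else Z ∈ C'.upper) := by
  obtain ⟨h1, h2, h3⟩ := MConfig.trace_admissible hU hG hS hO
  refine ⟨C.trace h, h1, h2, h3, subset_rfl, subset_rfl, ?_⟩
  cases b
  · simp only [Bool.false_eq_true, ↓reduceIte] at hmem ⊢; exact MConfig.mem_trace_upper.2 ⟨hmem, hZ⟩
  · simp only [↓reduceIte] at hmem ⊢; exact MConfig.mem_trace_lower.2 ⟨hmem, hZ⟩


/-! ## §15 (g3, 2026-08-28 22:5xZ) TRACE-FREE RE-BASING OF THE TOWER + CEILING RIGIDITY (RULE D forces the b-legs)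

(A) WHY.  The collar law (CT-FC) of §14.7 asks for a collar INSIDE THE TRACE OF THE SAME configuration.  That is strictly more than the tower
needs ((IR-FC) only asks that the cell be realisable at height `h` by SOME support), and it is exposed to a failure mode (IR-FC) is not: inside
`◇_{h+2}` the upward RULE-D obligations of an FC `P`-cell of `◇_h` can be met by servers∕covers OUTSIDE `◇_h` (e.g. the covers
`N[(h−2)I+2ℓ_u | hI | ((h−2)I+ℓ_u)²]^{S₄}` of the unit `P[(h−2)I+ℓ_u]⁴`), while inside `◇_h` the same obligations FORCE specific cells (B below);
a `◇_{h+2}` witness served the first way has no collar in its trace.  Pre-registered model-level test: F3d (hsemireg bus l.33756, reader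
`pred/ctcheck.py` 88e0333da8a3b108 = the RULE-D CORE of the ◇₈-trace of the THIRDCODE-b witnesses).
(B) CEILING RIGIDITY (PROVED, h-uniform, kernel): in ANY RULE-D-closed configuration inside `◇_h`, the ceiling unit `P[(h−2)I+ℓ_u]⁴` carries its
four b-legs `N[hI | ((h−2)I+ℓ_u)³]^{S₄}` (`ceilingUnit_forces_bLegs`): the coordinate pair `((g,u),(j,ū))` of the unit has values `h ≠ h−2`,
nothing of `◇_h` lies above the letter `(h−2)I+ℓ_u` except the apex `hI` along the antipode `ū` (`above_ceilingUnit_letter`), so neither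
`(g,u)` can be settled nor the pair covered, and RULE D leaves only «`(j,ū)` settled by the b-leg».  This is the first rung of the TOP-DOWN
FORCED CASCADE — the controlling structure of tall supports, read from the ceiling: it is BOOST-EQUIVARIANT (§7) until it meets the floor,
which is why `[6I+ℓ_u]⁴ ∈ Real₈` persists upward as `[(h−2)I+ℓ_u]⁴ ∈ Real_h` and why only FLOOR-ANCHORED TALL supports can carry anything new.
(C) THE RE-BASED TOWER (PROVED reductions, no trace, no collar): ONE law per height about ONE class of configurations,
  (TAF_h) `TallAnchoredFCUnits h`: the FC cells of a FLOOR-ANCHORED, TALL (not inside `◇_h`) admissible configuration of `◇_{h+2}` are upper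
  diagonal units `[tI+ℓ_k]⁴` with `t ≥ 6`;
  `realFCClassified_step_tall : TAF_h → CL_h → CL_{h+2}` (non-anchored supports boost down by K1 = `unboost_admissible`, short ones ARE `◇_h`
  supports, tall anchored ones are the hypothesis); `seedB1Odd_all_of_tall : (∀ n, TAF_{8+2n}) → (W′) → ∀ n, T_{8+2n}`;
  and (TAF_h) sits exactly at the K2 residue: `tallAnchored_of_IRFC_TBA : (IR-FC) → TBA_h → CL_h → TAF_h` (h ≥ 6) and
  `topBandAnchored_of_tall : TAF_h → TBA_h` (h even).  So the tower's inputs are now (W′) (machine ×2) and the single family (TAF_h) — a statement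
  about supports spanning floor to ceiling band, i.e. exactly the THRESHOLD-EXTREMAL class of §8.
(D) THE CONE FORM: `UpperUnitLawCone` («in the open forward cone every FC cell of an admissible G₁ H₁ configuration is an upper diagonal unit of
  level ≥ 6») ⇔ `∀ h, CL_h` (`realFCClassified_of_cone`, `upperUnitLawCone_of_all`); it implies (T_∞) outright (`seedB1OddCone_of_upperUnitLaw`).
HYPOTHESIS-FORM laws are NOT asserted; (W′), (TAF_h), CL_h are NOT kernel theorems; HC ∕ HC_CM ∕ HC_AV ∕ H2 ∕ (T₈) NOT proved. -/

/-! ### §15.1 The tall-anchored FC law and the re-based tower -/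

/-- **(TAF_h) TALL-ANCHORED FC UNITS (HYPOTHESIS FORM, conjectural; `h = 6`: = (W′) on tall anchored ◇₈ supports, machine ×2)**: in an admissible
configuration of `◇_{h+2}` that is FLOOR-ANCHORED and TALL (not contained in `◇_h`), every FC cell is an upper diagonal unit `[tI+ℓ_k]⁴`, `t ≥ 6`. -/
def TallAnchoredFCUnits (h : ℤ) : Prop :=
  ∀ C : MConfig, C.InDiamond (h + 2) → C.FloorAnchored → ¬ C.InDiamond h → C.G1Closed → C.StaticH1 →
    ∀ b : Bool, ∀ Z : MCell, FCc Z → (if b then Z ∈ C.lower else Z ∈ C.upper) →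
      b = false ∧ ∃ t : ℤ, ∃ k : Fin 4, 6 ≤ t ∧ Z = diagUnit t k

/-- **THE TRACE-FREE STEP (PROVED implication)**: `TAF_h ∧ CL_h ⇒ CL_{h+2}`. -/
theorem realFCClassified_step_tall {h : ℤ} (A : TallAnchoredFCUnits h) (H : RealFCClassified h) : RealFCClassified (h + 2) := by
  rintro b Z hfc ⟨C, hU, hG, hS, hZ⟩
  by_cases hA : C.FloorAnchored
  · by_cases hT : C.InDiamond h
    · exact H b Z hfc ⟨C, hT, hG, hS, hZ⟩
    · exact A C hU hA hT hG hS b Z hfc hZ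
  · obtain ⟨hU', hG', hS'⟩ := unboost_admissible hU hA hG hS
    have hZ' : if b then Z.boost (-2) ∈ (C.boostImage (-2)).lower else Z.boost (-2) ∈ (C.boostImage (-2)).upper := by
      cases b
      · simp only [Bool.false_eq_true, ↓reduceIte] at hZ ⊢
        exact Finset.mem_image_of_mem _ hZ
      · simp only [↓reduceIte] at hZ ⊢
        exact Finset.mem_image_of_mem _ hZ
    obtain ⟨hb, t, k, ht, e⟩ := H b (Z.boost (-2)) ((boost_fcc (-2) Z).mpr hfc) ⟨_, hU', hG', hS', hZ'⟩
    refine ⟨hb, t + 2, k, by omega, ?_⟩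
    have hZe : Z = (Z.boost (-2)).boost 2 := by rw [boost_boost]; norm_num; exact (boost_zero Z).symm
    rw [hZe, e, boost_diagUnit]

/-- the re-based tower of classifications from `CL_8`. -/
theorem realFCClassified_all_tall (A : ∀ n : ℕ, TallAnchoredFCUnits (8 + 2 * n)) (H8 : RealFCClassified 8) (n : ℕ) :
    RealFCClassified (8 + 2 * n) := by
  induction n with
  | zero => simpa using H8
  | succ m ih =>
    have e : (8 : ℤ) + 2 * ((m + 1 : ℕ) : ℤ) = 8 + 2 * (m : ℤ) + 2 := by push_cast; ring
    rw [e]; exact realFCClassified_step_tall (A m) ih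

/-- **`seedB1Odd_all_of_tall` (PROVED implication)**: `(∀ n, TAF_{8+2n}) ∧ (W′) ⇒ B1-odd at every height `8 + 2n`** — the trace-free chain;
its only inputs are the ◇₈ classification (W′) (machine ×2, hypothesis) and the tall-anchored law (conjectural). -/
theorem seedB1Odd_all_of_tall (A : ∀ n : ℕ, TallAnchoredFCUnits (8 + 2 * n)) (W : SeedFCPCeilingUnitDiamond8G1H1) (n : ℕ) :
    SeedB1OddDiamondG1H1 (8 + 2 * n) :=
  seedB1Odd_of_diagonal (seedFCDiagonal_of_classified
    (realFCClassified_all_tall A (realFCClassified_eight_iff_pCeilingUnit.mpr W) n))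

/-- (TAF_h) is implied by the pair of laws it replaces (PROVED): `(IR-FC) ∧ TBA_h ∧ CL_h ⇒ TAF_h` for `h ≥ 6`. -/
theorem tallAnchored_of_IRFC_TBA (R : InPlaceRigidityFC) {h : ℤ} (hh : 6 ≤ h) (T : TopBandFCUnitsAnchored h)
    (H : RealFCClassified h) : TallAnchoredFCUnits h := by
  intro C hU hFA _hT hG hS b Z hfc hZ
  by_cases hin : Z.InDiamond h
  · exact H b Z hfc (R h b Z hfc hin ⟨C, hU, hG, hS, hZ⟩)
  · obtain ⟨hb, k, rfl⟩ := T b Z hfc ⟨C, hU, hFA, hG, hS, hZ⟩ hin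
    exact ⟨hb, h, k, hh, rfl⟩

/-- … and implies the top-band half back (PROVED): `TAF_h ⇒ TBA_h` for even `h`. -/
theorem topBandAnchored_of_tall {h : ℤ} (he : h % 2 = 0) (A : TallAnchoredFCUnits h) : TopBandFCUnitsAnchored h := by
  rintro b Z hfc ⟨C, hU, hFA, hG, hS, hZ⟩ hnin
  have hmem : Z ∈ C.lower ∨ Z ∈ C.upper := by
    cases b
    · simp only [Bool.false_eq_true, ↓reduceIte] at hZ; exact Or.inr hZ
    · simp only [↓reduceIte] at hZ; exact Or.inl hZ
  have hT : ¬ C.InDiamond h := fun hT => hnin (hmem.elim (fun hZ => hT.1 Z hZ) (fun hZ => hT.2 Z hZ))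
  obtain ⟨hb, t, k, -, rfl⟩ := A C hU hFA hT hG hS b Z hfc hZ
  refine ⟨hb, k, ?_⟩
  have hx : InDiamond (h + 2) (diamondLetter t 1 k) := (hmem.elim (fun hZ => hU.1 _ hZ) (fun hZ => hU.2 _ hZ)) 0
  have hnot : ¬ InDiamond h (diamondLetter t 1 k) := fun hin => hnin fun _ => hin
  have hceil : OnCeiling (h + 2) (diamondLetter t 1 k) := by
    by_contra hc
    exact hnot ((inDiamond_iff_not_onCeiling he hx).mpr hc)
  have e1 : (diamondLetter t 1 k).1 = t + 1 := rfl
  have e2 := absCharge_diamondLetter_one t k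
  have ht : t = h := by unfold OnCeiling at hceil; omega
  subst ht; rfl

/-! ### §15.2 The cone form: one h-free statement for the whole tower of classifications -/

/-- **(UUL) THE UPPER-UNIT LAW IN THE OPEN CONE (HYPOTHESIS FORM, conjectural)**: every FC cell of an admissible G₁ H₁ configuration in the open
forward cone is an upper diagonal unit `[tI+ℓ_k]⁴` with `t ≥ 6`. -/
def UpperUnitLawCone : Prop :=
  ∀ C : MConfig, C.InCone → C.G1Closed → C.StaticH1 → ∀ b : Bool, ∀ Z : MCell, FCc Z → (if b then Z ∈ C.lower else Z ∈ C.upper) →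
    b = false ∧ ∃ t : ℤ, ∃ k : Fin 4, 6 ≤ t ∧ Z = diagUnit t k

/-- (UUL) ⇒ every CL_h (PROVED). -/
theorem realFCClassified_of_cone (U : UpperUnitLawCone) (h : ℤ) : RealFCClassified h := by
  rintro b Z hfc ⟨C, hU, hG, hS, hZ⟩
  exact U C (inCone_of_inDiamond' hU) hG hS b Z hfc hZ

/-- an admissible cone configuration carrying a cell lies in some `◇_{8+2n}`. -/
theorem exists_inDiamond_of_inCone {C : MConfig} (hC : C.InCone) {Z₀ : MCell} (hZ₀ : Z₀ ∈ C.lower ∨ Z₀ ∈ C.upper) :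
    ∃ n : ℕ, C.InDiamond (8 + 2 * n) := by
  have hne : C.letters.Nonempty := ⟨Z₀ 0, mem_letters hZ₀ 0⟩
  obtain ⟨x₁, hx₁, hmax⟩ := Finset.exists_max_image C.letters (fun x => x.1 + absCharge x) hne
  have hcone : ∀ x ∈ C.letters, InCone x := by
    intro x hx
    obtain ⟨Z, hZ, f, rfl⟩ := exists_of_mem_letters hx
    rcases hZ with hZ | hZ
    · exact hC.1 Z hZ f
    · exact hC.2 Z hZ f
  refine ⟨(x₁.1 + absCharge x₁).toNat, ⟨fun Z hZ f => ?_, fun Z hZ f => ?_⟩⟩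
  · have hx := hcone (Z f) (mem_letters (Or.inl hZ) f)
    have hle : (Z f).1 + absCharge (Z f) ≤ x₁.1 + absCharge x₁ := hmax (Z f) (mem_letters (Or.inl hZ) f)
    have : x₁.1 + absCharge x₁ ≤ ((x₁.1 + absCharge x₁).toNat : ℤ) := Int.self_le_toNat _
    exact ⟨hx.1, hx.2.1, hx.2.2, by omega⟩
  · have hx := hcone (Z f) (mem_letters (Or.inr hZ) f)
    have hle : (Z f).1 + absCharge (Z f) ≤ x₁.1 + absCharge x₁ := hmax (Z f) (mem_letters (Or.inr hZ) f)
    have : x₁.1 + absCharge x₁ ≤ ((x₁.1 + absCharge x₁).toNat : ℤ) := Int.self_le_toNat _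
    exact ⟨hx.1, hx.2.1, hx.2.2, by omega⟩

/-- every CL_{8+2n} ⇒ (UUL) (PROVED): a cone configuration lies in some `◇_{8+2n}`. -/
theorem upperUnitLawCone_of_all (H : ∀ n : ℕ, RealFCClassified (8 + 2 * n)) : UpperUnitLawCone := by
  intro C hC hG hS b Z hfc hZ
  have hmem : Z ∈ C.lower ∨ Z ∈ C.upper := by
    cases b
    · simp only [Bool.false_eq_true, ↓reduceIte] at hZ; exact Or.inr hZ
    · simp only [↓reduceIte] at hZ; exact Or.inl hZ
  obtain ⟨n, hU⟩ := exists_inDiamond_of_inCone hC hmem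
  exact H n b Z hfc ⟨C, hU, hG, hS, hZ⟩

/-- (UUL) ⇒ (T_∞) (PROVED): the h-uniform B1-odd statement follows from the upper-unit law in the cone. -/
theorem seedB1OddCone_of_upperUnitLaw (U : UpperUnitLawCone) : SeedB1OddConeG1H1 :=
  seedB1OddConeIff.mpr fun h => seedB1Odd_of_diagonal (seedFCDiagonal_of_classified (realFCClassified_of_cone U h))

/-- and the tower gives it back (PROVED): `(∀ n, TAF_{8+2n}) ∧ (W′) ⇒ (UUL)`. -/
theorem upperUnitLawCone_of_tall (A : ∀ n : ℕ, TallAnchoredFCUnits (8 + 2 * n)) (W : SeedFCPCeilingUnitDiamond8G1H1) :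
    UpperUnitLawCone :=
  upperUnitLawCone_of_all (realFCClassified_all_tall A (realFCClassified_eight_iff_pCeilingUnit.mpr W))

/-! ### §15.3 CEILING RIGIDITY: inside `◇_h`, RULE D forces the b-legs under the ceiling unit (PROVED, h-uniform) -/

/-- above the ceiling-unit letter `(h−2)I+ℓ_u`, the only letter of `◇_h` reached by a positive null step is the apex `hI`, along the antipode
`u + 2` (own direction `u` leaves the window; the odd directions leave the axes). -/
theorem above_ceilingUnit_letter {h e : ℤ} {u r : Fin 4} (he : 0 < e)
    (hx : InDiamond h (ray (diamondLetter (h - 2) 1 u) r e)) : r = u + 2 ∧ e = 1 := by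
  obtain ⟨hax, -, -, hA⟩ := hx
  have c1 := le_abs_self (chargeOf (ray (diamondLetter (h - 2) 1 u) r e))
  have c2 := neg_le_abs (chargeOf (ray (diamondLetter (h - 2) 1 u) r e))
  fin_cases u <;> fin_cases r <;> simp [AxisPt, absCharge, chargeOf] at hax hA c1 c2 ⊢ <;> omega

/-- the ceiling-unit letter is not an apex and is adapted to its own frame with coordinates `h` (own direction) and `h − 2` (antipode). -/
theorem ceilingUnit_letter_facts (h : ℤ) (u : Fin 4) :
    ¬ isApex (diamondLetter (h - 2) 1 u) ∧ Adapted (diamondLetter (h - 2) 1 u) u ∧ Adapted (diamondLetter (h - 2) 1 u) (u + 2) ∧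
      coord (diamondLetter (h - 2) 1 u) u = h ∧ coord (diamondLetter (h - 2) 1 u) (u + 2) = h - 2 := by
  fin_cases u <;> simp [isApex, Adapted, coord] <;> omega

/-- **CEILING RIGIDITY (PROVED)**: in a configuration inside `◇_h` whose `P`-cells pass RULE D, the ceiling unit `P[(h−2)I+ℓ_u]⁴` carries all four
b-legs `N[hI | ((h−2)I+ℓ_u)³]^{S₄}` — the `j`-th b-leg is the unit with its `j`-th letter replaced by the apex `hI`. -/
theorem ceilingUnit_forces_bLegs {h : ℤ} {C : MConfig} (hU : C.InDiamond h) (hD : ∀ P ∈ C.upper, RuleDMu4P C P)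
    {u : Fin 4} (hP : diagUnit (h - 2) u ∈ C.upper) (j : Fin 4) :
    Function.update (diagUnit (h - 2) u) j (h, 0, 0) ∈ C.lower := by
  obtain ⟨hnap, hadu, hadu', hcu, hcu'⟩ := ceilingUnit_letter_facts h u
  have hg : j + 1 ≠ j := by
    intro e
    have := congrArg (fun x : Fin 4 => x - j) e
    simp at this
  set g : Fin 4 := j + 1 with hgdef
  have hne : coord (diagUnit (h - 2) u g) u ≠ coord (diagUnit (h - 2) u j) (u + 2) := by
    show coord (diamondLetter (h - 2) 1 u) u ≠ coord (diamondLetter (h - 2) 1 u) (u + 2)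
    rw [hcu, hcu']; omega
  rcases hD _ hP g j hg u (u + 2) hadu hadu' hne with hS | hS | hC
  · -- `(g,u)` settled above: a server above the ceiling-unit letter in a direction `r ≠ u+2` — impossible inside `◇_h`
    obtain ⟨r, hr, N, hN, -, hlt, hray⟩ := hS
    have hx : InDiamond h (N g) := hU.1 N hN g
    rw [hray] at hx
    exact absurd (above_ceilingUnit_letter (by simpa using hlt) hx).1 hr
  · -- `(j,u+2)` settled above: the server is the b-leg
    obtain ⟨r, -, N, hN, hagree, hlt, hray⟩ := hS
    have hx : InDiamond h (N j) := hU.1 N hN j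
    rw [hray] at hx
    obtain ⟨rfl, he⟩ := above_ceilingUnit_letter (by simpa using hlt) hx
    have hNj : N j = (h, 0, 0) := by
      rw [hray, he]
      show ray (diamondLetter (h - 2) 1 u) (u + 2) 1 = (h, 0, 0)
      fin_cases u <;> simp <;> omega
    convert hN using 1
    funext f
    by_cases hf : f = j
    · subst hf; simp [hNj]
    · rw [Function.update_of_ne hf]; exact hagree f hf
  · -- a cover moving `(g,u)`: its `g`-letter lies above the ceiling-unit letter along `u` — impossible inside `◇_h`
    obtain ⟨a, b, ha, -, N, hN, -, hlt, hray, -, -⟩ := hC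
    have ha' : a = u := by
      rcases ha with ha | ⟨hap, -⟩
      · exact ha
      · exact absurd hap hnap
    subst ha'
    have hx : InDiamond h (N g) := hU.1 N hN g
    rw [hray] at hx
    have h2 := (above_ceilingUnit_letter (by simpa using hlt) hx).1
    exact absurd h2 (by fin_cases a <;> decide)

/-- in particular in an ADMISSIBLE `◇_h` configuration (H₁-static ⊇ RULE-D-closed). -/
theorem ceilingUnit_forces_bLegs_of_staticH1 {h : ℤ} {C : MConfig} (hU : C.InDiamond h) (hS : C.StaticH1)
    {u : Fin 4} (hP : diagUnit (h - 2) u ∈ C.upper) (j : Fin 4) :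
    Function.update (diagUnit (h - 2) u) j (h, 0, 0) ∈ C.lower :=
  ceilingUnit_forces_bLegs hU hS.1.2 hP j

/-- hence a REALISABLE ceiling unit is never alone: `[(h−2)I+ℓ_u]⁴ ∈ Real_h` (upper) forces the b-leg `N[hI|((h−2)I+ℓ_u)³] ∈ Real_h` (lower) —
the first rung of the top-down forced cascade, uniformly in `h`. -/
theorem bLeg_realisable_of_ceilingUnit {h : ℤ} {u : Fin 4} (H : CellRealisable h false (diagUnit (h - 2) u)) (j : Fin 4) :
    CellRealisable h true (Function.update (diagUnit (h - 2) u) j (h, 0, 0)) := by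
  obtain ⟨C, hU, hG, hS, hZ⟩ := H
  exact ⟨C, hU, hG, hS, by simpa using ceilingUnit_forces_bLegs_of_staticH1 hU hS (by simpa using hZ) j⟩


/-! ## §16 (g3, v14) CEILING RIGIDITY II — a charged letter ON THE CEILING LINE pins every other factor (PROVED, h-uniform)
§15.3 generalised from the diagonal unit to an ARBITRARY `P`-cell with a charged ceiling letter `tI + cℓ_u` (`c ≥ 1`, `t + 2c = h`) on some
factor `g`: inside `◇_h` the coordinate `(g,u)` (value `h`) can be neither SETTLED (a server above a ceiling letter exists only along the antipode
`u+2`, `above_ceiling_letter`) nor COVERED (`DirOK` forces the cover to move `g` along `u`, out of the window), so typed RULE D at the pair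
`((g,u),(j,k′))` leaves exactly «`(j,k′)` settled above» for EVERY other factor `j` and every adapted direction `k′` with `coord (Z j) k′ ≠ h`
(`settledAbove_of_ceiling_letter`). Read on a CHARGED other letter `t′I + c′ℓ_v` (`ray_charged_inDiamond`: from a charged letter only the
directions `v`, `v+2` stay on the axes): the ANTIPODAL SERVER `Z[j ↦ Z j + e·n_{v+2}]`, `e ≥ 1`, is forced always (`antipodalServer_of_ceiling_letter`;
for `c′ = 1`, `t′ = h − 2` it is the b-leg of §15.3), and the OWN-DIRECTION SERVER `Z[j ↦ Z j + e·n_v]` (an `N`-cell with the SAME support off `j`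
and a letter of HIGHER charge on `j` — an FC `N`-cell whenever `Z` is FC) is forced as soon as that letter is NOT itself on the ceiling line
(`ownServer_of_ceiling_letter`). COROLLARY (`fc_touching_ceiling_flat_of_noFCN`): in an admissible `◇_h` configuration WITHOUT FC `N`-cells, every
FC `P`-cell with one letter on the ceiling line has ALL FOUR letters on the ceiling line («ceiling-flat»). This is the typed reason why the top band
of the census is so thin: at `◇₈`, (W′) says there are no FC `N`-cells, and indeed its only FC `P`-cells, the ceiling units, are ceiling-flat; at
`◇₁₀` the THIRDCODE-b rows (kit j317021: x-fcnondiag, x-anyfc ∕ x-fcdiagoff models) are the census face of the same statement one height up.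
Nothing here asserts (TAF_h) ∕ (TBA_h); these are lemmas about typed RULE D inside a window. -/

/-- from a CHARGED letter `tI + cℓ_v` (`c ≥ 1`) a positive null step stays on the coordinate axes only in the directions `v` and `v + 2`. -/
theorem ray_charged_inDiamond {h t c e : ℤ} {v r : Fin 4} (hc : 1 ≤ c) (he : 0 < e)
    (hx : InDiamond h (ray (diamondLetter t c v) r e)) : r = v ∨ r = v + 2 := by
  obtain ⟨hax, -, -, -⟩ := hx
  have hc1 : 1 ≤ c := hc
  fin_cases v <;> fin_cases r <;> simp [AxisPt] at hax ⊢ <;> omega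

/-- above a charged letter ON THE CEILING LINE of `◇_h` (`t + 2c = h`) the only direction with room is the antipode `v + 2`. -/
theorem above_ceiling_letter {h t c e : ℤ} {v r : Fin 4} (hc : 1 ≤ c) (ht : t + 2 * c = h) (he : 0 < e)
    (hx : InDiamond h (ray (diamondLetter t c v) r e)) : r = v + 2 := by
  obtain ⟨hax, -, -, hA⟩ := hx
  have c1 := le_abs_self (chargeOf (ray (diamondLetter t c v) r e))
  have c2 := neg_le_abs (chargeOf (ray (diamondLetter t c v) r e))
  fin_cases v <;> fin_cases r <;> simp [AxisPt, absCharge, chargeOf] at hax hA c1 c2 ⊢ <;> omega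

/-- a charged letter is not an apex, is adapted to its own frame, and has coordinates `t + 2c` (own direction) and `t` (antipode). -/
theorem charged_letter_facts {t c : ℤ} (hc : 1 ≤ c) (v : Fin 4) :
    ¬ isApex (diamondLetter t c v) ∧ Adapted (diamondLetter t c v) v ∧ Adapted (diamondLetter t c v) (v + 2) ∧
      coord (diamondLetter t c v) v = t + 2 * c ∧ coord (diamondLetter t c v) (v + 2) = t := by
  fin_cases v <;> simp [isApex, Adapted, coord] <;> omega

/-- the causal height `α + c` of a charged letter `tI + cℓ_v` is `t + 2c`; inside `◇_h` hence `t + 2c ≤ h`. -/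
theorem charged_letter_height_le {h t c : ℤ} {v : Fin 4} (_hc : 1 ≤ c) (hx : InDiamond h (diamondLetter t c v)) : t + 2 * c ≤ h := by
  obtain ⟨-, -, -, hA⟩ := hx
  have c3 : c ≤ |c| := le_abs_self c
  fin_cases v <;> simp [absCharge, chargeOf] at hA ⊢ <;> omega

/-- **CEILING RIGIDITY II (PROVED, h-uniform).** In a configuration inside `◇_h`, let the `P`-cell `Z` pass typed RULE D and carry a CHARGED letter
ON THE CEILING LINE on factor `g` (`Z g = tI + cℓ_u`, `c ≥ 1`, `t + 2c = h`). Then every other adapted coordinate `(j,k′)` of value `≠ h` is SETTLED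
ABOVE (served above on `j` in a direction other than `k′ + 2`): the ceiling coordinate `(g,u)` itself admits neither a server nor a cover. -/
theorem settledAbove_of_ceiling_letter {h : ℤ} {C : MConfig} (hU : C.InDiamond h) {Z : MCell} (hD : RuleDMu4P C Z)
    {g : Fin 4} {t c : ℤ} {u : Fin 4} (hc : 1 ≤ c) (ht : t + 2 * c = h) (hZg : Z g = diamondLetter t c u)
    {j : Fin 4} (hjg : j ≠ g) {k' : Fin 4} (had : Adapted (Z j) k') (hne : coord (Z j) k' ≠ h) :
    SettledAbove C Z j k' := by
  obtain ⟨hnap, hadu, -, hcu, -⟩ := charged_letter_facts (t := t) hc u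
  have hadu' : Adapted (Z g) u := by rw [hZg]; exact hadu
  have hne' : coord (Z g) u ≠ coord (Z j) k' := by
    rw [hZg, hcu, ht]; exact fun e => hne e.symm
  rcases hD g j (Ne.symm hjg) u k' hadu' had hne' with hS | hS | hC
  · -- `(g,u)` settled above: a server above the ceiling letter in a direction `r ≠ u+2` — impossible inside `◇_h`
    obtain ⟨r, hr, N, hN, -, hlt, hray⟩ := hS
    rw [hZg] at hlt hray
    have hx : InDiamond h (N g) := hU.1 N hN g
    rw [hray] at hx
    exact absurd (above_ceiling_letter hc ht (sub_pos.mpr hlt) hx) hr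
  · exact hS
  · -- a cover moving `(g,u)`: `DirOK` at the charged letter forces the direction `u` — out of the window
    obtain ⟨a, b, ha, -, N, hN, -, hlt, hray, -, -⟩ := hC
    have ha' : a = u := by
      rcases ha with ha | ⟨hap, -⟩
      · exact ha
      · rw [hZg] at hap; exact absurd hap hnap
    rw [hZg] at hlt hray
    have hx : InDiamond h (N g) := hU.1 N hN g
    rw [hray] at hx
    have h2 := above_ceiling_letter hc ht (sub_pos.mpr hlt) hx
    rw [ha'] at h2
    exact absurd h2 (by fin_cases u <;> decide)

/-- **the ANTIPODAL SERVER is forced.** With `Z` as above and a CHARGED letter `t′I + c′ℓ_v` on another factor `j`, some `N`-cell agreeing with `Z`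
off `j` has `N j = Z j + e·n_{v+2}`, `e ≥ 1` (the b-leg when `c′ = 1`, `t′ = h − 2`; an FC `N`-cell when `e < c′`). -/
theorem antipodalServer_of_ceiling_letter {h : ℤ} {C : MConfig} (hU : C.InDiamond h) {Z : MCell} (hZ : Z ∈ C.upper) (hD : RuleDMu4P C Z)
    {g : Fin 4} {t c : ℤ} {u : Fin 4} (hc : 1 ≤ c) (ht : t + 2 * c = h) (hZg : Z g = diamondLetter t c u)
    {j : Fin 4} (hjg : j ≠ g) {t' c' : ℤ} {v : Fin 4} (hc' : 1 ≤ c') (hZj : Z j = diamondLetter t' c' v) :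
    ∃ N ∈ C.lower, MAgree N Z j ∧ ∃ e : ℤ, 0 < e ∧ N j = ray (Z j) (v + 2) e := by
  obtain ⟨-, -, hadv', -, hcv'⟩ := charged_letter_facts (t := t') hc' v
  have had : Adapted (Z j) (v + 2) := by rw [hZj]; exact hadv'
  have hle : t' + 2 * c' ≤ h := charged_letter_height_le hc' (by rw [← hZj]; exact hU.2 Z hZ j)
  have hne : coord (Z j) (v + 2) ≠ h := by rw [hZj, hcv']; omega
  obtain ⟨r, hr, N, hN, hag, hlt, hray⟩ := settledAbove_of_ceiling_letter hU hD hc ht hZg hjg had hne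
  refine ⟨N, hN, fun f hf => (hag f hf).symm, (N j).1 - (Z j).1, sub_pos.mpr hlt, ?_⟩
  have hx : InDiamond h (N j) := hU.1 N hN j
  rw [hray, hZj] at hx
  have hr' : r = v ∨ r = v + 2 := ray_charged_inDiamond hc' (by rw [hZj] at hlt; exact sub_pos.mpr hlt) hx
  have hrv : r ≠ v := by
    intro e; apply hr; rw [e]
    fin_cases v <;> decide
  rcases hr' with h1 | h1
  · exact absurd h1 hrv
  · rw [← h1]; exact hray

/-- **the OWN-DIRECTION SERVER is forced below the ceiling.** If moreover the letter on `j` is NOT on the ceiling line (`t′ + 2c′ ≠ h`), some `N`-cell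
agreeing with `Z` off `j` has `N j = Z j + e·n_v`, `e ≥ 1` — the same support off `j` with a letter of HIGHER charge `c′ + e` and the same phase on `j`. -/
theorem ownServer_of_ceiling_letter {h : ℤ} {C : MConfig} (hU : C.InDiamond h) {Z : MCell} (hD : RuleDMu4P C Z)
    {g : Fin 4} {t c : ℤ} {u : Fin 4} (hc : 1 ≤ c) (ht : t + 2 * c = h) (hZg : Z g = diamondLetter t c u)
    {j : Fin 4} (hjg : j ≠ g) {t' c' : ℤ} {v : Fin 4} (hc' : 1 ≤ c') (hZj : Z j = diamondLetter t' c' v) (hnc : t' + 2 * c' ≠ h) :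
    ∃ N ∈ C.lower, MAgree N Z j ∧ ∃ e : ℤ, 0 < e ∧ N j = ray (Z j) v e := by
  obtain ⟨-, hadv, -, hcv, -⟩ := charged_letter_facts (t := t') hc' v
  have had : Adapted (Z j) v := by rw [hZj]; exact hadv
  have hne : coord (Z j) v ≠ h := by rw [hZj, hcv]; exact hnc
  obtain ⟨r, hr, N, hN, hag, hlt, hray⟩ := settledAbove_of_ceiling_letter hU hD hc ht hZg hjg had hne
  refine ⟨N, hN, fun f hf => (hag f hf).symm, (N j).1 - (Z j).1, sub_pos.mpr hlt, ?_⟩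
  have hx : InDiamond h (N j) := hU.1 N hN j
  rw [hray, hZj] at hx
  have hr' : r = v ∨ r = v + 2 := ray_charged_inDiamond hc' (by rw [hZj] at hlt; exact sub_pos.mpr hlt) hx
  rcases hr' with h1 | h1
  · rw [← h1]; exact hray
  · exact absurd h1 hr

/-- the own-direction server of an FC `P`-cell is an FC `N`-cell: raising the charge of one letter along its own phase keeps every letter charged. -/
theorem fcc_of_ownServer {Z N : MCell} (hF : FCc Z) {j : Fin 4} (hag : MAgree N Z j) {t' c' e : ℤ} {v : Fin 4} (hc' : 1 ≤ c') (he : 0 < e)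
    (hZj : Z j = diamondLetter t' c' v) (hNj : N j = ray (Z j) v e) : FCc N := by
  intro f
  by_cases hf : f = j
  · subst hf
    rw [hNj, hZj]
    fin_cases v <;> simp <;> omega
  · rw [hag f hf]; exact hF f

/-- a charged `◇`-letter is a table letter: `x = tI + cℓ_v` with `c = absCharge x ≥ 1` and `t = x.1 − c`. -/
theorem exists_diamondLetter_of_charged {h : ℤ} {x : BPoint} (hx : InDiamond h x) (hc : x.2 ≠ (0, 0)) :
    ∃ t c : ℤ, ∃ v : Fin 4, 1 ≤ c ∧ x = diamondLetter t c v ∧ t + 2 * c = x.1 + absCharge x := by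
  obtain ⟨hax, -, -, -⟩ := hx
  obtain ⟨a, b, d⟩ := x
  rcases hax with h0 | ⟨hb, hd⟩ | ⟨hb, hd⟩
  · exact absurd h0 hc
  · simp only at hb hd; subst hd
    rcases lt_or_gt_of_ne hb with hneg | hpos
    · refine ⟨a + b, -b, 2, by omega, ?_, ?_⟩ <;> simp [absCharge, chargeOf, abs_of_neg hneg]
      ring
    · refine ⟨a - b, b, 0, by omega, ?_, ?_⟩ <;> simp [absCharge, chargeOf, abs_of_pos hpos]
      ring
  · simp only at hb hd; subst hb
    rcases lt_or_gt_of_ne hd with hneg | hpos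
    · refine ⟨a + d, -d, 1, by omega, ?_, ?_⟩ <;> simp [absCharge, chargeOf, abs_of_pos (by omega : (0:ℤ) < -d)]
      ring
    · refine ⟨a - d, d, 3, by omega, ?_, ?_⟩ <;> simp [absCharge, chargeOf, abs_of_neg (by omega : -d < (0:ℤ))]
      ring

/-- **COROLLARY (PROVED): without FC `N`-cells, FC `P`-cells touching the ceiling are CEILING-FLAT.** In a configuration inside `◇_h` whose `P`-cells
pass RULE D and which has NO FC `N`-cell, an FC `P`-cell with one letter on the ceiling line `α + c = h` has all four letters on it. -/
theorem fc_touching_ceiling_flat_of_noFCN {h : ℤ} {C : MConfig} (hU : C.InDiamond h) (hD : ∀ P ∈ C.upper, RuleDMu4P C P)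
    (hN : ∀ N ∈ C.lower, ¬ FCc N) {Z : MCell} (hZ : Z ∈ C.upper) (hF : FCc Z) {g : Fin 4} (hg : OnCeiling h (Z g)) (j : Fin 4) :
    OnCeiling h (Z j) := by
  by_cases hjg : j = g
  · rw [hjg]; exact hg
  obtain ⟨t, c, u, hc, hZg, htc⟩ := exists_diamondLetter_of_charged (hU.2 Z hZ g) (hF g)
  obtain ⟨t', c', v, hc', hZj, htc'⟩ := exists_diamondLetter_of_charged (hU.2 Z hZ j) (hF j)
  have ht : t + 2 * c = h := by rw [htc]; exact hg
  by_contra hnc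
  have hnc' : t' + 2 * c' ≠ h := by rw [htc']; exact hnc
  obtain ⟨N, hNm, hag, e, he, hNj⟩ := ownServer_of_ceiling_letter hU (hD Z hZ) hc ht hZg hjg hc' hZj hnc'
  exact hN N hNm (fcc_of_ownServer hF hag hc' he hZj hNj)


/-- **COROLLARY (PROVED): without FC `N`-cells, every FC `P`-cell touching the ceiling carries ALL ITS APEX LIFTS.** With `C`, `Z`, `g` as in
`fc_touching_ceiling_flat_of_noFCN`, for every `j ≠ g` the cell `Z[j ↦ hI]` is an `N`-cell of `C`: the antipodal server on `j` can stop short of the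
apex only at an FC `N`-cell (and cannot pass it inside the window). For the ceiling unit these are the b-legs of §15.3 (there no hypothesis on
`N`-cells is needed). -/
theorem apexLift_of_ceiling_letter_noFCN {h : ℤ} {C : MConfig} (hU : C.InDiamond h) (hD : ∀ P ∈ C.upper, RuleDMu4P C P)
    (hN : ∀ N ∈ C.lower, ¬ FCc N) {Z : MCell} (hZ : Z ∈ C.upper) (hF : FCc Z) {g : Fin 4} (hg : OnCeiling h (Z g))
    {j : Fin 4} (hjg : j ≠ g) : Function.update Z j (h, 0, 0) ∈ C.lower := by
  obtain ⟨t, c, u, hc, hZg, htc⟩ := exists_diamondLetter_of_charged (hU.2 Z hZ g) (hF g)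
  obtain ⟨t', c', v, hc', hZj, htc'⟩ := exists_diamondLetter_of_charged (hU.2 Z hZ j) (hF j)
  have ht : t + 2 * c = h := by rw [htc]; exact hg
  have ht' : t' + 2 * c' = h := by rw [htc']; exact fc_touching_ceiling_flat_of_noFCN hU hD hN hZ hF hg j
  obtain ⟨N, hNm, hag, e, he, hNj⟩ := antipodalServer_of_ceiling_letter hU hZ (hD Z hZ) hc ht hZg hjg hc' hZj
  have hx : InDiamond h (N j) := hU.1 N hNm j
  rw [hNj, hZj] at hx
  have hec : e = c' := by
    by_contra hne
    rcases lt_or_gt_of_ne hne with hlt | hgt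
    · -- the server stops short of the apex: it is an FC `N`-cell
      apply hN N hNm
      intro f
      by_cases hf : f = j
      · subst hf; rw [hNj, hZj]; fin_cases v <;> simp <;> omega
      · rw [hag f hf]; exact hF f
    · -- the server passes the apex: it leaves the window
      obtain ⟨-, -, -, hA⟩ := hx
      have c1 := le_abs_self (chargeOf (ray (diamondLetter t' c' v) (v + 2) e))
      have c2 := neg_le_abs (chargeOf (ray (diamondLetter t' c' v) (v + 2) e))
      fin_cases v <;> simp [absCharge, chargeOf] at hA c1 c2 <;> omega
  subst hec
  have hNj' : N j = (h, 0, 0) := by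
    rw [hNj, hZj, ← ht']
    refine Prod.ext ?_ (Prod.ext ?_ ?_) <;> fin_cases v <;> simp <;> omega
  convert hNm using 1
  funext f
  by_cases hf : f = j
  · subst hf; simp [hNj']
  · rw [Function.update_of_ne hf]; exact (hag f hf).symm

/-! ### §16.2 (TAF_h) is exactly the part of (CL_{h+2}) not already in (CL_h): the tower of classifications, re-indexed -/

/-- (TAF_h) is a WEAKENING of (CL_{h+2}) (it only speaks about some of the admissible `◇_{h+2}` configurations) … -/
theorem tallAnchored_of_classified {h : ℤ} (H : RealFCClassified (h + 2)) : TallAnchoredFCUnits h := by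
  intro C hU _ _ hG hS b Z hfc hmem
  exact H b Z hfc ⟨C, hU, hG, hS, hmem⟩

/-- … so with `realFCClassified_step_tall` the whole tower reads `∀ h ≥ 8 even, CL_h ⟺ CL_8 ∧ ∀ n, TAF_{8+2n}`; in particular the FIRST RUNG
(TAF_6) is (W′) read on the tall anchored `◇₈` supports (machine ×2: kit j309715 rows + W17; hypothesis in the kernel). -/
theorem tallAnchored_six_of_W' (W : SeedFCPCeilingUnitDiamond8G1H1) : TallAnchoredFCUnits 6 :=
  tallAnchored_of_classified (by
    have H := realFCClassified_eight_iff_pCeilingUnit.mpr W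
    norm_num
    exact H)

/-- the tower of classifications and the tall-anchored laws carry the same information above `◇₈`. -/
theorem realFCClassified_all_iff_tall :
    (∀ n : ℕ, RealFCClassified (8 + 2 * n)) ↔ RealFCClassified 8 ∧ ∀ n : ℕ, TallAnchoredFCUnits (8 + 2 * n) := by
  constructor
  · intro H
    refine ⟨by simpa using H 0, fun n => tallAnchored_of_classified ?_⟩
    have := H (n + 1)
    push_cast at this
    rw [show (8 : ℤ) + 2 * (n + 1) = 8 + 2 * n + 2 by ring] at this
    exact this
  · rintro ⟨H8, T⟩ n
    exact realFCClassified_all_tall T H8 n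


/-! ## §17 (g3, v15) THE POSITION SPLIT OF (TAF_h), THE SHRUNK CEILING CLASS, AND THE UNIT'S SECOND RUNG (PROVED, h-uniform)
Critic of record (idea-crit-6 g5, 2026-08-28 23:11:38Z, LINE 2′ PASS-WITH-PRICE; director-hodge R17.72): «LINE 2′ = exact re-basing + ceiling
engine §15.3∕§16 + floor lemmas + UNIT LAW; interior OPEN; progress measured ONLY by kernel lemmas shrinking the interior class h-uniformly, never
by census rows». This section TYPES that accounting; nothing in it is a census read, and nothing asserts (TAF_h).
§17.1 THE SPLIT. An FC cell of a tall floor-anchored admissible `◇_{h+2}` configuration is an `N`-cell, or a `P`-cell that touches the ceiling line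
`α + c = h + 2`, or touches the floor line `α = c`, or neither (INTERIOR). Accordingly (`tallAnchored_iff_split`, PROVED)
  `TallAnchoredFCUnits h ↔ TallNoFCN h ∧ CeilingFlatUnitLaw h ∧ TallNoFloorFCP h ∧ TallInteriorFCP h`,
where the CEILING class has been SHRUNK by the §16 engine (`fc_touching_ceiling_flat_of_noFCN`, `apexLift_of_ceiling_letter_noFCN`): given no FC
`N`-cells, a ceiling-touching FC `P`-cell is ceiling-flat and carries all four apex lifts `Z[j ↦ (h+2)I] ∈ C.lower`, so the only residual
statement about the ceiling class is `CeilingFlatUnitLaw h` «a ceiling-flat FC `P`-cell whose four apex lifts are present is a diagonal unit»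
(`tallCeilingFCP_of_noFCN_flatUnit`, PROVED). What remains OPEN, typed and each strictly narrower than (TAF_h): `TallNoFCN h`, `CeilingFlatUnitLaw h`,
`TallNoFloorFCP h`, `TallInteriorFCP h` (interior FC `P`-cells are units `[tI+ℓ_k]⁴`, `6 ≤ t ≤ h − 2`) — the last is the honest gap of LINE 2′.
§17.2 THE UNIT'S SECOND RUNG. Typed RULE D at the b-leg `N_j = [(h−2)I+ℓ_u]⁴[j ↦ hI]` (§15.3), read at the pair `((j,u),(g,u+2))` (coordinates `h`
vs `h − 2`), leaves inside `◇_h` exactly three typed possibilities (`bLeg_menu`, PROVED): (a) a SIBLING `P`-cell `[(h−2)I+ℓ_u]⁴[j ↦ (h−2e)I+eℓ_w]`,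
`e ≥ 1`, `w ≠ u` (ceiling-flat, FC, not a unit); (b) a SERVER `P`-cell `N_j[g ↦ (h−2−2e)I+(1+e)ℓ_u]`, `e ≥ 1` (one apex factor; `e = 1` is the
anomaly lens' `UnitLaw.server h` up to `S₄ × G₁`); (c) a COVER `P`-cell `[(h−2)I+ℓ_u]⁴[j ↦ (h−2e₁)I+e₁ℓ_w, g ↦ (h−2−2e₂)I+(1+e₂)ℓ_u]`, `w ≠ u`
(ceiling-flat, FC, not a unit). Hence (`unitServer_of_flatUnits`, PROVED): in a RULE-D-closed `◇_h` configuration whose ceiling-flat FC `P`-cells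
are all diagonal units — which (TAF) asserts of the tall anchored ones — every ordered pair `(j,g)` of factors of a present ceiling unit carries
a SERVER of some depth `e ≥ 1`. COMPOSITION WITH THE UNIT LAW (paper, census-neutral; director R17.64, optional): anomaly's
`AnomalyLens.UnitLaw.unit_law` (`Cruxes/BlochSeedDiscOne/AFlatUnitLaw.lean` v1.1 de916bd1d8070735) takes the binders `unit h ∈ S.upper`,
`bLeg h ∈ S.lower`, `server h ∈ S.upper`, `server h ∉ S.lower` and concludes `¬ A2IMinusClosed (S.dual h)`; §15.3 supplies the b-leg binder from typed
RULE D alone, and `unitServer_of_flatUnits` supplies a server of SOME depth `e ≥ 1` in a flat-unit world (binder 4 is its `e = 1` instance; RULE D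
does not choose the depth and says nothing about binder 5). The kernel composition is not written here only because the farm cannot import the
unbuilt `Cruxes` module (it is one modus ponens). The (8,10) census face of the four classes is THIRDCODE-b rows 3–5 (kit j317021) and the j318002
stage-2 reads, under the critic's fixed words (α)–(δ); none is read here. -/

/-! ### §17.1 position classes and the exact split -/

/-- the cell `Z` TOUCHES THE CEILING of `◇_H`: some letter lies on the ceiling line `α + c = H`. -/
def MCell.TouchesCeiling (H : ℤ) (Z : MCell) : Prop := ∃ g, OnCeiling H (Z g)

/-- the cell `Z` TOUCHES THE FLOOR: some letter lies on the floor line `α = c` (node level `t = 0`). -/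
def MCell.TouchesFloor (Z : MCell) : Prop := ∃ g, OnFloor (Z g)

/-- the cell `Z` is CEILING-FLAT in `◇_H`: all four letters lie on the ceiling line. -/
def MCell.CeilingFlat (H : ℤ) (Z : MCell) : Prop := ∀ g, OnCeiling H (Z g)

/-- (TAF-N_h) «NO FC `N`-CELLS»: a tall floor-anchored admissible `◇_{h+2}` configuration has no fully charged `N`-cell. OPEN, h-uniform
(hypothesis form; at `h = 6` it is a conjunct of (W′) read on the tall supports). -/
def TallNoFCN (h : ℤ) : Prop :=
  ∀ C : MConfig, C.InDiamond (h + 2) → C.FloorAnchored → ¬ C.InDiamond h → C.G1Closed → C.StaticH1 → ∀ N ∈ C.lower, ¬ FCc N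

/-- (TAF-C♭_h) «CEILING-FLAT UNIT LAW» — the RESIDUAL of the ceiling class after §16: in a tall floor-anchored admissible `◇_{h+2}` configuration a
ceiling-flat FC `P`-cell all of whose apex lifts `Z[j ↦ (h+2)I]` are `N`-cells of the configuration is a diagonal unit `[tI+ℓ_k]⁴` with `t ≥ 6`
(then necessarily `t = h`, `onCeiling_diagUnit_iff`). OPEN, h-uniform (hypothesis form). -/
def CeilingFlatUnitLaw (h : ℤ) : Prop :=
  ∀ C : MConfig, C.InDiamond (h + 2) → C.FloorAnchored → ¬ C.InDiamond h → C.G1Closed → C.StaticH1 →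
    ∀ Z ∈ C.upper, FCc Z → Z.CeilingFlat (h + 2) → (∀ j, Function.update Z j (h + 2, 0, 0) ∈ C.lower) →
      ∃ t : ℤ, ∃ k : Fin 4, 6 ≤ t ∧ Z = diagUnit t k

/-- (TAF-P⌈_h) the CEILING CLASS as (TAF_h) states it: a ceiling-touching FC `P`-cell is a diagonal unit with `t ≥ 6`. -/
def TallCeilingFCP (h : ℤ) : Prop :=
  ∀ C : MConfig, C.InDiamond (h + 2) → C.FloorAnchored → ¬ C.InDiamond h → C.G1Closed → C.StaticH1 →
    ∀ Z ∈ C.upper, FCc Z → Z.TouchesCeiling (h + 2) → ∃ t : ℤ, ∃ k : Fin 4, 6 ≤ t ∧ Z = diagUnit t k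

/-- (TAF-P⌊_h) «NO FC `P`-CELL TOUCHES THE FLOOR» in a tall floor-anchored admissible `◇_{h+2}` configuration. OPEN, h-uniform (hypothesis form). -/
def TallNoFloorFCP (h : ℤ) : Prop :=
  ∀ C : MConfig, C.InDiamond (h + 2) → C.FloorAnchored → ¬ C.InDiamond h → C.G1Closed → C.StaticH1 →
    ∀ Z ∈ C.upper, FCc Z → ¬ Z.TouchesFloor

/-- (TAF-I_h) THE INTERIOR CLASS: an FC `P`-cell touching neither the ceiling of `◇_{h+2}` nor the floor is a diagonal unit `[tI+ℓ_k]⁴`, `t ≥ 6`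
(hence `6 ≤ t ≤ h − 2`). OPEN, h-uniform (hypothesis form) — the honest gap of LINE 2′. -/
def TallInteriorFCP (h : ℤ) : Prop :=
  ∀ C : MConfig, C.InDiamond (h + 2) → C.FloorAnchored → ¬ C.InDiamond h → C.G1Closed → C.StaticH1 →
    ∀ Z ∈ C.upper, FCc Z → ¬ Z.TouchesCeiling (h + 2) → ¬ Z.TouchesFloor → ∃ t : ℤ, ∃ k : Fin 4, 6 ≤ t ∧ Z = diagUnit t k

/-- a letter of the diagonal unit `[tI+ℓ_k]⁴` lies on the ceiling line of `◇_H` iff `t + 2 = H` … -/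
theorem onCeiling_diagUnit_iff (t H : ℤ) (k f : Fin 4) : OnCeiling H (diagUnit t k f) ↔ t + 2 = H := by
  show (diamondLetter t 1 k).1 + |chargeOf (diamondLetter t 1 k)| = H ↔ t + 2 = H
  fin_cases k <;> simp [chargeOf] <;> omega

/-- … and never on the floor line unless `t = 0`. -/
theorem not_onFloor_diagUnit {t : ℤ} (ht : t ≠ 0) (k f : Fin 4) : ¬ OnFloor (diagUnit t k f) := by
  show ¬ OnFloor (diamondLetter t 1 k)
  fin_cases k <;> simp [absCharge, chargeOf] <;> omega

/-- the diagonal unit `[tI+ℓ_k]⁴` touches the ceiling of `◇_H` iff `t + 2 = H`. -/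
theorem touchesCeiling_diagUnit_iff (t H : ℤ) (k : Fin 4) : (diagUnit t k).TouchesCeiling H ↔ t + 2 = H := by
  constructor
  · rintro ⟨f, hf⟩
    exact (onCeiling_diagUnit_iff t H k f).mp hf
  · intro ht
    exact ⟨0, (onCeiling_diagUnit_iff t H k 0).mpr ht⟩

/-- the diagonal unit `[tI+ℓ_k]⁴`, `t ≠ 0`, does not touch the floor. -/
theorem not_touchesFloor_diagUnit {t : ℤ} (ht : t ≠ 0) (k : Fin 4) : ¬ (diagUnit t k).TouchesFloor := by
  rintro ⟨f, hf⟩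
  exact not_onFloor_diagUnit ht k f hf

/-- **THE CEILING CLASS IS SHRUNK BY THE ENGINE (PROVED).** «No FC `N`-cells» and the ceiling-flat unit law give the ceiling class of (TAF_h): by §16
a ceiling-touching FC `P`-cell is ceiling-flat (`fc_touching_ceiling_flat_of_noFCN`) and carries all four apex lifts (`apexLift_of_ceiling_letter_noFCN`;
the ceiling factor itself is lifted off another ceiling factor). -/
theorem tallCeilingFCP_of_noFCN_flatUnit {h : ℤ} (HN : TallNoFCN h) (HF : CeilingFlatUnitLaw h) : TallCeilingFCP h := by
  intro C hU hA hT hG hS Z hZ hF hc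
  obtain ⟨g, hg⟩ := hc
  have hN : ∀ N ∈ C.lower, ¬ FCc N := HN C hU hA hT hG hS
  have hD : ∀ P ∈ C.upper, RuleDMu4P C P := hS.1.2
  have flat : Z.CeilingFlat (h + 2) := fun j => fc_touching_ceiling_flat_of_noFCN hU hD hN hZ hF hg j
  refine HF C hU hA hT hG hS Z hZ hF flat fun j => ?_
  by_cases hjg : j = g
  · have hg1 : g + 1 ≠ g := by
      intro e
      have := congrArg (fun x : Fin 4 => x - g) e
      simp at this
    rw [hjg]
    exact apexLift_of_ceiling_letter_noFCN hU hD hN hZ hF (flat (g + 1)) (Ne.symm hg1)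
  · exact apexLift_of_ceiling_letter_noFCN hU hD hN hZ hF hg hjg

/-- **THE POSITION SPLIT (PROVED).** (TAF_h) is exactly: no FC `N`-cells ∧ the ceiling-flat unit law ∧ no floor-touching FC `P`-cell ∧ the interior
law. -/
theorem tallAnchored_iff_split (h : ℤ) :
    TallAnchoredFCUnits h ↔ TallNoFCN h ∧ CeilingFlatUnitLaw h ∧ TallNoFloorFCP h ∧ TallInteriorFCP h := by
  constructor
  · intro T
    refine ⟨?_, ?_, ?_, ?_⟩
    · intro C hU hA hT hG hS N hN hF
      exact absurd (T C hU hA hT hG hS true N hF (by simpa using hN)).1 (by decide)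
    · intro C hU hA hT hG hS Z hZ hF _ _
      exact (T C hU hA hT hG hS false Z hF (by simpa using hZ)).2
    · intro C hU hA hT hG hS Z hZ hF hf
      obtain ⟨f, hf⟩ := hf
      obtain ⟨t, k, ht, rfl⟩ := (T C hU hA hT hG hS false Z hF (by simpa using hZ)).2
      exact not_onFloor_diagUnit (by omega) k f hf
    · intro C hU hA hT hG hS Z hZ hF _ _
      exact (T C hU hA hT hG hS false Z hF (by simpa using hZ)).2
  · rintro ⟨HN, HF, HB, HI⟩ C hU hA hT hG hS b Z hF hmem
    cases b
    · have hZ : Z ∈ C.upper := by simpa using hmem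
      refine ⟨rfl, ?_⟩
      by_cases hc : Z.TouchesCeiling (h + 2)
      · exact tallCeilingFCP_of_noFCN_flatUnit HN HF C hU hA hT hG hS Z hZ hF hc
      by_cases hf : Z.TouchesFloor
      · exact absurd hf (HB C hU hA hT hG hS Z hZ hF)
      exact HI C hU hA hT hG hS Z hZ hF hc hf
    · have hZ : Z ∈ C.lower := by simpa using hmem
      exact absurd hF (HN C hU hA hT hG hS Z hZ)

/-- in particular the four class laws, uniformly in `h ≥ 8`, give the whole tower from `CL_8` (§15.1). -/
theorem seedB1Odd_all_of_split (HN : ∀ n : ℕ, TallNoFCN (8 + 2 * n)) (HF : ∀ n : ℕ, CeilingFlatUnitLaw (8 + 2 * n))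
    (HB : ∀ n : ℕ, TallNoFloorFCP (8 + 2 * n)) (HI : ∀ n : ℕ, TallInteriorFCP (8 + 2 * n))
    (W : SeedFCPCeilingUnitDiamond8G1H1) (n : ℕ) : SeedB1OddDiamondG1H1 (8 + 2 * n) :=
  seedB1Odd_all_of_tall (fun m => (tallAnchored_iff_split _).mpr ⟨HN m, HF m, HB m, HI m⟩) W n

/-! ### §17.2 the unit's second rung: typed RULE D at the b-leg -/

/-- an apex `hI` is an apex, adapted to every frame, with all four coordinates equal to `h`. -/
theorem apex_facts (h : ℤ) (k : Fin 4) :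
    isApex ((h, 0, 0) : BPoint) ∧ Adapted ((h, 0, 0) : BPoint) k ∧ coord ((h, 0, 0) : BPoint) k = h := by
  fin_cases k <;> simp [isApex, Adapted, coord]

/-- strictly BELOW an apex `hI` along a null ray: `hI = y + e·n_r` forces `y = (h−2e)I + eℓ_{r+2}`. -/
theorem eq_diamondLetter_of_ray_apex {h e : ℤ} {y : BPoint} {r : Fin 4} (hray : ((h, 0, 0) : BPoint) = ray y r e) :
    y = diamondLetter (h - 2 * e) e (r + 2) := by
  obtain ⟨a, b, d⟩ := y
  fin_cases r <;> simp [Prod.ext_iff] at hray ⊢ <;> omega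

/-- strictly BELOW the ceiling-unit letter `(h−2)I+ℓ_u` along a null ray inside a window, in a direction other than `u`: only the antipode `u + 2`,
landing on `(h−2−2e)I+(1+e)ℓ_u` (the directions `u ± 1` leave the coordinate axes). -/
theorem eq_diamondLetter_of_ray_unitLetter {h H e : ℤ} {y : BPoint} {u r : Fin 4} (he : 0 < e) (hr : r ≠ u) (hy : InDiamond H y)
    (hray : diamondLetter (h - 2) 1 u = ray y r e) : r = u + 2 ∧ y = diamondLetter (h - 2 - 2 * e) (1 + e) u := by
  obtain ⟨hax, -, -, -⟩ := hy
  obtain ⟨a, b, d⟩ := y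
  fin_cases u <;> fin_cases r <;> simp [AxisPt, Prod.ext_iff] at hr hax hray ⊢ <;> omega

/-- a charged table letter is charged. -/
theorem diamondLetter_charged {t c : ℤ} (hc : 1 ≤ c) (k : Fin 4) : (diamondLetter t c k).2 ≠ (0, 0) := by
  fin_cases k <;> simp <;> omega

/-- a charged table letter `tI + cℓ_k` with `t + 2c = H` lies on the ceiling line of `◇_H`. -/
theorem onCeiling_diamondLetter {t c H : ℤ} (hc : 1 ≤ c) (ht : t + 2 * c = H) (k : Fin 4) : OnCeiling H (diamondLetter t c k) := by
  have habs : |c| = c := abs_of_pos (by omega)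
  have habs' : |-c| = c := by rw [abs_neg]; exact habs
  show (diamondLetter t c k).1 + |chargeOf (diamondLetter t c k)| = H
  fin_cases k <;> simp [chargeOf, habs, habs'] <;> omega

/-- charged table letters are determined by their type and phase: `tI + cℓ_k = t′I + c′ℓ_{k′}` (`c, c′ ≥ 1`) forces `t = t′`, `c = c′`, `k = k′`. -/
theorem diamondLetter_inj {t t' c c' : ℤ} {k k' : Fin 4} (hc : 1 ≤ c) (hc' : 1 ≤ c') (e : diamondLetter t c k = diamondLetter t' c' k') :
    t = t' ∧ c = c' ∧ k = k' := by
  fin_cases k <;> fin_cases k' <;> simp [Prod.ext_iff] at e ⊢ <;> omega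

/-- **THE b-LEG MENU (PROVED, h-uniform).** In a configuration inside `◇_h` whose `N`-cells pass typed RULE D, let the b-leg
`N_j = [(h−2)I+ℓ_u]⁴[j ↦ hI]` be present and `g ≠ j`. RULE D at the pair `((j,u),(g,u+2))` (coordinates `h ≠ h − 2`) leaves exactly: (a) the apex
coordinate settled below — a SIBLING `P`-cell `[(h−2)I+ℓ_u]⁴[j ↦ (h−2e)I+eℓ_w]`, `e ≥ 1`, `w ≠ u`; or (b) `(g,u+2)` settled below — only the antipodal
direction stays in the window: a SERVER `P`-cell `N_j[g ↦ (h−2−2e)I+(1+e)ℓ_u]`, `e ≥ 1`; or (c) a COVER — `DirOK` forces the direction `u+2` on the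
charged factor `g` and forbids `u+2` on the apex: the `P`-cell `[(h−2)I+ℓ_u]⁴[j ↦ (h−2e₁)I+e₁ℓ_w, g ↦ (h−2−2e₂)I+(1+e₂)ℓ_u]`, `w ≠ u`. -/
theorem bLeg_menu {h : ℤ} {C : MConfig} (hU : C.InDiamond h) (hDN : ∀ N ∈ C.lower, RuleDMu4N C N) {u j : Fin 4}
    (hN : Function.update (diagUnit (h - 2) u) j (h, 0, 0) ∈ C.lower) {g : Fin 4} (hgj : g ≠ j) :
    (∃ e : ℤ, ∃ w : Fin 4, 0 < e ∧ w ≠ u ∧ Function.update (diagUnit (h - 2) u) j (diamondLetter (h - 2 * e) e w) ∈ C.upper) ∨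
    (∃ e : ℤ, 0 < e ∧
      Function.update (Function.update (diagUnit (h - 2) u) j (h, 0, 0)) g (diamondLetter (h - 2 - 2 * e) (1 + e) u) ∈ C.upper) ∨
    (∃ e₁ e₂ : ℤ, ∃ w : Fin 4, 0 < e₁ ∧ 0 < e₂ ∧ w ≠ u ∧
      Function.update (Function.update (diagUnit (h - 2) u) j (diamondLetter (h - 2 * e₁) e₁ w)) g
        (diamondLetter (h - 2 - 2 * e₂) (1 + e₂) u) ∈ C.upper) := by
  set N : MCell := Function.update (diagUnit (h - 2) u) j (h, 0, 0) with hNdef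
  have hNj : N j = (h, 0, 0) := by simp [hNdef]
  have hNg : N g = diamondLetter (h - 2) 1 u := by rw [hNdef, Function.update_of_ne hgj]; rfl
  obtain ⟨-, hadj, hcj⟩ := apex_facts h u
  obtain ⟨hnap, -, hadu', -, hcu'⟩ := charged_letter_facts (t := h - 2) (c := 1) le_rfl u
  have hadj' : Adapted (N j) u := by rw [hNj]; exact hadj
  have hadg' : Adapted (N g) (u + 2) := by rw [hNg]; exact hadu'
  have hne : coord (N j) u ≠ coord (N g) (u + 2) := by rw [hNj, hNg, hcj, hcu']; omega
  rcases hDN N hN j g (Ne.symm hgj) u (u + 2) hadj' hadg' hne with hS | hS | hC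
  · -- (a) the apex coordinate `(j,u)` is settled below: a sibling
    obtain ⟨r, hr, P, hP, hag, hlt, hray⟩ := hS
    have hray' : ((h, 0, 0) : BPoint) = ray (P j) r ((N j).1 - (P j).1) := by rw [← hNj]; exact hray
    have hPj := eq_diamondLetter_of_ray_apex hray'
    have hw : r + 2 ≠ u := by
      intro e; apply hr; rw [← e]
      fin_cases r <;> decide
    refine Or.inl ⟨(N j).1 - (P j).1, r + 2, sub_pos.mpr hlt, hw, ?_⟩
    generalize (N j).1 - (P j).1 = e at hPj ⊢
    convert hP using 1
    funext f
    by_cases hf : f = j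
    · subst hf; simpa using hPj.symm
    · rw [Function.update_of_ne hf, hag f hf, hNdef, Function.update_of_ne hf]
  · -- (b) `(g,u+2)` is settled below: a server (only the antipodal direction stays in the window)
    obtain ⟨r, hr, P, hP, hag, hlt, hray⟩ := hS
    have hray' : diamondLetter (h - 2) 1 u = ray (P g) r ((N g).1 - (P g).1) := by rw [← hNg]; exact hray
    have hr' : r ≠ u := by
      intro e; apply hr; rw [e]
      fin_cases u <;> decide
    obtain ⟨-, hPg⟩ := eq_diamondLetter_of_ray_unitLetter (sub_pos.mpr hlt) hr' (hU.2 P hP g) hray'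
    refine Or.inr (Or.inl ⟨(N g).1 - (P g).1, sub_pos.mpr hlt, ?_⟩)
    generalize (N g).1 - (P g).1 = e at hPg ⊢
    convert hP using 1
    funext f
    by_cases hf : f = g
    · subst hf; simpa using hPg.symm
    · rw [Function.update_of_ne hf, hag f hf]
  · -- (c) a cover: `DirOK` forces `u+2` on the charged factor and forbids it on the apex
    obtain ⟨a, b, ha, hb, P, hP, hag2, hltj, hrayj, hltg, hrayg⟩ := hC
    have ha' : a ≠ u + 2 := by
      rcases ha with hau | ⟨-, h2⟩
      · rw [hau]; fin_cases u <;> decide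
      · exact h2
    have hb' : b = u + 2 := by
      rcases hb with hbu | ⟨hap, -⟩
      · exact hbu
      · rw [hNg] at hap; exact absurd hap hnap
    have hrayj' : ((h, 0, 0) : BPoint) = ray (P j) a ((N j).1 - (P j).1) := by rw [← hNj]; exact hrayj
    have hPj := eq_diamondLetter_of_ray_apex hrayj'
    have hrayg' : diamondLetter (h - 2) 1 u = ray (P g) b ((N g).1 - (P g).1) := by rw [← hNg]; exact hrayg
    have hbu : b ≠ u := by rw [hb']; fin_cases u <;> decide
    obtain ⟨-, hPg⟩ := eq_diamondLetter_of_ray_unitLetter (sub_pos.mpr hltg) hbu (hU.2 P hP g) hrayg'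
    have hw : a + 2 ≠ u := by
      intro e; apply ha'; rw [← e]
      fin_cases a <;> decide
    refine Or.inr (Or.inr ⟨(N j).1 - (P j).1, (N g).1 - (P g).1, a + 2, sub_pos.mpr hltj, sub_pos.mpr hltg, hw, ?_⟩)
    generalize (N j).1 - (P j).1 = e₁ at hPj ⊢
    generalize (N g).1 - (P g).1 = e₂ at hPg ⊢
    convert hP using 1
    funext f
    by_cases hfg : f = g
    · subst hfg; simpa using hPg.symm
    · rw [Function.update_of_ne hfg]
      by_cases hfj : f = j
      · subst hfj; simpa using hPj.symm
      · rw [Function.update_of_ne hfj, hag2 f hfj hfg, hNdef, Function.update_of_ne hfj]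

/-- **COROLLARY (PROVED): IN A FLAT-UNIT WORLD THE SERVERS ARE FORCED.** In a RULE-D-closed configuration inside `◇_h` all of whose ceiling-flat FC
`P`-cells are diagonal units, a present ceiling unit `[(h−2)I+ℓ_u]⁴` carries, for every ordered pair of factors `(j,g)`, `g ≠ j`, a SERVER
`[(h−2)I+ℓ_u]⁴[j ↦ hI, g ↦ (h−2−2e)I+(1+e)ℓ_u] ∈ C.upper` of some depth `e ≥ 1`: the b-leg is present by §15.3, and the menu's sibling and cover are
ceiling-flat FC `P`-cells that are not units. -/
theorem unitServer_of_flatUnits {h : ℤ} {C : MConfig} (hU : C.InDiamond h) (hR : RuleDMu4Closed C)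
    (hCF : ∀ Z ∈ C.upper, FCc Z → Z.CeilingFlat h → ∃ t : ℤ, ∃ k : Fin 4, Z = diagUnit t k)
    {u : Fin 4} (hP : diagUnit (h - 2) u ∈ C.upper) {j g : Fin 4} (hgj : g ≠ j) :
    ∃ e : ℤ, 0 < e ∧
      Function.update (Function.update (diagUnit (h - 2) u) j (h, 0, 0)) g (diamondLetter (h - 2 - 2 * e) (1 + e) u) ∈ C.upper := by
  have hN := ceilingUnit_forces_bLegs hU hR.2 hP j
  rcases bLeg_menu hU hR.1 hN hgj with ⟨e, w, he, hw, hS⟩ | hb | ⟨e₁, e₂, w, he₁, he₂, hw, hS⟩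
  · -- the sibling is a ceiling-flat FC `P`-cell, hence a unit: its phase on `j` would be `u`
    exfalso
    have hfc : FCc (Function.update (diagUnit (h - 2) u) j (diamondLetter (h - 2 * e) e w)) := by
      intro f
      by_cases hf : f = j
      · subst hf; simpa using diamondLetter_charged (t := h - 2 * e) (c := e) (by omega) w
      · rw [Function.update_of_ne hf]; exact diamondLetter_charged (t := h - 2) (c := 1) le_rfl u
    have hfl : MCell.CeilingFlat h (Function.update (diagUnit (h - 2) u) j (diamondLetter (h - 2 * e) e w)) := by
      intro f
      by_cases hf : f = j
      · subst hf; simpa using onCeiling_diamondLetter (t := h - 2 * e) (c := e) (H := h) (by omega) (by ring) w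
      · rw [Function.update_of_ne hf]; exact onCeiling_diamondLetter (t := h - 2) (c := 1) (H := h) le_rfl (by ring) u
    obtain ⟨t, k, hk⟩ := hCF _ hS hfc hfl
    have h1 := congrFun hk g
    have h2 := congrFun hk j
    rw [Function.update_of_ne hgj] at h1
    simp only [Function.update_self] at h2
    obtain ⟨-, -, hku⟩ := diamondLetter_inj (le_rfl : (1 : ℤ) ≤ 1) le_rfl (h1 : diamondLetter (h - 2) 1 u = diamondLetter t 1 k)
    obtain ⟨-, -, hkw⟩ := diamondLetter_inj (by omega : (1 : ℤ) ≤ e) le_rfl (h2 : diamondLetter (h - 2 * e) e w = diamondLetter t 1 k)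
    exact hw (hkw.trans hku.symm)
  · exact hb
  · -- the cover is a ceiling-flat FC `P`-cell, hence a unit: its charge on `g` would be `1`
    exfalso
    have hfc : FCc (Function.update (Function.update (diagUnit (h - 2) u) j (diamondLetter (h - 2 * e₁) e₁ w)) g
        (diamondLetter (h - 2 - 2 * e₂) (1 + e₂) u)) := by
      intro f
      by_cases hfg : f = g
      · subst hfg; simpa using diamondLetter_charged (t := h - 2 - 2 * e₂) (c := 1 + e₂) (by omega) u
      · rw [Function.update_of_ne hfg]
        by_cases hfj : f = j
        · subst hfj; simpa using diamondLetter_charged (t := h - 2 * e₁) (c := e₁) (by omega) w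
        · rw [Function.update_of_ne hfj]; exact diamondLetter_charged (t := h - 2) (c := 1) le_rfl u
    have hfl : MCell.CeilingFlat h (Function.update (Function.update (diagUnit (h - 2) u) j (diamondLetter (h - 2 * e₁) e₁ w)) g
        (diamondLetter (h - 2 - 2 * e₂) (1 + e₂) u)) := by
      intro f
      by_cases hfg : f = g
      · subst hfg; simpa using onCeiling_diamondLetter (t := h - 2 - 2 * e₂) (c := 1 + e₂) (H := h) (by omega) (by ring) u
      · rw [Function.update_of_ne hfg]
        by_cases hfj : f = j
        · subst hfj; simpa using onCeiling_diamondLetter (t := h - 2 * e₁) (c := e₁) (H := h) (by omega) (by ring) w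
        · rw [Function.update_of_ne hfj]; exact onCeiling_diamondLetter (t := h - 2) (c := 1) (H := h) le_rfl (by ring) u
    obtain ⟨t, k, hk⟩ := hCF _ hS hfc hfl
    have h1 := congrFun hk g
    simp only [Function.update_self] at h1
    obtain ⟨-, hc, -⟩ := diamondLetter_inj (by omega : (1 : ℤ) ≤ 1 + e₂) le_rfl (h1 : diamondLetter (h - 2 - 2 * e₂) (1 + e₂) u = diamondLetter t 1 k)
    omega

/-- hence under H₁-staticness: in an admissible `◇_h` configuration whose ceiling-flat FC `P`-cells are units, the twelve servers of a ceiling unit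
(one per ordered pair of factors, each of some depth) are present. -/
theorem unitServer_of_flatUnits_staticH1 {h : ℤ} {C : MConfig} (hU : C.InDiamond h) (hS : C.StaticH1)
    (hCF : ∀ Z ∈ C.upper, FCc Z → Z.CeilingFlat h → ∃ t : ℤ, ∃ k : Fin 4, Z = diagUnit t k)
    {u : Fin 4} (hP : diagUnit (h - 2) u ∈ C.upper) {j g : Fin 4} (hgj : g ≠ j) :
    ∃ e : ℤ, 0 < e ∧
      Function.update (Function.update (diagUnit (h - 2) u) j (h, 0, 0)) g (diamondLetter (h - 2 - 2 * e) (1 + e) u) ∈ C.upper :=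
  unitServer_of_flatUnits hU hS.1 hCF hP hgj

/-! ## §18 (g3, v16) FLOOR RIGIDITY — the mirror of §16 at `N`-cells, and the shrunk `N`-class (PROVED, h-uniform)
The ι-dual of §16, proved by hand (the tree's `Pad4TowerRuleDMu4Dual` transports RULE D, but the bookkeeping is longer than the direct proof).
An `N`-cell is served and covered BELOW. Below a charged FLOOR letter `cℓ_u` (node level `t = 0`, height `c`) the only direction with room is `u`
itself (sliding down the floor line towards `O`: the antipode `u + 2` raises the charge above the height, `u ± 1` leave the axes —
`below_floor_letter`), so the floor coordinate `(g, u+2)` (value `0`) of an `N`-cell can be neither SETTLED below (that needs a direction `≠ u`) nor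
COVERED (`DirOK` forces `u + 2` on the charged factor). Hence typed RULE D at the pair `((g,u+2),(j,k′))` settles BELOW every other adapted coordinate
of non-zero value (`settledBelow_of_floor_letter`). Read on a charged other letter `t′I + c′ℓ_v`: the OWN-DIRECTION DROP `Z[j ↦ Z j − e·n_v]`, `e ≥ 1`,
is always forced (`ownDrop_of_floor_letter`; a `P`-cell with the same support off `j` — FC with a floor letter unless `e = c′`, when it is the apex drop
`Z[j ↦ t′I]`), and the ANTIPODAL DROP `Z[j ↦ Z j − e·n_{v+2}] = Z[j ↦ (t′−2e)I+(c′+e)ℓ_v]` (an FC `P`-cell with a floor letter) is forced as soon as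
`t′ ≠ 0` (`antipodalDrop_of_floor_letter`). COROLLARIES under «no FC `P`-cell touches the floor» (the class law `TallNoFloorFCP` of §17, here as a
local hypothesis): an FC `N`-cell touching the floor is FLOOR-FLAT (`fcN_touching_floor_flat_of_noFloorFCP`) and carries all four O-drops
`Z[j ↦ O] ∈ C.upper` (`oDrop_of_floor_letter_noFloorFCP`) — gs-eng-2's floor LEMMA A ∕ A′ typed uniformly in the height and for arbitrary charges.
§18.2: so the `N`-class of (TAF_h) splits into the LIFTED FC `N`-cells (touching no floor letter) and a flat-drop residual:
`TallNoFCN h ↔ TallNoLiftedFCN h ∧ FloorFlatDropLaw h` GIVEN `TallNoFloorFCP h` (`tallNoFCN_iff_lifted_flatDrop`), and the position split of §17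
refines to `tallAnchored_iff_split5`. Interior and lifted classes stay OPEN; nothing here is a census read; (TAF_h) is not asserted. -/

/-! ### §18.1 the floor engine -/

/-- BELOW a charged FLOOR letter `cℓ_u` (`c ≥ 1`, node level `0`) along a null ray, inside a window: only the direction `u` itself. -/
theorem below_floor_letter {H c e : ℤ} {u r : Fin 4} {y : BPoint} (hc : 1 ≤ c) (he : 0 < e) (hy : InDiamond H y)
    (hray : diamondLetter 0 c u = ray y r e) : r = u := by
  obtain ⟨hax, hA, -, -⟩ := hy
  obtain ⟨a, b, d⟩ := y
  have c1 := le_abs_self (chargeOf (a, b, d))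
  have c2 := neg_le_abs (chargeOf (a, b, d))
  fin_cases u <;> fin_cases r <;> simp [AxisPt, absCharge, chargeOf, Prod.ext_iff] at hax hA hray c1 c2 ⊢ <;> omega

/-- below a CHARGED letter `tI + cℓ_v` (`c ≥ 1`) along a null ray the direction is `v` or `v + 2` (else the lower point leaves the axes). -/
theorem below_charged_letter {H t c e : ℤ} {v r : Fin 4} {y : BPoint} (hc : 1 ≤ c) (he : 0 < e) (hy : InDiamond H y)
    (hray : diamondLetter t c v = ray y r e) : r = v ∨ r = v + 2 := by
  obtain ⟨hax, -, -, -⟩ := hy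
  obtain ⟨a, b, d⟩ := y
  fin_cases v <;> fin_cases r <;> simp [AxisPt, Prod.ext_iff] at hax hray ⊢ <;> omega

/-- the node level of a window letter `tI + cℓ_v` is non-negative (for any `c`). -/
theorem charged_letter_level_nonneg {H t c : ℤ} {v : Fin 4} (hx : InDiamond H (diamondLetter t c v)) : 0 ≤ t := by
  obtain ⟨-, hA, -, -⟩ := hx
  have c1 := le_abs_self (chargeOf (diamondLetter t c v))
  have c2 := neg_le_abs (chargeOf (diamondLetter t c v))
  fin_cases v <;> simp [absCharge, chargeOf] at hA c1 c2 ⊢ <;> omega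

/-- the charge of a table letter. -/
theorem absCharge_diamondLetter {c : ℤ} (hc : 0 ≤ c) (t : ℤ) (k : Fin 4) : absCharge (diamondLetter t c k) = c := by
  have habs : |c| = c := abs_of_nonneg hc
  have habs' : |-c| = c := by rw [abs_neg]; exact habs
  show |chargeOf (diamondLetter t c k)| = c
  fin_cases k <;> simp [chargeOf, habs, habs']

/-- a charged letter lies on the floor line iff its node level is `0`. -/
theorem onFloor_diamondLetter_iff {t c : ℤ} (hc : 1 ≤ c) (k : Fin 4) : OnFloor (diamondLetter t c k) ↔ t = 0 := by
  show (diamondLetter t c k).1 = absCharge (diamondLetter t c k) ↔ t = 0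
  rw [absCharge_diamondLetter (by omega) t k]
  fin_cases k <;> simp

/-- **FLOOR RIGIDITY (PROVED, h-uniform; mirror of `settledAbove_of_ceiling_letter`).** In a configuration inside a window, let the `N`-cell `Z` pass
typed RULE D and carry a charged FLOOR letter `cℓ_u` on factor `g`. Then every other adapted coordinate `(j,k′)` of NON-ZERO value is SETTLED BELOW:
the floor coordinate `(g,u+2)` itself admits neither a server below nor a cover. -/
theorem settledBelow_of_floor_letter {H : ℤ} {C : MConfig} (hU : C.InDiamond H) {Z : MCell} (hD : RuleDMu4N C Z)
    {g : Fin 4} {c : ℤ} {u : Fin 4} (hc : 1 ≤ c) (hZg : Z g = diamondLetter 0 c u)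
    {j : Fin 4} (hjg : j ≠ g) {k' : Fin 4} (had : Adapted (Z j) k') (hne : coord (Z j) k' ≠ 0) :
    SettledBelow C Z j k' := by
  obtain ⟨hnap, -, hadu', -, hcu'⟩ := charged_letter_facts (t := 0) hc u
  have hadg : Adapted (Z g) (u + 2) := by rw [hZg]; exact hadu'
  have hne' : coord (Z g) (u + 2) ≠ coord (Z j) k' := by
    rw [hZg, hcu']; exact fun e => hne e.symm
  rcases hD g j (Ne.symm hjg) (u + 2) k' hadg had hne' with hS | hS | hC
  · -- `(g,u+2)` settled below: a cell below the floor letter in a direction `r ≠ u` — impossible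
    obtain ⟨r, hr, P, hP, -, hlt, hray⟩ := hS
    rw [hZg] at hlt hray
    have hru : r = u := below_floor_letter hc (sub_pos.mpr hlt) (hU.2 P hP g) hray
    exfalso; apply hr; rw [hru]
    fin_cases u <;> decide
  · exact hS
  · -- a cover moving `(g,u+2)`: `DirOK` at the charged letter forces the direction `u+2` — impossible below a floor letter
    obtain ⟨a, b, ha, -, P, hP, -, hlt, hray, -, -⟩ := hC
    have ha' : a = u + 2 := by
      rcases ha with ha | ⟨hap, -⟩
      · exact ha
      · rw [hZg] at hap; exact absurd hap hnap
    rw [hZg] at hlt hray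
    have hau : a = u := below_floor_letter hc (sub_pos.mpr hlt) (hU.2 P hP g) hray
    rw [ha'] at hau
    exact absurd hau (by fin_cases u <;> decide)

/-- **the OWN-DIRECTION DROP is forced.** With `Z ∈ C.lower` as above and a charged letter `t′I + c′ℓ_v` on another factor `j`, some `P`-cell agreeing
with `Z` off `j` has `Z j = P j + e·n_v`, `e ≥ 1` (for `e < c′` an FC `P`-cell keeping the floor letter; for `e = c′` the apex drop `Z[j ↦ t′I]`). -/
theorem ownDrop_of_floor_letter {H : ℤ} {C : MConfig} (hU : C.InDiamond H) {Z : MCell} (hZ : Z ∈ C.lower) (hD : RuleDMu4N C Z)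
    {g : Fin 4} {c : ℤ} {u : Fin 4} (hc : 1 ≤ c) (hZg : Z g = diamondLetter 0 c u)
    {j : Fin 4} (hjg : j ≠ g) {t' c' : ℤ} {v : Fin 4} (hc' : 1 ≤ c') (hZj : Z j = diamondLetter t' c' v) :
    ∃ P ∈ C.upper, MAgree P Z j ∧ ∃ e : ℤ, 0 < e ∧ Z j = ray (P j) v e := by
  obtain ⟨-, hadv, -, hcv, -⟩ := charged_letter_facts (t := t') hc' v
  have had : Adapted (Z j) v := by rw [hZj]; exact hadv
  have ht' : 0 ≤ t' := charged_letter_level_nonneg (by rw [← hZj]; exact hU.1 Z hZ j)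
  have hne : coord (Z j) v ≠ 0 := by rw [hZj, hcv]; omega
  obtain ⟨r, hr, P, hP, hag, hlt, hray⟩ := settledBelow_of_floor_letter hU hD hc hZg hjg had hne
  refine ⟨P, hP, hag, (Z j).1 - (P j).1, sub_pos.mpr hlt, ?_⟩
  rw [hZj] at hlt hray
  have hr' : r = v ∨ r = v + 2 := below_charged_letter hc' (sub_pos.mpr hlt) (hU.2 P hP j) hray
  rcases hr' with h1 | h1
  · rw [h1] at hray; rw [hZj]; exact hray
  · exact absurd h1 hr

/-- **the ANTIPODAL DROP is forced off the floor.** If moreover the letter on `j` is NOT on the floor line (`t′ ≠ 0`), some `P`-cell agreeing with `Z`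
off `j` has `Z j = P j + e·n_{v+2}`, `e ≥ 1`, i.e. `P j = (t′−2e)I + (c′+e)ℓ_v` — a letter of HIGHER charge on `j` (an FC `P`-cell whenever `Z` is FC,
still carrying the floor letter on `g`). -/
theorem antipodalDrop_of_floor_letter {H : ℤ} {C : MConfig} (hU : C.InDiamond H) {Z : MCell} (hD : RuleDMu4N C Z)
    {g : Fin 4} {c : ℤ} {u : Fin 4} (hc : 1 ≤ c) (hZg : Z g = diamondLetter 0 c u)
    {j : Fin 4} (hjg : j ≠ g) {t' c' : ℤ} {v : Fin 4} (hc' : 1 ≤ c') (hZj : Z j = diamondLetter t' c' v) (ht' : t' ≠ 0) :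
    ∃ P ∈ C.upper, MAgree P Z j ∧ ∃ e : ℤ, 0 < e ∧ Z j = ray (P j) (v + 2) e := by
  obtain ⟨-, -, hadv', -, hcv'⟩ := charged_letter_facts (t := t') hc' v
  have had : Adapted (Z j) (v + 2) := by rw [hZj]; exact hadv'
  have hne : coord (Z j) (v + 2) ≠ 0 := by rw [hZj, hcv']; exact ht'
  obtain ⟨r, hr, P, hP, hag, hlt, hray⟩ := settledBelow_of_floor_letter hU hD hc hZg hjg had hne
  refine ⟨P, hP, hag, (Z j).1 - (P j).1, sub_pos.mpr hlt, ?_⟩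
  rw [hZj] at hlt hray
  have hr' : r = v ∨ r = v + 2 := below_charged_letter hc' (sub_pos.mpr hlt) (hU.2 P hP j) hray
  have hrv : r ≠ v := by
    intro e; apply hr; rw [e]
    fin_cases v <;> decide
  rcases hr' with h1 | h1
  · exact absurd h1 hrv
  · rw [h1] at hray; rw [hZj]; exact hray

/-- the lower end of an antipodal drop from a charged letter is charged (charge `c′ + e`). -/
theorem charged_of_antipodalDrop {t' c' e : ℤ} {v : Fin 4} {y : BPoint} (hc' : 1 ≤ c') (he : 0 < e)
    (h : diamondLetter t' c' v = ray y (v + 2) e) : y.2 ≠ (0, 0) := by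
  obtain ⟨a, b, d⟩ := y
  fin_cases v <;> simp [Prod.ext_iff] at h ⊢ <;> omega

/-- the lower end of an own-direction drop from a charged letter is charged unless the drop length is exactly the charge, when it is the apex `t′I`. -/
theorem ownDrop_cases {t' c' e : ℤ} {v : Fin 4} {y : BPoint} (h : diamondLetter t' c' v = ray y v e) :
    y.2 ≠ (0, 0) ∨ (e = c' ∧ y = (t', 0, 0)) := by
  obtain ⟨a, b, d⟩ := y
  by_cases hec : e = c'
  · right
    refine ⟨hec, ?_⟩
    subst hec
    fin_cases v <;> simp [Prod.ext_iff] at h ⊢ <;> omega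
  · left
    fin_cases v <;> simp [Prod.ext_iff] at h ⊢ <;> omega

/-- **COROLLARY (PROVED): if no FC `P`-cell touches the floor, FC `N`-cells touching the floor are FLOOR-FLAT.** -/
theorem fcN_touching_floor_flat_of_noFloorFCP {H : ℤ} {C : MConfig} (hU : C.InDiamond H) (hDN : ∀ N ∈ C.lower, RuleDMu4N C N)
    (hNP : ∀ P ∈ C.upper, FCc P → ¬ P.TouchesFloor) {Z : MCell} (hZ : Z ∈ C.lower) (hF : FCc Z) {g : Fin 4} (hg : OnFloor (Z g))
    (j : Fin 4) : OnFloor (Z j) := by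
  by_cases hjg : j = g
  · rw [hjg]; exact hg
  obtain ⟨t, c, u, hc, hZg, -⟩ := exists_diamondLetter_of_charged (hU.1 Z hZ g) (hF g)
  obtain ⟨t', c', v, hc', hZj, -⟩ := exists_diamondLetter_of_charged (hU.1 Z hZ j) (hF j)
  have ht : t = 0 := by rw [hZg] at hg; exact (onFloor_diamondLetter_iff hc u).mp hg
  subst ht
  rw [hZj, onFloor_diamondLetter_iff hc' v]
  by_contra ht'
  obtain ⟨P, hP, hag, e, he, hray⟩ := antipodalDrop_of_floor_letter hU (hDN Z hZ) hc hZg hjg hc' hZj ht'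
  rw [hZj] at hray
  refine hNP P hP ?_ ⟨g, ?_⟩
  · intro f
    by_cases hf : f = j
    · subst hf; exact charged_of_antipodalDrop hc' he hray
    · rw [hag f hf]; exact hF f
  · rw [hag g (Ne.symm hjg)]; exact hg

/-- **COROLLARY (PROVED): … and carry all four O-DROPS.** With `C`, `Z`, `g` as above, for every `j ≠ g` the cell `Z[j ↦ O]` is a `P`-cell of `C`
(the own-direction drop on `j` can stop short of `O` only at an FC `P`-cell touching the floor). For `[ℓ_{u_i}]`-cells this is gs-eng-2's LEMMA A. -/
theorem oDrop_of_floor_letter_noFloorFCP {H : ℤ} {C : MConfig} (hU : C.InDiamond H) (hDN : ∀ N ∈ C.lower, RuleDMu4N C N)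
    (hNP : ∀ P ∈ C.upper, FCc P → ¬ P.TouchesFloor) {Z : MCell} (hZ : Z ∈ C.lower) (hF : FCc Z) {g : Fin 4} (hg : OnFloor (Z g))
    {j : Fin 4} (hjg : j ≠ g) : Function.update Z j (0, 0, 0) ∈ C.upper := by
  obtain ⟨t, c, u, hc, hZg, -⟩ := exists_diamondLetter_of_charged (hU.1 Z hZ g) (hF g)
  obtain ⟨t', c', v, hc', hZj, -⟩ := exists_diamondLetter_of_charged (hU.1 Z hZ j) (hF j)
  have ht : t = 0 := by rw [hZg] at hg; exact (onFloor_diamondLetter_iff hc u).mp hg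
  subst ht
  have ht' : t' = 0 := by
    have := fcN_touching_floor_flat_of_noFloorFCP hU hDN hNP hZ hF hg j
    rw [hZj] at this; exact (onFloor_diamondLetter_iff hc' v).mp this
  subst ht'
  obtain ⟨P, hP, hag, e, he, hray⟩ := ownDrop_of_floor_letter hU hZ (hDN Z hZ) hc hZg hjg hc' hZj
  rw [hZj] at hray
  rcases ownDrop_cases hray with hch | ⟨-, hPj⟩
  · -- the drop stops short of (or overshoots) `O`: an FC `P`-cell touching the floor at `g`
    exfalso
    refine hNP P hP ?_ ⟨g, ?_⟩
    · intro f
      by_cases hf : f = j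
      · subst hf; exact hch
      · rw [hag f hf]; exact hF f
    · rw [hag g (Ne.symm hjg)]; exact hg
  · convert hP using 1
    funext f
    by_cases hf : f = j
    · subst hf; simpa using hPj.symm
    · rw [Function.update_of_ne hf]; exact (hag f hf).symm

/-! ### §18.2 the shrunk `N`-class and the refined split -/

/-- the cell `Z` is FLOOR-FLAT: all four letters on the floor line. -/
def MCell.FloorFlat (Z : MCell) : Prop := ∀ g, OnFloor (Z g)

/-- (TAF-N⌊_h) «NO FC `N`-CELL TOUCHES THE FLOOR» in a tall floor-anchored admissible `◇_{h+2}` configuration. OPEN, h-uniform (hypothesis form). -/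
def TallNoFloorFCN (h : ℤ) : Prop :=
  ∀ C : MConfig, C.InDiamond (h + 2) → C.FloorAnchored → ¬ C.InDiamond h → C.G1Closed → C.StaticH1 →
    ∀ N ∈ C.lower, FCc N → ¬ N.TouchesFloor

/-- (TAF-N↑_h) «NO LIFTED FC `N`-CELL»: every FC `N`-cell of a tall floor-anchored admissible `◇_{h+2}` configuration touches the floor (none has all
four node levels `t ≥ 2`). OPEN, h-uniform (hypothesis form) — with `TallInteriorFCP` the honest gap of LINE 2′. -/
def TallNoLiftedFCN (h : ℤ) : Prop :=
  ∀ C : MConfig, C.InDiamond (h + 2) → C.FloorAnchored → ¬ C.InDiamond h → C.G1Closed → C.StaticH1 →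
    ∀ N ∈ C.lower, FCc N → N.TouchesFloor

/-- (TAF-N♭_h) «FLOOR-FLAT DROP LAW» — the RESIDUAL of the floor `N`-class after §18.1: no floor-flat FC `N`-cell `[c_f ℓ_{u_f}]_f` has all four O-drops
`Z[j ↦ O]` present. OPEN, h-uniform (hypothesis form; at `◇₈` these cells are peel-dead, deep rounds). -/
def FloorFlatDropLaw (h : ℤ) : Prop :=
  ∀ C : MConfig, C.InDiamond (h + 2) → C.FloorAnchored → ¬ C.InDiamond h → C.G1Closed → C.StaticH1 →
    ∀ N ∈ C.lower, FCc N → N.FloorFlat → (∀ j, Function.update N j (0, 0, 0) ∈ C.upper) → False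

/-- **THE FLOOR `N`-CLASS IS SHRUNK BY THE FLOOR ENGINE (PROVED).** No FC `P`-cell on the floor + the flat-drop law ⇒ no FC `N`-cell on the floor. -/
theorem tallNoFloorFCN_of_noFloorFCP_flatDrop {h : ℤ} (HB : TallNoFloorFCP h) (HD : FloorFlatDropLaw h) : TallNoFloorFCN h := by
  intro C hU hA hT hG hS N hN hF hfl
  obtain ⟨g, hg⟩ := hfl
  have hNP : ∀ P ∈ C.upper, FCc P → ¬ P.TouchesFloor := HB C hU hA hT hG hS
  have hDN : ∀ N ∈ C.lower, RuleDMu4N C N := hS.1.1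
  have flat : N.FloorFlat := fun j => fcN_touching_floor_flat_of_noFloorFCP hU hDN hNP hN hF hg j
  refine HD C hU hA hT hG hS N hN hF flat fun j => ?_
  by_cases hjg : j = g
  · have hg1 : g + 1 ≠ g := by
      intro e
      have := congrArg (fun x : Fin 4 => x - g) e
      simp at this
    rw [hjg]
    exact oDrop_of_floor_letter_noFloorFCP hU hDN hNP hN hF (flat (g + 1)) (Ne.symm hg1)
  · exact oDrop_of_floor_letter_noFloorFCP hU hDN hNP hN hF hg hjg

/-- the `N`-class splits into its floor part and its lifted part … -/
theorem tallNoFCN_iff_floor_lifted (h : ℤ) : TallNoFCN h ↔ TallNoFloorFCN h ∧ TallNoLiftedFCN h := by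
  constructor
  · intro HN
    exact ⟨fun C hU hA hT hG hS N hN hF _ => HN C hU hA hT hG hS N hN hF,
      fun C hU hA hT hG hS N hN hF => absurd hF (HN C hU hA hT hG hS N hN)⟩
  · rintro ⟨HF, HL⟩ C hU hA hT hG hS N hN hF
    exact HF C hU hA hT hG hS N hN hF (HL C hU hA hT hG hS N hN hF)

/-- … and, given no FC `P`-cell on the floor, the floor part is the flat-drop residual. -/
theorem tallNoFCN_iff_lifted_flatDrop {h : ℤ} (HB : TallNoFloorFCP h) : TallNoFCN h ↔ TallNoLiftedFCN h ∧ FloorFlatDropLaw h := by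
  constructor
  · intro HN
    exact ⟨((tallNoFCN_iff_floor_lifted h).mp HN).2, fun C hU hA hT hG hS N hN hF _ _ => HN C hU hA hT hG hS N hN hF⟩
  · rintro ⟨HL, HD⟩
    exact (tallNoFCN_iff_floor_lifted h).mpr ⟨tallNoFloorFCN_of_noFloorFCP_flatDrop HB HD, HL⟩

/-- **THE REFINED POSITION SPLIT (PROVED).** (TAF_h) ⟺ no lifted FC `N`-cell ∧ the flat-drop residual ∧ the flat-unit residual ∧ no FC `P`-cell on
the floor ∧ the interior law — both ends of the window are now reduced, by typed RULE D alone, to one residual statement each about FLAT cells with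
all four canonical partners present; the open middle is `TallNoLiftedFCN h ∧ TallInteriorFCP h`. -/
theorem tallAnchored_iff_split5 (h : ℤ) :
    TallAnchoredFCUnits h ↔
      TallNoLiftedFCN h ∧ FloorFlatDropLaw h ∧ CeilingFlatUnitLaw h ∧ TallNoFloorFCP h ∧ TallInteriorFCP h := by
  rw [tallAnchored_iff_split]
  constructor
  · rintro ⟨HN, HF, HB, HI⟩
    exact ⟨((tallNoFCN_iff_lifted_flatDrop HB).mp HN).1, ((tallNoFCN_iff_lifted_flatDrop HB).mp HN).2, HF, HB, HI⟩
  · rintro ⟨HL, HD, HF, HB, HI⟩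
    exact ⟨(tallNoFCN_iff_lifted_flatDrop HB).mpr ⟨HL, HD⟩, HF, HB, HI⟩


/-! ## §19 (g3, v17) X⁺ SIBLING EXCLUSION — the phase engine at the ceiling (PROVED, h-uniform; no RULE D, no census)

MACHINE STATUS OF §15–§18 AT v17 (words of record director-hodge R18.2 ∕ R18.7, hsemireg bus l.34045 ∕ l.≈34082, after kit j317021
«PAD4-D10-THIRDCODE-b» rows 1 ∕ 5, gs-eng-2 g54 table l.34019, control class map l.34030, critic idea-crit-6 g5 l.34043): **(TAF₈) = `TallAnchoredFCUnits 8`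
and (CL₁₀) = `RealFCClassified 10` are REFUTED AS TYPED at MACHINE level** (cadical SAT witnesses ×1 + typed-port admissibility replay ×1: tall floor-anchored
H₁-static G₁-closed ◇₁₀ supports carrying the FC cells `P[6I+2ℓ]⁴`, `P[6I+2ℓ|8I+ℓ|8I+ℓ|8I+ℓ]`, `N[8I+ℓ]⁴`); with them `TallAnchoredFCUnits` ∀h, (W′), (CUL),
(TB₈) ∕ (TBA₈) and the §17–§18 class laws `CeilingFlatUnitLaw 8`, `TallNoFCN 8`, `TallNoLiftedFCN 8` are machine-false; every THEOREM of §15–§18 stands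
as an implication (its conjectural antecedents are now known false at h = 8; `tallAnchored_six_of_W'` certifies nothing). A KERNEL certificate
`¬ TallAnchoredFCUnits 8` was NOT produced (cost: the X-families' derived deciders need ≈ 3·10¹¹ evaluations on the minimal 400-cell witness; R18.7 (1)).
(T₈), (T₁₀) stand (◇₁₀ odd-FC row: cadical UNSAT + drat-trim «s VERIFIED», kit j318002); H2 ∕ 18881 untouched. The ◇₁₀ peel (j318002 stage 2) and the
pre-registered `cllcheck` read (l.34202, R18.26) leave ONE open phase question at ◇₁₀: «constant phase» on the two antipodal-mix ceiling units
`P[8I+ℓ₋₁³|8I+ℓ₁]`, `P[8I+ℓ₋₁²|8I+ℓ₁²]`; the parity-bit law (EB₁₀) is exactly (T₁₀) ∧ a peel fact (critic's E-2: it RENAMES (T) unless it acquires an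
independent reason). §19 is the first piece of such a reason, for the PERPENDICULAR half only.

§19 CONTENT. The ◇₈ ∕ ◇₁₀ peel cones show that the phase coupling between factors is carried by the encoder's `X+` family at the ceiling (and `A2I−`
at the floor), never by RULE D (its coordinate values are direction-blind). `xPlus_sibling_exclusion`: in an `X+`-closed configuration
(`XPlusClosed C = XresXClosed (C.dual 0)`, `Pad4TowerXresFamilies` §2) no `N`-cell `q` has two `P`-children `Z`, `n` below it on one factor `σ` in two
different directions (adjacent sibling), provided `q` is `Z`'s only lower `σ`-variant and some other letter `Z_f` is a top letter (then the clause's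
breakers (H-e′) ∕ (H-b) ∕ `W_f = ∅` are vacuous) — proved by transporting the three cells to the dual world (`uPartner_dual`, `magree_dual`,
`isApex_dual`) and checking the ten conjuncts of `XresXFires`. `xPlus_apex_children_exclusion`: the instance `q_σ = tI`, `Z_σ = (t−2)I + ℓ_a`,
`n_σ = (t−2)I + ℓ_c`, `a ≠ c`. `xPlus_perpPair_apex_exclusion`: with `G₁`-closed levels a cell `Z ∈ upper` carrying two PERPENDICULAR unit children
`(t−2)I + ℓ_a`, `(t−2)I + ℓ_{a±1}` of one node and axis letters elsewhere contains its own `σ`-sibling in its `G₁`-orbit (`Δ^{3(b−a)} (Z ∘ (σ τ))`),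
so it cannot coexist with its parent lift `q = Z(σ ↦ tI) ∈ lower` under the same side conditions — the ◇₈ peel's round-1 kill `P[O|6I+ℓ₋₁|6I+ℓᵢ|8I]`
(RULE D-P forces `q`; `f` = the `8I` factor) made h-uniform. Antipodal pairs get no sibling from `G₁` (`2b − a ≡ a`), matching the census (◇₈: round 15
of 17 via O-drop servers; ◇₁₀: peel-alive). What §19 does NOT do: it says nothing about 4-charged FC cells directly (their lifts break (H-b)); the road
from here to a parity law runs through RULE D's apex lifts and servers and is cut at ◇₁₀ by REALISABLE exotic servers (charge-2 ceiling cells) — the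
successor's work (HOME HANDOFF.md §4). Nothing here is a census row; nothing here says (T_h) ∕ H2 ∕ HC ∕ HC_CM ∕ HC_AV holds. -/

/-- **X⁺ SIBLING EXCLUSION** (h-uniform; the first kernel use of the `X+` family in the control lens's tower programme). In an `X+`-closed
configuration, let `Z ∈ upper` be a `P`-cell with a charged factor `σ`, `q ∈ lower` an `N`-cell reached from `Z` by raising the
`σ`-letter along the direction `u` (`UPartner q Z σ u`: `q` agrees with `Z` off `σ`, `q_σ = Z_σ + d·n_u`), and `n ∈ upper` a second
`P`-cell one step below `q` on `σ` in another direction `w ≠ u` (`UPartner q n σ w`, adjacent). If `q` is the ONLY lower cell agreeing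
with `Z` off `σ`, and no lower cell rises above `Z`'s `f`-letter for some factor `f ≠ σ` (e.g. `Z_f = hI` inside `◇_h`), then the `X+`
clause `(Z; σ, u; q; w, n; f)` of `xres2s` fires in the dual world — contradiction. The breakers (H-e′), (H-b), `W_f = ∅` and the
companion ∕ topmost conditions are discharged by `honly`, `htop` and adjacency; nothing about `h`, RULE D or `G₁` is used. -/
theorem xPlus_sibling_exclusion {C : MConfig} (hX : XPlusClosed C) {Z q n : MCell} {σ f u w : Fin 4}
    (hZ : Z ∈ C.upper) (hq : q ∈ C.lower) (hn : n ∈ C.upper)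
    (hσ : ¬ isApex (Z σ)) (hfσ : f ≠ σ) (hwu : w ≠ u)
    (hZq : UPartner q Z σ u) (hnq : UPartner q n σ w) (hadj : (q σ).1 = (n σ).1 + 1)
    (honly : ∀ W ∈ C.lower, MAgree W Z σ → W σ = q σ)
    (htop : ∀ W ∈ C.lower, (W f).1 ≤ (Z f).1) : False := by
  have hZ' : dualCell 0 Z ∈ (C.dual 0).lower := dualCell_mem_dual_lower hZ
  have hq' : dualCell 0 q ∈ (C.dual 0).upper := dualCell_mem_dual_upper hq
  have hn' : dualCell 0 n ∈ (C.dual 0).lower := dualCell_mem_dual_lower hn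
  -- a dual-upper cell is the dual of a lower cell; its `σ`-letter, if it agrees with `Z` off `σ`, is `q_σ` dualised
  have key : ∀ P ∈ (C.dual 0).upper, MAgree P (dualCell 0 Z) σ → P σ = dualCell 0 q σ := by
    intro P hP hag
    have hW : dualCell 0 P ∈ C.lower := mem_dual_upper.mp hP
    have hag' : MAgree (dualCell 0 (dualCell 0 P)) (dualCell 0 Z) σ := by rwa [dualCell_dualCell]
    have hZW : MAgree Z (dualCell 0 P) σ := magree_dual.mp hag'
    have e : dualCell 0 P σ = q σ := honly _ hW (fun g hg => (hZW g hg).symm)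
    have e' : dualPt 0 (dualPt 0 (P σ)) = dualPt 0 (q σ) := congrArg (dualPt 0) e
    rwa [dualPt_dualPt] at e'
  -- level bookkeeping in the dual world
  have lq : (dualCell 0 q σ).1 = 0 - (q σ).1 := rfl
  have ln : (dualCell 0 n σ).1 = 0 - (n σ).1 := rfl
  have lZf : (dualCell 0 Z f).1 = 0 - (Z f).1 := rfl
  have above : ∀ P ∈ (C.dual 0).upper, ¬ (P f).1 < (dualCell 0 Z f).1 := by
    intro P hP hlt
    have hW : dualCell 0 P ∈ C.lower := mem_dual_upper.mp hP
    have h1 := htop _ hW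
    have lP : (dualCell 0 P f).1 = 0 - (P f).1 := rfl
    omega
  refine hX (dualCell 0 Z) hZ' (dualCell 0 q) hq' (dualCell 0 n) hn' σ u w f ⟨?_, hfσ, ?_, ?_, hwu, ?_, ?_, ?_, ?_, ?_⟩
  · -- `Z_σ` charged
    show ¬ isApex (dualPt 0 (Z σ))
    rw [isApex_dual]; exact hσ
  · -- `q^∨` is a `u`-partner of `Z^∨`
    exact (uPartner_dual 0 q Z σ u).mpr hZq
  · -- topmost: every dual `u`-partner of `Z^∨` sits at `q^∨`'s level
    intro P hP hPu
    exact le_of_eq (congrArg (fun x : BPoint => x.1) (key P hP hPu.1))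
  · -- `n^∨` is a sibling of `q^∨` in direction `w`
    have hs := (uPartner_dual 0 q n σ w).mpr hnq
    exact ⟨fun g hg => (hs.1 g hg).symm, hs.2.1, hs.2.2⟩
  · -- no companion strictly between (adjacency)
    intro P hP _ h1 h2 _
    omega
  · -- (H-e′): a participant `Z^∨(σ ↦ y)` has `y = q^∨_σ`
    intro P hP hag _ _ _
    rw [key P hP hag]
    simp [Effective]
  · -- (H-b): nothing lies null-above `Z_f` (dually: null-below `Z^∨_f`)
    intro P hP _ hnull _
    exact absurd hnull.1 (above P hP)
  · -- `W_f(Z^∨) = ∅` for the same reason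
    intro P hP hnull
    exact absurd hnull.1 (above P hP)

/-- **COROLLARY — TWO CHILDREN OF ONE APEX LETTER.** With `q_σ = tI` a node∕apex letter and `Z_σ = (t−2)I + ℓ_a`, `n_σ = (t−2)I + ℓ_c`
its two children of DIFFERENT phases `a ≠ c` (`Z, n ∈ upper`, `q ∈ lower`, all three agreeing off `σ`), the hypotheses of
`xPlus_sibling_exclusion` hold with `u = a + 2`, `w = c + 2`: an `X+`-closed configuration in which `q` is `Z`'s only lower
`σ`-variant and `Z_f` is a top letter contains no such triple. (The ◇₈ peel's round-1 kill `P[O|6I+ℓ₋₁|6I+ℓᵢ|8I]` and every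
`Xp` conflict of the ◇₈∕◇₁₀ cones are instances: there `Z_f = hI`.) -/
theorem xPlus_apex_children_exclusion {C : MConfig} (hX : XPlusClosed C) {Z q n : MCell} {σ f : Fin 4} {t : ℤ} (a c : Fin 4)
    (hZ : Z ∈ C.upper) (hq : q ∈ C.lower) (hn : n ∈ C.upper) (hfσ : f ≠ σ) (hac : a ≠ c)
    (hqσ : q σ = (t, 0, 0)) (hZσ : Z σ = ray (t - 2, 0, 0) a 1) (hnσ : n σ = ray (t - 2, 0, 0) c 1)
    (hqZ : MAgree q Z σ) (hnq : MAgree n q σ)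
    (honly : ∀ W ∈ C.lower, MAgree W Z σ → W σ = q σ)
    (htop : ∀ W ∈ C.lower, (W f).1 ≤ (Z f).1) : False := by
  refine xPlus_sibling_exclusion hX (u := a + 2) (w := c + 2) hZ hq hn ?_ hfσ ?_ ⟨fun g hg => (hqZ g hg).symm, ?_, ?_⟩
    ⟨hnq, ?_, ?_⟩ ?_ honly htop
  · rw [hZσ]; fin_cases a <;> simp [isApex]
  · fin_cases a <;> fin_cases c <;> simp_all
  · rw [hZσ, hqσ]; show t - 2 + 1 < t; omega
  · rw [hZσ, hqσ]; fin_cases a <;> simp [ray, Prod.ext_iff] <;> omega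
  · rw [hnσ, hqσ]; show t - 2 + 1 < t; omega
  · rw [hnσ, hqσ]; fin_cases c <;> simp [ray, Prod.ext_iff] <;> omega
  · rw [hnσ, hqσ]; show t = t - 2 + 1 + 1; omega

/-- Δ fixes axis letters. -/
theorem deltaPt_of_isApex {x : BPoint} (hx : isApex x) : deltaPt x = x := by
  obtain ⟨x1, x2, x3⟩ := x
  simp only [isApex] at hx
  obtain ⟨h2, h3⟩ := hx
  subst h2; subst h3
  simp [deltaPt]

/-- **COROLLARY — A PERPENDICULAR PAIR NEXT TO AN APEX DIES AT ONCE (the ◇₈ peel's round-1 pattern, h-uniform).** Let the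
configuration be `X+`-closed with `G₁`-closed levels, and let `Z ∈ upper` carry two unit children `Z_σ = (t−2)I + ℓ_a`,
`Z_τ = (t−2)I + ℓ_b` of the same node with PERPENDICULAR phases (`b = a ± 1`) and axis letters on the other two factors. Then
`G₁ = S₄ × Δ` supplies the `σ`-sibling of `Z` inside `Z`'s own orbit — `n = Δ^r (Z ∘ (σ τ))`, `r = 3(b − a)`, has `n_τ = Z_τ`,
`n_σ = (t−2)I + ℓ_{a+2}`, `n_g = Z_g` elsewhere — so if the common parent `q = Z(σ ↦ tI) ∈ lower` is `Z`'s only lower `σ`-variant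
and `Z_f` (`f ≠ σ`) is a top letter, `xPlus_apex_children_exclusion` fires. (◇₈: `Z = P[O|6I+ℓ₋₁|6I+ℓᵢ|8I]`, `q = N[O|8I|6I+ℓᵢ|8I]`
forced by RULE D-P, `f` = the `8I` factor — cone of 2 literals, round 1.) ANTIPODAL pairs (`b = a + 2`) get no sibling from `G₁`
(`2b − a ≡ a`), matching the census: antipodal mixes peel late (◇₈ round 15) or not at all (◇₁₀). -/
theorem xPlus_perpPair_apex_exclusion {C : MConfig} (hX : XPlusClosed C) (hG : C.G1Closed) {Z q : MCell} {σ τ f : Fin 4} {t : ℤ}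
    (a b : Fin 4) (hZ : Z ∈ C.upper) (hq : q ∈ C.lower) (hστ : σ ≠ τ) (hfσ : f ≠ σ) (hperp : b = a + 1 ∨ b = a + 3)
    (hZσ : Z σ = ray (t - 2, 0, 0) a 1) (hZτ : Z τ = ray (t - 2, 0, 0) b 1) (haxis : ∀ g, g ≠ σ → g ≠ τ → isApex (Z g))
    (hqσ : q σ = (t, 0, 0)) (hqZ : MAgree q Z σ)
    (honly : ∀ W ∈ C.lower, MAgree W Z σ → W σ = q σ)
    (htop : ∀ W ∈ C.lower, (W f).1 ≤ (Z f).1) : False := by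
  obtain ⟨_, hPu, _, hDu⟩ := hG
  -- the swapped cell and its Δ-iterates lie in `upper`
  set Y : MCell := Z.perm (Equiv.swap σ τ) with hY
  have hY1 : Y ∈ C.upper := hPu _ Z hZ
  have hY2 : Y.delta ∈ C.upper := hDu _ hY1
  have hY3 : Y.delta.delta ∈ C.upper := hDu _ hY2
  have hY4 : Y.delta.delta.delta ∈ C.upper := hDu _ hY3
  have Yσ : Y σ = Z τ := by simp [hY, MCell.perm_apply, Equiv.swap_apply_left]
  have Yτ : Y τ = Z σ := by simp [hY, MCell.perm_apply, Equiv.swap_apply_right]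
  have Yg : ∀ g, g ≠ σ → g ≠ τ → Y g = Z g := fun g h1 h2 => by
    simp [hY, MCell.perm_apply, Equiv.swap_apply_of_ne_of_ne h1 h2]
  have dg : ∀ g, g ≠ σ → g ≠ τ → deltaPt (Z g) = Z g := fun g h1 h2 => deltaPt_of_isApex (haxis g h1 h2)
  -- the sibling `n`: one or three Δ-steps according to the sign of the perpendicular turn
  rcases hperp with rfl | rfl
  · -- `b = a + 1`: `r = 3`
    refine xPlus_apex_children_exclusion hX (n := Y.delta.delta.delta) a (a + 2) hZ hq hY4 hfσ ?_ hqσ hZσ ?_ hqZ ?_ honly htop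
    · fin_cases a <;> decide
    · show deltaPt (deltaPt (deltaPt (Y σ))) = _
      rw [Yσ, hZτ]; fin_cases a <;> simp [deltaPt, ray]
    · intro g hg
      by_cases hgt : g = τ
      · subst hgt
        show deltaPt (deltaPt (deltaPt (Y g))) = q g
        rw [Yτ, hZσ, hqZ g hg, hZτ]; fin_cases a <;> simp [deltaPt, ray]
      · show deltaPt (deltaPt (deltaPt (Y g))) = q g
        rw [Yg g hg hgt, dg g hg hgt, dg g hg hgt, dg g hg hgt, hqZ g hg]
  · -- `b = a + 3`: `r = 1`
    refine xPlus_apex_children_exclusion hX (n := Y.delta) a (a + 2) hZ hq hY2 hfσ ?_ hqσ hZσ ?_ hqZ ?_ honly htop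
    · fin_cases a <;> decide
    · show deltaPt (Y σ) = _
      rw [Yσ, hZτ]; fin_cases a <;> simp [deltaPt, ray]
    · intro g hg
      by_cases hgt : g = τ
      · subst hgt
        show deltaPt (Y g) = q g
        rw [Yτ, hZσ, hqZ g hg, hZτ]; fin_cases a <;> simp [deltaPt, ray]
      · show deltaPt (Y g) = q g
        rw [Yg g hg hgt, dg g hg hgt, hqZ g hg]


/-! ## §20 (g3, v18) THE PERPENDICULAR CEILING PAIR IS EXCLUDED — side conditions discharged by the window, the lift by RULE D (PROVED, h-uniform)

§19's exclusion carried two side conditions («`q` is `Z`'s only lower `σ`-variant», «`Z_f` is a top letter»). At the CEILING of `◇_h` both are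
forced: `xPlus_sibling_exclusion_sharp` replaces «only variant» by the two conditions the `X+` clause actually consumes — `q` is the LOWEST
`u`-partner above `Z` (topmost in the dual) and (H-e′) — and both hold automatically when `q_σ = hI` (nothing of `◇_h` lies above level `h`;
`hI` is causally above every letter of `◇_h`: `effective_top_bsub_of_inDiamond`), as does the top-letter condition when `Z_f = hI`
(`level_le_of_inDiamond`). RULE D-P at a `P`-cell with a charged letter ON THE CEILING LINE forces the apex lift `Z(σ ↦ hI) ∈ lower` of its
ceiling unit `(h−2)I + ℓ_a` (§16 `antipodalServer_of_ceiling_letter` with `e = 1` forced by the window). Composition: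
**`noPerpCeilingPair_of_ruleD`** — an `X+`-closed, `G₁`-closed configuration inside `◇_h` whose `P`-cells pass typed RULE D contains NO `P`-cell
with two PERPENDICULAR ceiling units `(h−2)I + ℓ_a`, `(h−2)I + ℓ_{a±1}`, a top letter `hI` and an axis letter on the fourth factor — for every
even `h`, with no census input. This is a genuine h-uniform CLASS EXCLUSION inside the hypotheses of `(T_h)` (`StaticH1 ⊇ RuleDMu4Closed ∧
XPlusClosed`; `G1Closed`; `InDiamond h`), the first one in this programme whose engine is the phase-sensitive `X+` family. DATA CHECK ×1 (not an
input): in the ◇₈ peel (gs-eng-2 g53 j309861) all 5 such `P`-orbits `P[x|6I+ℓ₋₁|6I+ℓᵢ|8I]` die in ROUND 1 by an `Xp` conflict, in the ◇₁₀ peel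
(g54 j318002, 74004db439790926) all 6 orbits `P[x|8I+ℓ₋₁|8I+ℓᵢ|10I]` die in ROUND 1 by `P:Xp`; the ANTIPODAL analogues die in rounds 7–15 (◇₈, one
survives) ∕ 13–25 (◇₁₀, two survive) — the lemma is exactly as sharp as the census on this class and says nothing about antipodal pairs
(`G₁` supplies no sibling: `2b − a ≡ a`). Nothing here is a census row; nothing here says (T_h) ∕ H2 ∕ HC ∕ HC_CM ∕ HC_AV holds. -/

/-- duality reverses differences: `x^∨ − y^∨ = y − x` (`h = 0`). -/
theorem bsub_dualPt_zero (x y : BPoint) : bsub (dualPt 0 x) (dualPt 0 y) = bsub y x := by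
  obtain ⟨x1, x2, x3⟩ := x
  obtain ⟨y1, y2, y3⟩ := y
  simp only [bsub, Prod.mk.injEq]
  refine ⟨?_, ?_, ?_⟩ <;> ring

/-- the top letter `hI` lies causally above every letter of `◇_h`. -/
theorem effective_top_bsub_of_inDiamond {h : ℤ} {x : BPoint} (hx : InDiamond h x) : Effective (bsub (h, 0, 0) x) := by
  obtain ⟨x1, x2, x3⟩ := x
  obtain ⟨hax, -, -, hA⟩ := hx
  simp only [absCharge, chargeOf] at hA
  show 0 ≤ h - x1 ∧ (0 - x2) ^ 2 + (0 - x3) ^ 2 ≤ (h - x1) ^ 2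
  rcases hax with h0 | ⟨-, h3⟩ | ⟨h2, -⟩
  · simp only [Prod.mk.injEq] at h0
    obtain ⟨rfl, rfl⟩ := h0
    simp at hA
    exact ⟨by omega, by nlinarith⟩
  · simp only at h3; subst h3
    simp at hA
    have hb := abs_le.mp (show |x2| ≤ h - x1 by linarith)
    exact ⟨by linarith [abs_nonneg x2], by nlinarith [hb.1, hb.2]⟩
  · simp only at h2; subst h2
    simp at hA
    have hb := abs_le.mp (show |x3| ≤ h - x1 by linarith)
    exact ⟨by linarith [abs_nonneg x3], by nlinarith [hb.1, hb.2]⟩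

/-- every letter of `◇_h` has level `≤ h`. -/
theorem level_le_of_inDiamond {h : ℤ} {x : BPoint} (hx : InDiamond h x) : x.1 ≤ h := by
  obtain ⟨-, -, -, hA⟩ := hx
  have : 0 ≤ absCharge x := abs_nonneg _
  omega

/-- **X⁺ SIBLING EXCLUSION, sharp form.** As `xPlus_sibling_exclusion` (§19) with the hypothesis «`q` is `Z`'s only lower `σ`-variant» replaced
by the two conditions the clause actually needs: `q` is the LOWEST `u`-partner of `Z` above it (topmost in the dual), and (H-e′): every lower
`σ`-variant `W` of `Z` lying causally above `n_σ` and not timelike-related to `Z_σ` lies causally below `q_σ`. -/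
theorem xPlus_sibling_exclusion_sharp {C : MConfig} (hX : XPlusClosed C) {Z q n : MCell} {σ f u w : Fin 4}
    (hZ : Z ∈ C.upper) (hq : q ∈ C.lower) (hn : n ∈ C.upper)
    (hσ : ¬ isApex (Z σ)) (hfσ : f ≠ σ) (hwu : w ≠ u)
    (hZq : UPartner q Z σ u) (hnq : UPartner q n σ w) (hadj : (q σ).1 = (n σ).1 + 1)
    (hlow : ∀ W ∈ C.lower, UPartner W Z σ u → (q σ).1 ≤ (W σ).1)
    (hHe : ∀ W ∈ C.lower, MAgree W Z σ → W σ ≠ Z σ → Effective (bsub (W σ) (n σ)) → ¬ Timelike (bsub (Z σ) (W σ)) →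
      Effective (bsub (q σ) (W σ)))
    (htop : ∀ W ∈ C.lower, (W f).1 ≤ (Z f).1) : False := by
  have hZ' : dualCell 0 Z ∈ (C.dual 0).lower := dualCell_mem_dual_lower hZ
  have hq' : dualCell 0 q ∈ (C.dual 0).upper := dualCell_mem_dual_upper hq
  have hn' : dualCell 0 n ∈ (C.dual 0).lower := dualCell_mem_dual_lower hn
  -- every dual-upper cell is `W^∨` for a lower cell `W`
  have rep : ∀ P ∈ (C.dual 0).upper, ∃ W ∈ C.lower, P = dualCell 0 W := fun P hP =>
    ⟨dualCell 0 P, mem_dual_upper.mp hP, (dualCell_dualCell 0 P).symm⟩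
  have lq : (dualCell 0 q σ).1 = 0 - (q σ).1 := rfl
  have ln : (dualCell 0 n σ).1 = 0 - (n σ).1 := rfl
  have lZf : (dualCell 0 Z f).1 = 0 - (Z f).1 := rfl
  have above : ∀ P ∈ (C.dual 0).upper, ¬ (P f).1 < (dualCell 0 Z f).1 := by
    intro P hP hlt
    obtain ⟨W, hW, rfl⟩ := rep P hP
    have h1 := htop _ hW
    have lP : (dualCell 0 W f).1 = 0 - (W f).1 := rfl
    omega
  refine hX (dualCell 0 Z) hZ' (dualCell 0 q) hq' (dualCell 0 n) hn' σ u w f ⟨?_, hfσ, ?_, ?_, hwu, ?_, ?_, ?_, ?_, ?_⟩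
  · show ¬ isApex (dualPt 0 (Z σ))
    rw [isApex_dual]; exact hσ
  · exact (uPartner_dual 0 q Z σ u).mpr hZq
  · -- topmost in the dual = lowest above in the original
    intro P hP hPu
    obtain ⟨W, hW, rfl⟩ := rep P hP
    have h1 := hlow W hW ((uPartner_dual 0 W Z σ u).mp hPu)
    have lW : (dualCell 0 W σ).1 = 0 - (W σ).1 := rfl
    omega
  · have hs := (uPartner_dual 0 q n σ w).mpr hnq
    exact ⟨fun g hg => (hs.1 g hg).symm, hs.2.1, hs.2.2⟩
  · intro P hP _ h1 h2 _
    omega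
  · -- (H-e′), transported
    intro P hP hag hne heff hnt
    obtain ⟨W, hW, rfl⟩ := rep P hP
    have hagZW : MAgree W Z σ := fun g hg => ((magree_dual.mp hag) g hg).symm
    have hne' : W σ ≠ Z σ := fun e => hne (by show dualPt 0 (W σ) = dualPt 0 (Z σ); rw [e])
    have heff' : Effective (bsub (W σ) (n σ)) := by
      have : bsub (dualCell 0 n σ) (dualCell 0 W σ) = bsub (W σ) (n σ) := bsub_dualPt_zero _ _
      rwa [this] at heff
    have hnt' : ¬ Timelike (bsub (Z σ) (W σ)) := by
      have : bsub (dualCell 0 W σ) (dualCell 0 Z σ) = bsub (Z σ) (W σ) := bsub_dualPt_zero _ _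
      rwa [this] at hnt
    have goal := hHe W hW hagZW hne' heff' hnt'
    show Effective (bsub (dualPt 0 (W σ)) (dualPt 0 (q σ)))
    rwa [bsub_dualPt_zero]
  · intro P hP _ hnull _
    exact absurd hnull.1 (above P hP)
  · intro P hP hnull
    exact absurd hnull.1 (above P hP)

/-- **TWO CHILDREN OF THE TOP LETTER (unconditional given the window).** Inside `◇_h`, an `X+`-closed configuration contains no triple
`Z, n ∈ upper`, `q ∈ lower` agreeing off `σ` with `q_σ = hI`, `Z_σ = (h−2)I + ℓ_a`, `n_σ = (h−2)I + ℓ_c`, `a ≠ c`, when some other letter of `Z`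
is the top letter `Z_f = hI`: both side conditions of the sharp lemma are forced by the window (nothing lies above level `h`; `hI` is causally
above every letter of `◇_h`). -/
theorem xPlus_top_children_exclusion {h : ℤ} {C : MConfig} (hU : C.InDiamond h) (hX : XPlusClosed C) {Z q n : MCell} {σ f : Fin 4}
    (a c : Fin 4) (hZ : Z ∈ C.upper) (hq : q ∈ C.lower) (hn : n ∈ C.upper) (hfσ : f ≠ σ) (hac : a ≠ c)
    (hqσ : q σ = (h, 0, 0)) (hZσ : Z σ = ray (h - 2, 0, 0) a 1) (hnσ : n σ = ray (h - 2, 0, 0) c 1) (hZf : Z f = (h, 0, 0))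
    (hqZ : MAgree q Z σ) (hnq : MAgree n q σ) : False := by
  refine xPlus_sibling_exclusion_sharp hX (u := a + 2) (w := c + 2) hZ hq hn ?_ hfσ ?_ ⟨fun g hg => (hqZ g hg).symm, ?_, ?_⟩
    ⟨hnq, ?_, ?_⟩ ?_ ?_ ?_ ?_
  · rw [hZσ]; fin_cases a <;> simp [isApex]
  · fin_cases a <;> fin_cases c <;> simp_all
  · rw [hZσ, hqσ]; show h - 2 + 1 < h; omega
  · rw [hZσ, hqσ]; fin_cases a <;> simp [ray, Prod.ext_iff] <;> omega
  · rw [hnσ, hqσ]; show h - 2 + 1 < h; omega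
  · rw [hnσ, hqσ]; fin_cases c <;> simp [ray, Prod.ext_iff] <;> omega
  · rw [hnσ, hqσ]; show h = h - 2 + 1 + 1; omega
  · -- lowest partner above: any lower `u`-partner of `Z` sits strictly above level `h − 1`, i.e. at level `≥ h = level(q_σ)`
    intro W _ hWu
    have h1 : (Z σ).1 < (W σ).1 := hWu.2.1
    rw [hZσ] at h1; rw [hqσ]
    have h2 : (ray (h - 2, 0, 0) a 1).1 = h - 2 + 1 := rfl
    show h ≤ (W σ).1; omega
  · -- (H-e′): `hI` is causally above every letter of the window
    intro W hW _ _ _ _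
    rw [hqσ]; exact effective_top_bsub_of_inDiamond (hU.1 W hW σ)
  · intro W hW
    rw [hZf]; exact level_le_of_inDiamond (hU.1 W hW f)

/-- **PERPENDICULAR PAIR UNDER THE TOP LETTER (window form of `xPlus_perpPair_apex_exclusion`).** -/
theorem xPlus_perpPair_top_exclusion {h : ℤ} {C : MConfig} (hU : C.InDiamond h) (hX : XPlusClosed C) (hG : C.G1Closed) {Z q : MCell}
    {σ τ f : Fin 4} (a b : Fin 4) (hZ : Z ∈ C.upper) (hq : q ∈ C.lower) (hστ : σ ≠ τ) (hfσ : f ≠ σ) (hperp : b = a + 1 ∨ b = a + 3)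
    (hZσ : Z σ = ray (h - 2, 0, 0) a 1) (hZτ : Z τ = ray (h - 2, 0, 0) b 1) (haxis : ∀ g, g ≠ σ → g ≠ τ → isApex (Z g))
    (hZf : Z f = (h, 0, 0)) (hqσ : q σ = (h, 0, 0)) (hqZ : MAgree q Z σ) : False := by
  obtain ⟨_, hPu, _, hDu⟩ := hG
  set Y : MCell := Z.perm (Equiv.swap σ τ) with hY
  have hY1 : Y ∈ C.upper := hPu _ Z hZ
  have hY2 : Y.delta ∈ C.upper := hDu _ hY1
  have hY3 : Y.delta.delta ∈ C.upper := hDu _ hY2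
  have hY4 : Y.delta.delta.delta ∈ C.upper := hDu _ hY3
  have Yσ : Y σ = Z τ := by simp [hY, MCell.perm_apply, Equiv.swap_apply_left]
  have Yτ : Y τ = Z σ := by simp [hY, MCell.perm_apply, Equiv.swap_apply_right]
  have Yg : ∀ g, g ≠ σ → g ≠ τ → Y g = Z g := fun g h1 h2 => by
    simp [hY, MCell.perm_apply, Equiv.swap_apply_of_ne_of_ne h1 h2]
  have dg : ∀ g, g ≠ σ → g ≠ τ → deltaPt (Z g) = Z g := fun g h1 h2 => deltaPt_of_isApex (haxis g h1 h2)
  rcases hperp with rfl | rfl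
  · refine xPlus_top_children_exclusion hU hX (n := Y.delta.delta.delta) a (a + 2) hZ hq hY4 hfσ ?_ hqσ hZσ ?_ hZf hqZ ?_
    · fin_cases a <;> decide
    · show deltaPt (deltaPt (deltaPt (Y σ))) = _
      rw [Yσ, hZτ]; fin_cases a <;> simp [deltaPt, ray]
    · intro g hg
      by_cases hgt : g = τ
      · subst hgt
        show deltaPt (deltaPt (deltaPt (Y g))) = q g
        rw [Yτ, hZσ, hqZ g hg, hZτ]; fin_cases a <;> simp [deltaPt, ray]
      · show deltaPt (deltaPt (deltaPt (Y g))) = q g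
        rw [Yg g hg hgt, dg g hg hgt, dg g hg hgt, dg g hg hgt, hqZ g hg]
  · refine xPlus_top_children_exclusion hU hX (n := Y.delta) a (a + 2) hZ hq hY2 hfσ ?_ hqσ hZσ ?_ hZf hqZ ?_
    · fin_cases a <;> decide
    · show deltaPt (Y σ) = _
      rw [Yσ, hZτ]; fin_cases a <;> simp [deltaPt, ray]
    · intro g hg
      by_cases hgt : g = τ
      · subst hgt
        show deltaPt (Y g) = q g
        rw [Yτ, hZσ, hqZ g hg, hZτ]; fin_cases a <;> simp [deltaPt, ray]
      · show deltaPt (Y g) = q g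
        rw [Yg g hg hgt, dg g hg hgt, hqZ g hg]

/-- **NO PERPENDICULAR CEILING PAIR (PROVED, h-uniform; engine = `X+`, lift = RULE D-P, sibling = `G₁`).** In a configuration inside `◇_h` that
is `X+`-closed and `G₁`-closed and whose `P`-cells pass typed RULE D, no `P`-cell carries two PERPENDICULAR ceiling units `(h−2)I + ℓ_a`,
`(h−2)I + ℓ_b` (`b = a ± 1`), a top letter `hI`, and an axis letter on the remaining factor. (RULE D-P forces the apex lift `q = Z(σ ↦ hI) ∈ lower`
— `antipodalServer_of_ceiling_letter` applied to the ceiling-line letter on `τ` and the charged letter on `σ`, `e = 1` by the window — and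
`xPlus_perpPair_top_exclusion` closes.) In particular under the hypotheses of `(T_h)` (`InDiamond h`, `G1Closed`, `StaticH1`). -/
theorem noPerpCeilingPair_of_ruleD {h : ℤ} {C : MConfig} (hU : C.InDiamond h) (hX : XPlusClosed C) (hG : C.G1Closed)
    (hD : ∀ P ∈ C.upper, RuleDMu4P C P) {Z : MCell} (hZ : Z ∈ C.upper) {σ τ f : Fin 4} (hστ : σ ≠ τ) (hfσ : f ≠ σ) (a b : Fin 4)
    (hperp : b = a + 1 ∨ b = a + 3) (hZσ : Z σ = diamondLetter (h - 2) 1 a) (hZτ : Z τ = diamondLetter (h - 2) 1 b)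
    (hZf : Z f = (h, 0, 0)) (haxis : ∀ g, g ≠ σ → g ≠ τ → isApex (Z g)) : False := by
  obtain ⟨q, hq, hag, e, he, hqσ⟩ := antipodalServer_of_ceiling_letter hU hZ (hD Z hZ) (g := τ) (t := h - 2) (c := 1) (u := b)
    le_rfl (by ring) hZτ hστ (t' := h - 2) (c' := 1) (v := a) le_rfl hZσ
  have h1 : (q σ).1 = (Z σ).1 + e := by rw [hqσ]
  have h2 : (Z σ).1 = h - 2 + 1 := by rw [hZσ]
  have h3 : (q σ).1 ≤ h := level_le_of_inDiamond (hU.1 q hq σ)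
  have he1 : e = 1 := by omega
  rw [he1, hZσ] at hqσ
  have hqσ' : q σ = (h, 0, 0) := by
    rw [hqσ]; fin_cases a <;> simp [ray, Prod.ext_iff] <;> omega
  exact xPlus_perpPair_top_exclusion hU hX hG a b hZ hq hστ hfσ hperp hZσ hZτ haxis hZf hqσ' hag

/-- the same under the hypotheses of `(T_h)` verbatim (`StaticH1 = RuleDMu4Closed ∧ X+ ∧ A2I−`; `A2I−` unused). -/
theorem noPerpCeilingPair {h : ℤ} {C : MConfig} (hU : C.InDiamond h) (hG : C.G1Closed) (hS : C.StaticH1)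
    {Z : MCell} (hZ : Z ∈ C.upper) {σ τ f : Fin 4} (hστ : σ ≠ τ) (hfσ : f ≠ σ) (a b : Fin 4)
    (hperp : b = a + 1 ∨ b = a + 3) (hZσ : Z σ = diamondLetter (h - 2) 1 a) (hZτ : Z τ = diamondLetter (h - 2) 1 b)
    (hZf : Z f = (h, 0, 0)) (haxis : ∀ g, g ≠ σ → g ≠ τ → isApex (Z g)) : False :=
  noPerpCeilingPair_of_ruleD hU hS.2.1 hG (fun P hP => hS.1.2 P hP) hZ hστ hfσ a b hperp hZσ hZτ hZf haxis

/-! ## §21 (g3, v19) THE ANTIPODAL-CLASS LAW (AP_h) — HYPOTHESIS FORM, typed at the director's invitation (R18.44 «typable by the lenses as a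
crux-workfile statement … no census section»); the trivial bridge `(AP_h) → (T_h)`; separating probes

WHAT IT SAYS. For every admissible two-level configuration in `◇_h` (same three binders as `(T_h)`: `InDiamond h`, `G1Closed`, `StaticH1`)
and every FULLY CHARGED cell `Z` present at either level: (a) ONE ANTIPODAL CLASS — the four phases are all real (`ℓ_{±1}`, pattern
`κ(Z) = 0`) or all imaginary (`ℓ_{±i}`, `κ(Z) = 15`); (b) EVEN MULTIPLICITY — inside that class each of the two phases occurs an even number
of times (`Z.spar` even). In words: «unit phases of a realisable FC cell lie in one antipodal class `{a, a+2}` with even multiplicity of each;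
never odd, never perpendicular» (R18.44 LADDER READING).

STATUS — HONEST (critic E-2 applies verbatim). `AntipodalClassLaw h` is a HYPOTHESIS-FORM `def`, never a fact, and
`seedB1Odd_of_antipodalClassLaw : (AP_h) → (T_h)` only RENAMES `(T_h)` at the FC-cell level unless (AP_h) acquires an independent reason.
Its content BEYOND parity is exactly two exclusions: the six even MIXED-class patterns `κ ∈ {3,5,6,9,10,12}` (two real + two imaginary
phases, «perpendicular») and the odd sign counts inside one class («3+1 antipodal»). Machine status, modulo ports, machine ≠ kernel:
(AP₁₀) = gs-eng-2 g55's census-of-8 at `◇₁₀` (hsemireg l.34327; realisable FC orbits `P[6I+ℓ]⁴, P[6I+2ℓ]⁴, P[6I+2ℓ³|8I+ℓ], P[6I+2ℓ²|8I+ℓ²],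
P[6I+2ℓ|8I+ℓ³], N[8I+ℓ]⁴, P[8I+ℓ]⁴` — constant phase — and the 2+2 antipodal top-node cell `P[8I+ℓ₋₁²|8I+ℓ₁²]`, booked R18.44 ×2-instrument
on the SAT side incl. this seat's typed-port replay l.34330; UNSAT side instrument ×1, kit j322459 pending); it is what killed the
constant-phase candidate (CP₁₀). (AP₈): consistent with every `◇₈` row of record known to this seat (W17: `[6I+ℓ]⁴ ∈ Real₈`); not re-derived
here. (AP₁₂): a PREDICTION, untested. KERNEL REASONS so far: for the «perpendicular» exclusion, §19–§20 (`noPerpCeilingPair`) prove the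
top-letter P-cell class h-uniformly — FC cells themselves carry no apex letter and reach that class only through RULE D lifts (successor: read
the `◇₁₀` cone of `P[8I+ℓ₋₁²|8I+ℓᵢ²]`); for the «3+1 antipodal» exclusion NO kernel lemma exists (g55's minimal core: RULE D-P 12 + RULE D-N 13
+ X⁺ 10 + A2I⁻ 0 clauses — a RULE D + X⁺ chain with no G₁ sibling; successor's second target). No census section is added (R18.2 (5)). -/

/-- the SIGN BIT of a letter: `0` for the phases `ℓ₁, ℓ_i` (`Re β + Im β > 0`), `1` for `ℓ₋₁, ℓ₋ᵢ` (and, harmlessly, for apex letters). -/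
def sbit (x : BPoint) : ℕ := if 0 < x.2.1 + x.2.2 then 0 else 1

/-- the SIGN COUNT of a cell: the number of factors with a negative phase `ℓ₋₁ ∕ ℓ₋ᵢ`. -/
def MCell.spar (Z : MCell) : ℕ := sbit (Z 0) + sbit (Z 1) + sbit (Z 2) + sbit (Z 3)

/-- the (AP) conclusion for one cell: one antipodal class (pattern `0000` or `1111`) and an even sign count. An `abbrev` (decidable by unfolding; no instance declared). -/
abbrev MCell.APConcl (Z : MCell) : Prop := (Z.pat = 0 ∨ Z.pat = 15) ∧ Z.spar % 2 = 0

/-- **(AP_h) THE ANTIPODAL-CLASS LAW — hypothesis form.** Every fully charged cell present (either level) in an admissible `◇_h`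
configuration has its four phases in one antipodal class with even multiplicity of each. NOT proved for any `h`; see the section docstring. -/
def AntipodalClassLaw (h : ℤ) : Prop :=
  ∀ C : MConfig, C.InDiamond h → C.G1Closed → C.StaticH1 →
    ∀ Z : MCell, (Z ∈ C.lower ∨ Z ∈ C.upper) → FCc Z → Z.APConcl

/-- an (AP)-conforming cell has an even parity pattern (`0000` or `1111`), hence is never odd. -/
theorem not_oddPat_of_apConcl {Z : MCell} (h : Z.APConcl) : ¬ OddPat Z.pat := by
  rcases h.1 with e | e <;> rw [e] <;> decide

/-- **the bridge `(AP_h) → (T_h)`** (modus tollens at the FC-cell level; by critic E-2 this RENAMES `(T_h)` until (AP_h) has an independent reason). -/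
theorem seedB1Odd_of_antipodalClassLaw (h : ℤ) (H : AntipodalClassLaw h) : SeedB1OddDiamondG1H1 h := by
  intro C hU hG hS hodd
  rcases hodd with ⟨Z, hZ, hfc, hp⟩ | ⟨Z, hZ, hfc, hp⟩
  · exact not_oddPat_of_apConcl (H C hU hG hS Z (Or.inl hZ) hfc) hp
  · exact not_oddPat_of_apConcl (H C hU hG hS Z (Or.inr hZ) hfc) hp

/-- (AP) is antitone in the height, like `(T_h)`: a larger diamond is a stronger law. -/
theorem antipodalClassLaw_antitone {h h' : ℤ} (hh : h ≤ h') (H : AntipodalClassLaw h') : AntipodalClassLaw h := fun C hU hG hS =>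
  H C ⟨fun Z hZ f => inDiamond_mono hh (hU.1 Z hZ f), fun P hP f => inDiamond_mono hh (hU.2 P hP f)⟩ hG hS

/-- SEPARATING PROBES (`decide`; phases `ℓ₁ = k 0`, `ℓ₋ᵢ = k 1`, `ℓ₋₁ = k 2`, `ℓ_i = k 3`): the booked realisable 2+2 antipodal cell
`[8I+ℓ₋₁²|8I+ℓ₁²]` and the constant cells `[8I+ℓ₋₁]⁴`, `[6I+2ℓ₋₁³|8I+ℓ₋₁]` CONFORM to (AP); the 3+1 antipodal cell `[8I+ℓ₋₁³|8I+ℓ₁]`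
(g55: residual-UNSAT), the 2+2 perpendicular cell `[8I+ℓ₋₁²|8I+ℓᵢ²]` (even, κ = 3) and the odd unit `[8I+ℓ₋₁³|8I+ℓᵢ]` (row 6) VIOLATE it —
so (AP₁₀) separates C-antimix22 from C-antimix31 exactly as the residual instrument does, and refines parity. -/
theorem apConcl_probes :
    (mcellOf (diamondLetter 8 1 2) (diamondLetter 8 1 2) (diamondLetter 8 1 0) (diamondLetter 8 1 0)).APConcl ∧
    (mcellOf (diamondLetter 8 1 2) (diamondLetter 8 1 2) (diamondLetter 8 1 2) (diamondLetter 8 1 2)).APConcl ∧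
    (mcellOf (diamondLetter 6 2 2) (diamondLetter 6 2 2) (diamondLetter 6 2 2) (diamondLetter 8 1 2)).APConcl ∧
    ¬ (mcellOf (diamondLetter 8 1 2) (diamondLetter 8 1 2) (diamondLetter 8 1 2) (diamondLetter 8 1 0)).APConcl ∧
    ¬ (mcellOf (diamondLetter 8 1 2) (diamondLetter 8 1 2) (diamondLetter 8 1 3) (diamondLetter 8 1 3)).APConcl ∧
    ¬ (mcellOf (diamondLetter 8 1 2) (diamondLetter 8 1 2) (diamondLetter 8 1 2) (diamondLetter 8 1 3)).APConcl := by
  decide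

/-! ## §22 (g4, v20) APEX RIVALRY — the `X+` skeleton of the ◇₁₀ refutations, typed h-uniformly (PROVED; engine `X+`, lift RULE D-P, no census input)

WHY THIS SECTION (director-hodge R18.47 START-HERE (ii) LINE 2″; critic idea-crit-6 g6 memo-17 E-2 «independent reason»). gs-eng-2 g55's residual
instrument (hsemireg l.34327; `general-structure/gs2/g55/residual/`, RESIDUAL-D10 v1.2 42e55fd9e2327780) decided every ◇₁₀ peel survivor and published
deletion-minimal cores: `mus/MUS-C-antimix31.txt` 5846cfa341714226 (the 3+1 antipodal ceiling unit `P[8I+ℓ₋₁³|8I+ℓ₁]`: DP 12 + DN 13 + Xp 10),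
`mus/MUS-B-oddcu-±i.txt` (the ODD 3+1 units `P[8I+ℓ₋₁³|8I+ℓ_{±i}]`: Xp 19 + DP 15 + DN 12 each) and `mus/MUS-census-all-UNSAT-survivors.txt` (all 32
UNSAT survivors). This seat's reader `pred/musmap.py` (g4; local, seconds; output `pred/out-musmap-*.txt`) decodes every clause of those cores
against the typed rules and finds, at ◇₁₀: (1) ALL 939 `X+` clauses of the 32 cores (48∕48 in the three FC-unit cores) are CHILD RIVALRIES — the head
`Z ∈ upper` and the rival `n ∈ upper` are two children, on one factor `σ`, of a common parent `q ∈ lower`; in 925∕939 the parent letter `q_σ = tI`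
is an APEX letter and the head carries THE SAME apex letter `tI`, unserved, on another factor `f` (`t = h`: 738 «TOP» clauses, among them all 48 of
the FC-unit cores; `t = h−2`: 161; `t = h−4`: 26; the other 14 are radial rivalries under a charged parent, §19's general form); in the TOP clauses
the rival is a ceiling unit `n_σ = (h−2)I + ℓ_c` adjacent to the parent and the head's own `σ`-letter is the letter of the CEILING LINE at distance
`e ∈ {1,2,3,4}` below the apex, `Z_σ = (h−2e)I + eℓ_a`, `a ≠ c` (184 ∕ 252 ∕ 188 ∕ 114 clauses; ANY two phases — antipodal in 6∕10 of the antimix31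
core's, where `G₁` supplies no sibling and RULE D supplies the rival); (2) ALL 42∕42 RULE D-P clauses of the three FC-unit cores have ONE
alternative, «a stuck letter forces THE inward lift»: 36 under a stuck TOP letter (typed below), 6 under a stuck ceiling coordinate (§16); over the
32 cores 171∕195 RULE D-P clauses sit under a top letter; (3) the RULE D-N clauses of the three FC-unit cores list 120 alternatives out of a typed
menu of 3 982 (drops with `r ≠ k+2` on either factor at every depth, covers with `DirOK`; 32 cores: 1 050 of 18 515) — the other 3 862 were pruned
by the peel before the core was extracted (death rounds 1–25, median 18; none alive): the cores are the tip of a RULE-D-N iceberg and are NOT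
h-uniform proofs; (4) every variable of every core lies within ceiling distance `max(δ(cell), 2)`, `δ = h − (t+2c)` (32∕32; the FC units: `δ ≤ 2`).
§22 types finding (1) h-uniformly: the TOP LETTER IS STUCK (`settledAbove_of_topLetter`: nothing of `◇_h` lies above level `h`, so RULE D-P settles
every other unequal adapted coordinate above — the apex twin of §16), hence FORCES THE INWARD LIFT of every charged factor
(`inwardLift_of_topLetter`; for a ceiling unit the apex lift `Z(σ ↦ hI) ∈ lower`, `apexLift_of_topLetter`), and `X+` then excludes the rival:
**`apexRivalry_of_ruleD`** (distance `e ≥ 1`, hypothesis «no lower inward lift of `Z` on `σ` strictly below the apex», automatic for `e = 1`,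
reduced to one absent cell for `e = 2` in `apexRivalry_two`) and its `e = 1` case **`topChild_unique`**: two `P`-cells agreeing off `σ` with
ceiling units of phases `a`, `c` on `σ` and a common top letter elsewhere have `a = c`. §20's `noPerpCeilingPair` is the sub-case where `G₁`
supplies the rival inside the head's own orbit; here the rival is any cell, which is what the antipodal∕3+1 cores use. WHAT THIS IS NOT: not an
exclusion of any 4-charged FC cell (those carry no top letter; the cores reach top letters through RULE D-P lifts and RULE D-N drops whose pruned
alternatives are ≈ 4k peel facts at ◇₁₀), not (AP_h), not (T_h); HC ∕ HC_CM ∕ HC_AV ∕ H2 ∕ 18881 NOT proved; machine ≠ kernel; width toward H2 = 0. -/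

/-- **THE TOP LETTER IS STUCK (PROVED, h-uniform).** Inside `◇_h`, a `P`-cell `Z` passing typed RULE D with the top letter `Z f = hI` has every adapted
coordinate of value `≠ h` on every other factor SETTLED ABOVE: a server or a cover moving `f` would put a lower-level letter above level `h`. -/
theorem settledAbove_of_topLetter {h : ℤ} {C : MConfig} (hU : C.InDiamond h) {Z : MCell} (hD : RuleDMu4P C Z)
    {f : Fin 4} (hZf : Z f = (h, 0, 0)) {j : Fin 4} (hjf : j ≠ f) {k' : Fin 4} (had : Adapted (Z j) k') (hne : coord (Z j) k' ≠ h) :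
    SettledAbove C Z j k' := by
  have hadf : Adapted (Z f) 0 := by rw [hZf]; simp [Adapted]
  have hcf : coord (Z f) 0 = h := by rw [hZf]; simp [coord]
  have hne' : coord (Z f) 0 ≠ coord (Z j) k' := by rw [hcf]; exact fun e => hne e.symm
  rcases hD f j (Ne.symm hjf) 0 k' hadf had hne' with hS | hS | hC
  · obtain ⟨r, -, N, hN, -, hlt, -⟩ := hS
    have h1 : (N f).1 ≤ h := level_le_of_inDiamond (hU.1 N hN f)
    rw [hZf] at hlt
    have h2 : h < (N f).1 := hlt
    omega
  · exact hS
  · obtain ⟨a, b, -, -, N, hN, -, hlt, -, -, -⟩ := hC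
    have h1 : (N f).1 ≤ h := level_le_of_inDiamond (hU.1 N hN f)
    rw [hZf] at hlt
    have h2 : h < (N f).1 := hlt
    omega

/-- **THE TOP LETTER FORCES THE INWARD LIFT (PROVED, h-uniform).** With `Z ∈ upper` as above and a CHARGED letter `tI + cℓ_v` (`c ≥ 1`) on a factor
`j ≠ f`, some `N ∈ lower` agreeing with `Z` off `j` has `N j = Z j + e·n_{v+2}`, `e ≥ 1` — an inward lift along the antipodal direction (the apex twin of
§16 `antipodalServer_of_ceiling_letter`; the 36 «stuck top letter» RULE D-P clauses of the three ◇₁₀ FC-unit cores are instances). -/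
theorem inwardLift_of_topLetter {h : ℤ} {C : MConfig} (hU : C.InDiamond h) {Z : MCell} (hZ : Z ∈ C.upper) (hD : RuleDMu4P C Z)
    {f : Fin 4} (hZf : Z f = (h, 0, 0)) {j : Fin 4} (hjf : j ≠ f) {t c : ℤ} {v : Fin 4} (hc : 1 ≤ c) (hZj : Z j = diamondLetter t c v) :
    ∃ N ∈ C.lower, MAgree N Z j ∧ ∃ e : ℤ, 0 < e ∧ N j = ray (Z j) (v + 2) e := by
  obtain ⟨-, -, hadv', -, hcv'⟩ := charged_letter_facts (t := t) hc v
  have had : Adapted (Z j) (v + 2) := by rw [hZj]; exact hadv'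
  have hle : t + 2 * c ≤ h := charged_letter_height_le hc (by rw [← hZj]; exact hU.2 Z hZ j)
  have hne : coord (Z j) (v + 2) ≠ h := by rw [hZj, hcv']; omega
  obtain ⟨r, hr, N, hN, hag, hlt, hray⟩ := settledAbove_of_topLetter hU hD hZf hjf had hne
  refine ⟨N, hN, fun g hg => (hag g hg).symm, (N j).1 - (Z j).1, sub_pos.mpr hlt, ?_⟩
  have hx : InDiamond h (N j) := hU.1 N hN j
  rw [hray, hZj] at hx
  have hr' : r = v ∨ r = v + 2 := ray_charged_inDiamond hc (by rw [hZj] at hlt; exact sub_pos.mpr hlt) hx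
  have hrv : r ≠ v := by
    intro e; apply hr; rw [e]
    fin_cases v <;> decide
  rcases hr' with h1 | h1
  · exact absurd h1 hrv
  · rw [← h1]; exact hray

/-- **THE APEX LIFT OF A CEILING UNIT UNDER A TOP LETTER.** In particular a ceiling unit `(h−2)I + ℓ_a` on `σ ≠ f` carries its apex lift
`Z(σ ↦ hI) ∈ lower` (the lift length is `1` by the window). -/
theorem apexLift_of_topLetter {h : ℤ} {C : MConfig} (hU : C.InDiamond h) {Z : MCell} (hZ : Z ∈ C.upper) (hD : RuleDMu4P C Z)
    {f σ : Fin 4} (hZf : Z f = (h, 0, 0)) (hσf : σ ≠ f) {a : Fin 4} (hZσ : Z σ = diamondLetter (h - 2) 1 a) :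
    ∃ q ∈ C.lower, MAgree q Z σ ∧ q σ = (h, 0, 0) := by
  obtain ⟨q, hq, hag, e, he, hqσ⟩ := inwardLift_of_topLetter hU hZ hD hZf hσf (t := h - 2) (c := 1) (v := a) le_rfl hZσ
  have h1 : (q σ).1 = (Z σ).1 + e := by rw [hqσ]
  have h2 : (Z σ).1 = h - 2 + 1 := by rw [hZσ]
  have h3 : (q σ).1 ≤ h := level_le_of_inDiamond (hU.1 q hq σ)
  have he1 : e = 1 := by omega
  rw [he1, hZσ] at hqσ
  refine ⟨q, hq, hag, ?_⟩
  rw [hqσ]; fin_cases a <;> simp [ray, Prod.ext_iff] <;> omega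

/-- **APEX RIVALRY AT DISTANCE `e` (PROVED, h-uniform).** Inside `◇_h`, in an `X+`-closed configuration whose `P`-cells pass typed RULE D, let
`Z ∈ upper` carry a top letter `Z f = hI` and, on `σ ≠ f`, a letter of the CEILING LINE at distance `e ≥ 1` below the apex, `Z σ = (h−2e)I + eℓ_a`,
such that no lower inward lift of `Z` on `σ` lies strictly below the apex (`hlow`; automatic for `e = 1`). Then no `n ∈ upper` agreeing with `Z`
off `σ` carries a ceiling unit `(h−2)I + ℓ_c` of ANOTHER phase `c ≠ a` on `σ`. RULE D-P supplies the apex lift `q = Z(σ ↦ hI) ∈ lower`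
(`inwardLift_of_topLetter`, `hlow`, the window) and `xPlus_sibling_exclusion_sharp` (§20) fires with `u = a + 2`, `w = c + 2`; (H-e′) and the
top-letter condition are discharged by the window exactly as in `xPlus_top_children_exclusion`. The 746 «TOP» `X+` clauses of g55's 32 ◇₁₀ cores
(`e ≤ 4`) are instances. -/
theorem apexRivalry_of_ruleD {h e : ℤ} {C : MConfig} (hU : C.InDiamond h) (hX : XPlusClosed C) (hD : ∀ P ∈ C.upper, RuleDMu4P C P)
    {Z n : MCell} (hZ : Z ∈ C.upper) (hn : n ∈ C.upper) {σ f : Fin 4} (hfσ : f ≠ σ) (hZf : Z f = (h, 0, 0)) {a c : Fin 4} (hac : a ≠ c)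
    (he : 1 ≤ e) (hZσ : Z σ = diamondLetter (h - 2 * e) e a) (hnσ : n σ = diamondLetter (h - 2) 1 c) (hag : MAgree n Z σ)
    (hlow : ∀ W ∈ C.lower, UPartner W Z σ (a + 2) → h ≤ (W σ).1) : False := by
  obtain ⟨q, hq, hqZ, e', he', hqσ⟩ := inwardLift_of_topLetter hU hZ (hD Z hZ) hZf (Ne.symm hfσ) he hZσ
  have l1 : (q σ).1 = (Z σ).1 + e' := by rw [hqσ]
  have l2 : (Z σ).1 = h - 2 * e + e := by rw [hZσ]
  have l3 : (q σ).1 ≤ h := level_le_of_inDiamond (hU.1 q hq σ)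
  have hZq : UPartner q Z σ (a + 2) := by
    refine ⟨fun g hg => (hqZ g hg).symm, by omega, ?_⟩
    rw [show (q σ).1 - (Z σ).1 = e' by omega]; exact hqσ
  have l4 : h ≤ (q σ).1 := hlow q hq hZq
  have hee : e' = e := by omega
  have hqσ' : q σ = (h, 0, 0) := by
    rw [hqσ, hee, hZσ]; fin_cases a <;> simp [ray, Prod.ext_iff] <;> omega
  obtain ⟨hnap, -, -, -, -⟩ := charged_letter_facts (t := h - 2 * e) he a
  refine xPlus_sibling_exclusion_sharp hX (u := a + 2) (w := c + 2) hZ hq hn ?_ hfσ ?_ hZq ⟨?_, ?_, ?_⟩ ?_ ?_ ?_ ?_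
  · rw [hZσ]; exact hnap
  · exact fun e => hac (add_right_cancel e).symm
  · intro g hg; rw [hag g hg]; exact (hqZ g hg).symm
  · rw [hnσ, hqσ']; show h - 2 + 1 < h; omega
  · rw [hnσ, hqσ']; fin_cases c <;> simp [ray, Prod.ext_iff] <;> omega
  · rw [hnσ, hqσ']; show h = h - 2 + 1 + 1; omega
  · intro W hW hWu; rw [hqσ']; exact hlow W hW hWu
  · intro W hW _ _ _ _
    rw [hqσ']; exact effective_top_bsub_of_inDiamond (hU.1 W hW σ)
  · intro W hW
    rw [hZf]; exact level_le_of_inDiamond (hU.1 W hW f)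

/-- **TOP-CHILD UNIQUENESS (TCU; PROVED, h-uniform) — the `e = 1` case, hypothesis-free.** Inside `◇_h`, in an `X+`-closed configuration whose
`P`-cells pass typed RULE D, two `P`-cells that agree off one factor `σ`, carry ceiling units `(h−2)I + ℓ_a`, `(h−2)I + ℓ_c` there, and share a top
letter `hI` on a factor `f ≠ σ`, have the same phase. (Equivalently: for every frame with a top letter, at most ONE phase occurs as a ceiling unit
on `σ` among the `P`-cells.) The ten `X+` clauses of the antimix31 core and all `e = 1` TOP clauses of the 32 ◇₁₀ cores are instances; §20's
`noPerpCeilingPair` is the sub-case in which `G₁` supplies the second cell. -/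
theorem topChild_unique_of_ruleD {h : ℤ} {C : MConfig} (hU : C.InDiamond h) (hX : XPlusClosed C) (hD : ∀ P ∈ C.upper, RuleDMu4P C P)
    {Z Z' : MCell} (hZ : Z ∈ C.upper) (hZ' : Z' ∈ C.upper) {σ f : Fin 4} (hfσ : f ≠ σ) (hag : MAgree Z' Z σ) (hZf : Z f = (h, 0, 0))
    {a c : Fin 4} (hZσ : Z σ = diamondLetter (h - 2) 1 a) (hZ'σ : Z' σ = diamondLetter (h - 2) 1 c) : a = c := by
  by_contra hac
  have hZσ1 : Z σ = diamondLetter (h - 2 * 1) 1 a := by rw [hZσ]; norm_num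
  have l2 : (Z σ).1 = h - 2 + 1 := by rw [hZσ]
  refine apexRivalry_of_ruleD hU hX hD hZ hZ' hfσ hZf hac le_rfl hZσ1 hZ'σ hag ?_
  intro W _ hWu
  have h1 : (Z σ).1 < (W σ).1 := hWu.2.1
  omega

/-- **TCU under the hypotheses of `(T_h)` verbatim** (`StaticH1 = RuleDMu4Closed ∧ X+ ∧ A2I−`; `A2I−` and `G₁` unused). -/
theorem topChild_unique {h : ℤ} {C : MConfig} (hU : C.InDiamond h) (hS : C.StaticH1)
    {Z Z' : MCell} (hZ : Z ∈ C.upper) (hZ' : Z' ∈ C.upper) {σ f : Fin 4} (hfσ : f ≠ σ) (hag : MAgree Z' Z σ) (hZf : Z f = (h, 0, 0))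
    {a c : Fin 4} (hZσ : Z σ = diamondLetter (h - 2) 1 a) (hZ'σ : Z' σ = diamondLetter (h - 2) 1 c) : a = c :=
  topChild_unique_of_ruleD hU hS.2.1 (fun P hP => hS.1.2 P hP) hZ hZ' hfσ hag hZf hZσ hZ'σ

/-- **APEX RIVALRY AT DISTANCE 2, with the one absent cell named.** If `Z_σ = (h−4)I + 2ℓ_a` (the second letter of the ceiling staircase) and the
intermediate lift `Z(σ ↦ (h−2)I + ℓ_a)` is ABSENT from `lower`, the rival ceiling unit of any other phase is excluded (the `e = 2` TOP clauses of the
odd 3+1 cores `MUS-B-oddcu-±i` and of the 2+2 perpendicular-class cores are instances; the absence is there a peel fact). -/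
theorem apexRivalry_two {h : ℤ} {C : MConfig} (hU : C.InDiamond h) (hX : XPlusClosed C) (hD : ∀ P ∈ C.upper, RuleDMu4P C P)
    {Z n : MCell} (hZ : Z ∈ C.upper) (hn : n ∈ C.upper) {σ f : Fin 4} (hfσ : f ≠ σ) (hZf : Z f = (h, 0, 0)) {a c : Fin 4} (hac : a ≠ c)
    (hZσ : Z σ = diamondLetter (h - 4) 2 a) (hnσ : n σ = diamondLetter (h - 2) 1 c) (hag : MAgree n Z σ)
    (hmid : ∀ W ∈ C.lower, MAgree W Z σ → W σ ≠ diamondLetter (h - 2) 1 a) : False := by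
  have hZσ2 : Z σ = diamondLetter (h - 2 * 2) 2 a := by rw [hZσ]; norm_num
  have l2 : (Z σ).1 = h - 4 + 2 := by rw [hZσ]
  refine apexRivalry_of_ruleD hU hX hD hZ hn hfσ hZf hac (by norm_num) hZσ2 hnσ hag ?_
  intro W hW hWu
  obtain ⟨hagZW, hlt, hray⟩ := hWu
  by_contra hlow
  have l3 : (W σ).1 ≤ h := level_le_of_inDiamond (hU.1 W hW σ)
  have hd : (W σ).1 - (Z σ).1 = 1 := by omega
  apply hmid W hW (fun g hg => (hagZW g hg).symm)
  rw [hray, hd, hZσ]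
  fin_cases a <;> simp [ray, Prod.ext_iff] <;> omega

/-! ## §23 (g4, v21) TWO `G₁`-COROLLARIES OF TOP-CHILD UNIQUENESS — census-free class exclusions under a top letter (PROVED, h-uniform)

With `G₁` (factor permutations, phase rotation `Δ`) supplying the rival inside the cell's own orbit, §22's `topChild_unique` EXCLUDES, under the
hypotheses of `(T_h)` (`A2I−` unused): **(C1)** a LONE ceiling unit whose other letters are apexes, one of them the top letter `hI` (rival `Δ Z`:
`Δ` fixes apexes); **(C2)** an ANTIPODAL PAIR of ceiling units `ℓ_a, ℓ_{a+2}` plus ANY third ceiling unit `ℓ_b`, the fourth letter being `hI`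
(rival `Δ²` of the pair's transposition: agrees with `Z` off the third unit, carries `ℓ_{b+2}` there) — incl. the «2+1 ANTIPODAL» class
`[hI|ℓ_a|ℓ_a|ℓ_{a+2}]` (an ODD multiplicity inside one antipodal class) and `[hI|ℓ_a|ℓ_{a+2}|ℓ_{a±1}]`. DATA ×1 (◇₁₀ peel, kit j318002
74004db439790926): `P[10I³|8I+ℓ]`, `P[10I|8I²|8I+ℓ]`, `P[10I²|8I|8I+ℓ]` (C1), `P[10I|8I+ℓ₋₁²|8I+ℓ₁]`, `P[10I|8I+ℓ₋₁|8I+ℓ_{±i}|8I+ℓ₁]` (C2) all die in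
ROUND 1 by `Xp`; the uncovered neighbours `P[8I+ℓ₋₁|8I+ℓ₁|10I²]` (the would-be rival is `Z` itself), `P[8I+ℓ₋₁³|10I]`, `P[8I+ℓ₋₁²|8I+ℓᵢ|10I]`
are booked SAT by g55's residual census (census.json, hsemireg l.34327): neither clause of (AP_h) holds at the top-letter level in general, and
(C2) is as sharp as the data on its class. HONEST: FC cells carry no top letter — (C1)–(C2) are silent on them; not (AP_h), not (T_h); HC ∕ HC_CM ∕
HC_AV ∕ H2 NOT proved; width toward H2 = 0. -/

/-- **(C1) NO LONE CEILING UNIT AMONG APEXES UNDER A TOP LETTER (PROVED, h-uniform)**: inside `◇_h`, `X+`- and `G₁`-closed, `P`-cells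
pass typed RULE D ⇒ no `P`-cell has a ceiling unit `(h−2)I + ℓ_a` on one factor and apexes on the other three, one of them `hI`. -/
theorem noLoneCeilingUnit_of_ruleD {h : ℤ} {C : MConfig} (hU : C.InDiamond h) (hX : XPlusClosed C) (hG : C.G1Closed)
    (hD : ∀ P ∈ C.upper, RuleDMu4P C P) {Z : MCell} (hZ : Z ∈ C.upper) {σ f : Fin 4} (hfσ : f ≠ σ) (hZf : Z f = (h, 0, 0))
    {a : Fin 4} (hZσ : Z σ = diamondLetter (h - 2) 1 a) (hapex : ∀ g, g ≠ σ → isApex (Z g)) : False := by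
  obtain ⟨-, -, -, hDu⟩ := hG
  have hY : Z.delta ∈ C.upper := hDu Z hZ
  have hag : MAgree Z.delta Z σ := fun g hg => by
    show deltaPt (Z g) = Z g
    exact deltaPt_of_isApex (hapex g hg)
  have hYσ : Z.delta σ = diamondLetter (h - 2) 1 (a + 3) := by
    show deltaPt (Z σ) = _
    rw [hZσ]; fin_cases a <;> simp [deltaPt]
  have key := topChild_unique_of_ruleD hU hX hD hZ hY hfσ hag hZf hZσ hYσ
  revert key; fin_cases a <;> decide

/-- (C1) under the hypotheses of `(T_h)` verbatim. -/
theorem noLoneCeilingUnit {h : ℤ} {C : MConfig} (hU : C.InDiamond h) (hG : C.G1Closed) (hS : C.StaticH1)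
    {Z : MCell} (hZ : Z ∈ C.upper) {σ f : Fin 4} (hfσ : f ≠ σ) (hZf : Z f = (h, 0, 0))
    {a : Fin 4} (hZσ : Z σ = diamondLetter (h - 2) 1 a) (hapex : ∀ g, g ≠ σ → isApex (Z g)) : False :=
  noLoneCeilingUnit_of_ruleD hU hS.2.1 hG (fun P hP => hS.1.2 P hP) hZ hfσ hZf hZσ hapex

/-- **(C2) NO ANTIPODAL PAIR PLUS A THIRD CEILING UNIT UNDER A TOP LETTER (PROVED, h-uniform)**: same hypotheses ⇒ no `P`-cell carries
ceiling units `(h−2)I + ℓ_a`, `(h−2)I + ℓ_{a+2}`, `(h−2)I + ℓ_b` (any `b`) on three factors and `hI` on the fourth (rival `Δ²(Z ∘ swap σ τ) ∈ upper`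
agrees with `Z` off `ρ` and carries `ℓ_{b+2}` there; `topChild_unique` gives `b = b + 2`). -/
theorem noAntipodalPairUnit_of_ruleD {h : ℤ} {C : MConfig} (hU : C.InDiamond h) (hX : XPlusClosed C) (hG : C.G1Closed)
    (hD : ∀ P ∈ C.upper, RuleDMu4P C P) {Z : MCell} (hZ : Z ∈ C.upper) {σ τ ρ : Fin 4} (hστ : σ ≠ τ) (hσρ : σ ≠ ρ) (hτρ : τ ≠ ρ)
    {a b : Fin 4} (hZσ : Z σ = diamondLetter (h - 2) 1 a) (hZτ : Z τ = diamondLetter (h - 2) 1 (a + 2))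
    (hZρ : Z ρ = diamondLetter (h - 2) 1 b) (hrest : ∀ g, g ≠ σ → g ≠ τ → g ≠ ρ → Z g = (h, 0, 0)) : False := by
  obtain ⟨-, hPu, -, hDu⟩ := hG
  obtain ⟨f, hfσ, hfτ, hfρ⟩ : ∃ f : Fin 4, f ≠ σ ∧ f ≠ τ ∧ f ≠ ρ := by
    fin_cases σ <;> fin_cases τ <;> fin_cases ρ <;> decide
  have hZf : Z f = (h, 0, 0) := hrest f hfσ hfτ hfρ
  have hY : ((Z.perm (Equiv.swap σ τ)).delta).delta ∈ C.upper := hDu _ (hDu _ (hPu _ Z hZ))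
  have Yap : ∀ g, ((Z.perm (Equiv.swap σ τ)).delta).delta g = deltaPt (deltaPt (Z (Equiv.swap σ τ g))) := fun g => rfl
  have hag : MAgree ((Z.perm (Equiv.swap σ τ)).delta).delta Z ρ := by
    intro g hg
    rw [Yap]
    by_cases hgσ : g = σ
    · rw [hgσ, Equiv.swap_apply_left, hZτ, hZσ]
      fin_cases a <;> simp [deltaPt]
    · by_cases hgτ : g = τ
      · rw [hgτ, Equiv.swap_apply_right, hZσ, hZτ]
        fin_cases a <;> simp [deltaPt]
      · rw [Equiv.swap_apply_of_ne_of_ne hgσ hgτ, hrest g hgσ hgτ hg]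
        simp [deltaPt]
  have hYρ : ((Z.perm (Equiv.swap σ τ)).delta).delta ρ = diamondLetter (h - 2) 1 (b + 2) := by
    rw [Yap, Equiv.swap_apply_of_ne_of_ne (Ne.symm hσρ) (Ne.symm hτρ), hZρ]
    fin_cases b <;> simp [deltaPt]
  have key := topChild_unique_of_ruleD hU hX hD hZ hY hfρ hag hZf hZρ hYρ
  revert key; fin_cases b <;> decide

/-- (C2) under the hypotheses of `(T_h)` verbatim; with `b = a` it is the «2+1 antipodal» class `[hI | ℓ_a | ℓ_a | ℓ_{a+2}]`. -/
theorem noAntipodalPairUnit {h : ℤ} {C : MConfig} (hU : C.InDiamond h) (hG : C.G1Closed) (hS : C.StaticH1)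
    {Z : MCell} (hZ : Z ∈ C.upper) {σ τ ρ : Fin 4} (hστ : σ ≠ τ) (hσρ : σ ≠ ρ) (hτρ : τ ≠ ρ)
    {a b : Fin 4} (hZσ : Z σ = diamondLetter (h - 2) 1 a) (hZτ : Z τ = diamondLetter (h - 2) 1 (a + 2))
    (hZρ : Z ρ = diamondLetter (h - 2) 1 b) (hrest : ∀ g, g ≠ σ → g ≠ τ → g ≠ ρ → Z g = (h, 0, 0)) : False :=
  noAntipodalPairUnit_of_ruleD hU hS.2.1 hG (fun P hP => hS.1.2 P hP) hZ hστ hσρ hτρ hZσ hZτ hZρ hrest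

/-- every cell of the `G₁`-orbit of a `P`-cell is a `P`-cell (`G₁` = factor permutations and powers of `Δ`). -/
theorem G1_orbit_mem {C : MConfig} (hG : C.G1Closed) {Z : MCell} (hZ : Z ∈ C.upper) (π : Equiv.Perm (Fin 4)) (k : ℕ) :
    MCell.delta^[k] (Z.perm π) ∈ C.upper := by
  obtain ⟨-, hPu, -, hDu⟩ := hG
  induction k with
  | zero => exact hPu π Z hZ
  | succ n ih => rw [Function.iterate_succ_apply']; exact hDu _ ih

/-- **TOP-CHILD UNIQUENESS AGAINST THE CELL'S OWN `G₁`-ORBIT** (common shape of (C1) = `(π,k) = (1,1)` and (C2) = `(swap σ τ, 2)`): if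
`Δᵏ ∘ π ∈ G₁` carries the `P`-cell `Z` (top letter on `f`) to a cell agreeing with `Z` off `ρ ≠ f`, both with ceiling units on `ρ`, the units
coincide — the statement the reader `tcucheck.py` (a84de4983f0dcc83) tests on the `G₁`-expanded booked SAT supports (0 violations ∕ 8 784 cells). -/
theorem topChild_unique_orbit {h : ℤ} {C : MConfig} (hU : C.InDiamond h) (hG : C.G1Closed) (hS : C.StaticH1) {Z : MCell}
    (hZ : Z ∈ C.upper) (π : Equiv.Perm (Fin 4)) (k : ℕ) {ρ f : Fin 4} (hfρ : f ≠ ρ) (hZf : Z f = (h, 0, 0))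
    (hag : MAgree (MCell.delta^[k] (Z.perm π)) Z ρ) {a c : Fin 4} (hZρ : Z ρ = diamondLetter (h - 2) 1 a)
    (hYρ : MCell.delta^[k] (Z.perm π) ρ = diamondLetter (h - 2) 1 c) : a = c :=
  topChild_unique hU hS hZ (G1_orbit_mem hG hZ π k) hfρ hag hZf hZρ hYρ

/-- the «2+1 antipodal» instance at ◇₁₀: `P[10I|8I+ℓ₋₁|8I+ℓ₋₁|8I+ℓ₁]` (`ℓ₋₁ = 2`, `ℓ₁ = 0`) is absent (peel ×1: round 1, `Xp`). -/
theorem no_top_antipodal21_ten {C : MConfig} (hU : C.InDiamond 10) (hG : C.G1Closed) (hS : C.StaticH1) :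
    mcellOf (10, 0, 0) (diamondLetter 8 1 2) (diamondLetter 8 1 2) (diamondLetter 8 1 0) ∉ C.upper := by
  intro hZ
  refine noAntipodalPairUnit hU hG hS hZ (σ := 3) (τ := 1) (ρ := 2) (a := 0) (b := 2) (by decide) (by decide) (by decide)
    rfl ?_ rfl ?_
  · show diamondLetter 8 1 2 = diamondLetter (10 - 2) 1 (0 + 2); norm_num
  · intro g h1 h2 h3
    have hg : g = 0 := by fin_cases g <;> simp_all
    subst hg; rfl

end Summit.Ventures.HSemireg.Pad4Tower
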